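import Summits.HubbardSuperconductivity.HubbardSuperconductivity.Theorems.BalabanIRBirComplexStableXYRSplitGlueR3
import Summits.HubbardSuperconductivity.HubbardSuperconductivity.Theorems.BalabanIRBirComplexStableXYRStubFatGaussianDomination
import Summits.HubbardSuperconductivity.HubbardSuperconductivity.Theorems.BalabanIRBirComplexStableXYRStubCubicNormalForm
import Summits.HubbardSuperconductivity.HubbardSuperconductivity.Theorems.BalabanIRBirComplexStableXYRStubSubGaussianMargin
import Summits.HubbardSuperconductivity.HubbardSuperconductivity.Theorems.BalabanIRBirComplexStableXYRStubGaussianDefectCost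
import Summits.HubbardSuperconductivity.HubbardSuperconductivity.Theorems.BalabanIRBirComplexStableXYRStubVortexPlaquetteEnergy
import Summits.HubbardSuperconductivity.HubbardSuperconductivity.Theorems.BalabanIRBirComplexStableXYRStubLargeFieldRegulated
import Summits.HubbardSuperconductivity.HubbardSuperconductivity.Theorems.BalabanIRBirComplexStableXYRSingleRegimeGlue
import Summits.HubbardSuperconductivity.HubbardSuperconductivity.Theorems.BalabanIRBirComplexStableXYRInfraredEndgame
import Summits.HubbardSuperconductivity.HubbardSuperconductivity.Theorems.BalabanIRBirComplexStableXYRConjPositivity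
import Summits.HubbardSuperconductivity.HubbardSuperconductivity.Theorems.BalabanIRBirComplexStableXYRPositivityR2Glue
import Summits.HubbardSuperconductivity.HubbardSuperconductivity.Theorems.BirComplexStableXY.Negative.WitnessTable
import Literature.MathematicalPhysics.QuantumFieldTheory.TorusChartVorticity
import Literature.MathematicalPhysics.QuantumFieldTheory.TorusChartFlatCochains
import Summits.HubbardSuperconductivity.HubbardSuperconductivity.Theorems.BalabanIRBirComplexStableXYRLiftIdentity
import Summits.HubbardSuperconductivity.HubbardSuperconductivity.Theorems.BalabanIRBirComplexStableXYRSpinWaveSector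
import Summits.HubbardSuperconductivity.HubbardSuperconductivity.Theorems.BalabanIRBirComplexStableXYRStubTreeGaugeDecomposition
import Summits.HubbardSuperconductivity.HubbardSuperconductivity.Theorems.BalabanIRBirComplexStableXYRStubPinnedTiling
import Summits.HubbardSuperconductivity.HubbardSuperconductivity.Theorems.BalabanIRBirComplexStableXYRStubCoulombSquare
import Summits.HubbardSuperconductivity.HubbardSuperconductivity.Theorems.BalabanIRBirComplexStableXYRStubCurlNormBound
import Summits.HubbardSuperconductivity.HubbardSuperconductivity.Theorems.BalabanIRBirComplexStableXYRStubUnfoldedLiftIdentity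
import Summits.HubbardSuperconductivity.HubbardSuperconductivity.Theorems.BalabanIRBirComplexStableXYRStubBilinSquare
import Summits.HubbardSuperconductivity.HubbardSuperconductivity.Theorems.BalabanIRBirComplexStableXYRStubPathCfgD0
import Summits.HubbardSuperconductivity.HubbardSuperconductivity.Theorems.BalabanIRBirComplexStableXYRStubThinFormCoercive
import Summits.HubbardSuperconductivity.HubbardSuperconductivity.Theorems.BalabanIRBirComplexStableXYRStubWindowFactorisation
import Summits.HubbardSuperconductivity.HubbardSuperconductivity.Theorems.BalabanIRBirComplexStableXYRStubThinFormPolar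
import Summits.HubbardSuperconductivity.HubbardSuperconductivity.Theorems.BalabanIRBirComplexStableXYRStubUnfoldedPartZ
import Summits.HubbardSuperconductivity.HubbardSuperconductivity.Theorems.BalabanIRBirComplexStableXYRStubVortexCost
import Summits.HubbardSuperconductivity.HubbardSuperconductivity.Theorems.BalabanIRBirComplexStableXYRFSRepresentation
import Summits.HubbardSuperconductivity.HubbardSuperconductivity.Theorems.BalabanIRBirComplexStableXYRStubFSRepresentationObs
import Summits.HubbardSuperconductivity.HubbardSuperconductivity.Theorems.BalabanIRBirComplexStableXYRStubLocFactorBounds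
import Summits.HubbardSuperconductivity.HubbardSuperconductivity.Theorems.BalabanIRBirComplexStableXYRStubPathCfgOsc
import Summits.HubbardSuperconductivity.HubbardSuperconductivity.Theorems.BalabanIRBirComplexStableXYRStubSectorClassFunction
import Summits.HubbardSuperconductivity.HubbardSuperconductivity.Theorems.BalabanIRBirComplexStableXYRStubSectorLabel
import Summits.HubbardSuperconductivity.HubbardSuperconductivity.Theorems.BalabanIRBirComplexStableXYRStubWindingSectorCost
import Summits.HubbardSuperconductivity.HubbardSuperconductivity.Theorems.BalabanIRBirComplexStableXYRStubActionConjNeg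
import Summits.HubbardSuperconductivity.HubbardSuperconductivity.Theorems.BalabanIRBirComplexStableXYRStubSectorConjugation
import Summits.HubbardSuperconductivity.HubbardSuperconductivity.Theorems.BalabanIRBirComplexStableXYRStubImGradientZero
import Summits.HubbardSuperconductivity.HubbardSuperconductivity.Theorems.BalabanIRBirComplexStableXYRStubLinearPartSector
import Summits.HubbardSuperconductivity.HubbardSuperconductivity.Theorems.BalabanIRBirComplexStableXYRStubBerryPhaseFactor
import Summits.HubbardSuperconductivity.HubbardSuperconductivity.Theorems.BalabanIRBirComplexStableXYRStubCubicRemainder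
import Summits.HubbardSuperconductivity.HubbardSuperconductivity.Theorems.BalabanIRBirComplexStableXYRStubConstCochainPythagoras
import Summits.HubbardSuperconductivity.HubbardSuperconductivity.Theorems.BalabanIRBirComplexStableXYRStubPathCfgConst
import Summits.HubbardSuperconductivity.HubbardSuperconductivity.Theorems.BalabanIRBirComplexStableXYRStubHolonomyStrainConst
import Summits.HubbardSuperconductivity.HubbardSuperconductivity.Theorems.BalabanIRBirComplexStableXYRStubBerryWeightsReflect
import Summits.HubbardSuperconductivity.HubbardSuperconductivity.Theorems.BalabanIRBirComplexStableXYRStubSpatialBerryZero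
import Summits.HubbardSuperconductivity.HubbardSuperconductivity.Theorems.BalabanIRBirComplexStableXYRStubHolonomyFormSplit
import Summits.HubbardSuperconductivity.HubbardSuperconductivity.Theorems.BalabanIRBirComplexStableXYRStubThetaPositive
import Literature.MathematicalPhysics.QuantumFieldTheory.TphiSeminormTaylor
import Literature.MathematicalPhysics.QuantumFieldTheory.TphiSeminormExp
import Literature.MathematicalPhysics.QuantumFieldTheory.GaussianWeightExpectation
import Literature.MathematicalPhysics.QuantumFieldTheory.TorusChartPinnedGaussian
import Summits.HubbardSuperconductivity.HubbardSuperconductivity.Theorems.BalabanIRBirComplexStableXYRThinFormExact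
import Summits.HubbardSuperconductivity.HubbardSuperconductivity.Theorems.BalabanIRBirComplexStableXYRStubTphiSeminormClmLe
import Summits.HubbardSuperconductivity.HubbardSuperconductivity.Theorems.BalabanIRBirComplexStableXYRStubTphiSeminormCharLe
import Summits.HubbardSuperconductivity.HubbardSuperconductivity.Theorems.BalabanIRBirComplexStableXYRStubTphiSeminormGenFLe
import Summits.HubbardSuperconductivity.HubbardSuperconductivity.Theorems.BalabanIRBirComplexStableXYRStubGenFContDiff
import Summits.HubbardSuperconductivity.HubbardSuperconductivity.Theorems.BalabanIRBirComplexStableXYRStubTaylorPolyFDTwoGenF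
import Summits.HubbardSuperconductivity.HubbardSuperconductivity.Theorems.BalabanIRBirComplexStableXYRStubSpatialHolonomyFormCoercive
import Summits.HubbardSuperconductivity.HubbardSuperconductivity.Theorems.BalabanIRBirComplexStableXYRSmallFieldVertex
import Summits.HubbardSuperconductivity.HubbardSuperconductivity.Theorems.BalabanIRBirComplexStableXYRStubHolonomySectorData
import Summits.HubbardSuperconductivity.HubbardSuperconductivity.Theorems.BalabanIRBirComplexStableXYRStubGenFComplexShiftLe
import Summits.HubbardSuperconductivity.HubbardSuperconductivity.Theorems.BalabanIRBirComplexStableXYRStubTwistIntegralConj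
import Summits.HubbardSuperconductivity.HubbardSuperconductivity.Theorems.BalabanIRBirComplexStableXYRStubSectorModulusFat
import Summits.HubbardSuperconductivity.HubbardSuperconductivity.Theorems.BalabanIRBirComplexStableXYRStubSectorNormalForm
import Summits.HubbardSuperconductivity.HubbardSuperconductivity.Theorems.BalabanIRBirComplexStableXYRStubBondGradientPrecision
import Summits.HubbardSuperconductivity.HubbardSuperconductivity.Theorems.BalabanIRBirComplexStableXYRStubGaussianRealTail
import Summits.HubbardSuperconductivity.HubbardSuperconductivity.Theorems.BalabanIRBirComplexStableXYRStubMultivariateGaussianFunctional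
import Summits.HubbardSuperconductivity.HubbardSuperconductivity.Theorems.BalabanIRBirComplexStableXYRStubBondWeightDefect
import Summits.HubbardSuperconductivity.HubbardSuperconductivity.Theorems.BalabanIRBirComplexStableXYRStubThetaPerturbedPositive
import Summits.HubbardSuperconductivity.HubbardSuperconductivity.Theorems.BalabanIRBirComplexStableXYRStubSpatialThetaSummable
import Mathlib.Analysis.Normed.Algebra.Spectrum
import Summits.HubbardSuperconductivity.HubbardSuperconductivity.Theorems.BalabanIRBirComplexStableXYRTEndResolventBound
import Summits.HubbardSuperconductivity.HubbardSuperconductivity.Theorems.BalabanIRBirComplexStableXYRTEndFeshbachFixedPoint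
import Summits.HubbardSuperconductivity.HubbardSuperconductivity.Theorems.BalabanIRBirComplexStableXYRTEndDressedEigenvectors
import Summits.HubbardSuperconductivity.HubbardSuperconductivity.Theorems.BalabanIRBirComplexStableXYRTEndProjectorPowers
import Summits.HubbardSuperconductivity.HubbardSuperconductivity.Theorems.BalabanIRBirComplexStableXYRTEndComplementDecay
import Summits.HubbardSuperconductivity.HubbardSuperconductivity.Theorems.BalabanIRBirComplexStableXYRTEndMuReal
import Summits.HubbardSuperconductivity.HubbardSuperconductivity.Theorems.BalabanIRBirComplexStableXYRTEndPowerAsymptotics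
import Summits.HubbardSuperconductivity.HubbardSuperconductivity.Theorems.BalabanIRBirComplexStableXYRStubSectorIntegrandExact
import Summits.HubbardSuperconductivity.HubbardSuperconductivity.Theorems.BalabanIRBirComplexStableXYRStubBondGradientTail
import Summits.HubbardSuperconductivity.HubbardSuperconductivity.Theorems.BalabanIRBirComplexStableXYRTEndTraceNormBound
import Summits.HubbardSuperconductivity.HubbardSuperconductivity.Theorems.BalabanIRBirComplexStableXYRTEndTraceRankOne
import Mathlib.Topology.Algebra.Module.Star
import Summits.HubbardSuperconductivity.HubbardSuperconductivity.Theorems.BalabanIRBirComplexStableXYRTEndTraceAsymptotics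
import Summits.HubbardSuperconductivity.HubbardSuperconductivity.Theorems.BalabanIRBirComplexStableXYRTEndFeshbachConjOfJ
import Summits.HubbardSuperconductivity.HubbardSuperconductivity.Theorems.BalabanIRBirComplexStableXYRStubBondWeightTphiLe
import HarnessLib

/-!
# Line `fat-gaussian-defect-calculus` — skeleton (lead a4, continued by leads c4, c5) for crux `BalabanIR.BirComplexStableXYR`
# (stmt-HubbardSuperconductivity-14845)

STATUS (lead c7, 2026-08-17): CHAPTER 1 of T-RG (the exact all-vortex-sector Fröhlich–Spencer representation of `partZ` and of the
numerators) and the chapter-2 sector layer are LANDED — 25 accepted `--supports` files (waves 1–7 + the lead's assembly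
`Theorems/BalabanIRBirComplexStableXYRFSRepresentation.lean` p157389); every `stub_*` below except S5a/S5b is discharged by a tree
theorem.  Open: S5a `stub_complexPositivityR3I3`, S5b `stub_complexInfraredBound` (T-RG chapters 2–3, crux-sized).  Line card:
`Lines/fat_gaussian_defect_calculus.md` (lead c7 edition, with the chapter-2 design).

RESHAPE (lead c6, 2026-08-16T23:55Z): the last open stub S5 `stub_singleRegimeRG` (crux-equivalent blob: both engine
outputs on the (I3) class) is SPLIT along the structure every proof method actually produces, and its observable
endgame is LANDED: S5a `stub_complexPositivityI3` (bare `0 < Re Z` on the (I3) class — open content only at `r ≥ 3`;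
`r = 2` is `birEven_partitionFunction_pos`) and S5b `stub_complexInfraredBound` (the INFRARED BOUND per space-time mode
for the complex measure, `Re ∫ |ẑ_θ(k,q)|² e^{−A} ≤ C·L²M/(c₀K·(ε_L(k)+ε_M(q))) · Re Z`, `k ≠ 0` — the Goldstone
upper bound; for the real XY table it is the FSS infrared bound of `BirSliceXYOrderRP`).  Composition:
`singleRegime_I3 := Theorems.singleRegimeI3_of_positivity_of_infrared S5a S5b` (LANDED p131204,
`Theorems/BalabanIRBirComplexStableXYRInfraredEndgame.lean`: slice sum rule + slice equivalence + `Σ_{k≠0,q} ε⁻¹ ≤ 32L²M`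
for an ARBITRARY complex weight of modulus `≤ 1`, no reflection positivity), then the landed glue as before.  The old
S5 is now a COROLLARY (`stub_singleRegimeRG` below, sorry-free given S5a/S5b).  Also landed for the endgame of S5a at
every `r`: `Theorems.conjPositivity_endgame` (p130769: conjugating symmetry + zero-free activity ray ⇒ polymer
partition function real `> 0`).  OPEN: S5a, S5b (2 sorries).  RESHAPE 2 (lead c6, 2026-08-17T06:00Z): S5a registered as its exact open
content `stub_complexPositivityR3I3` (`r ≥ 3`); the `r = 2` case is glued by the landed `complexPositivityI3_of_ge3`.

Status (lead c5, 2026-08-16T23:40Z): composition glue LANDED as a tree theorem (`birComplexStableXYR_of_singleRegimeI3`,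
p129739) — the crux is now literally `glue (S5 S2 S3 S4 S6 S7)`; S5 handed back `promote-stub` (PROMOTE.md).  Status (lead c4, 2026-08-16T21:55Z): S1 `stub_cubicNormalForm` LANDED (p127699 + kernel p127633, route seat 0),
S2 `stub_fatGaussianDomination` LANDED (p126812, lead a4), S3 `stub_subGaussianMargin` LANDED (p127210, route seat 0),
S4 `stub_gaussianDefectCost` LANDED (p127216 via Literature `DeterminantLowRankDefect` p127169, route seat 0) — all four are
discharged below by the landed theorems of namespace `Theorems.FatGaussian`.  Regulator algebra (α)(β)(γ) of the card
is Literature now (p127106, p127256, p127357, p127525, route seat 1).  RESHAPE (lead c4, 22:00Z): the two remaining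
scale-0 consequences of the lever are registered as stubs S6 `stub_vortexPlaquetteEnergy` (vortex core cost, lever
(iii)) and S7 `stub_largeFieldRegulated` (large-field factor in the regulated sup-norm, lever (ii)) and fed to S5, so
that S5 `stub_singleRegimeRG` (lead) is exactly "the single-regime RG given every scale-0 input".  S6 LANDED p128691,
S7 LANDED p128549 (lead c4 wave 2, 22:10Z).  OPEN: S5 only (1 sorry).

Lead a4's own copy of the crux-plan skeleton (planner crux-plan 2026-08-16T21:00Z, sha 115fae04…; the planner's
file lives in its session folder / gate evidence, not readable from this seat, so the composition below is re-derived
from the five REGISTERED stub signatures, which are copied verbatim from the ledger).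

Stubs (registered, `ledger workitem get stmt-HubbardSuperconductivity-14845`, skeleton sha 115fae04…):
* `stub_cubicNormalForm` (S1, M) — in-class null-Lagrangian re-tabling: for every (U1)(R)(P) table `c` a table `c'`
  with the same real part of `F`, the SAME action on every torus, (U1)(N)(R)(P) kept, `normA c' ≤ C_r·normA c`, and a
  REAL window Hessian (`Σ_n Im(c'_n)(n·v)² = 0`, hypothesis (I3)).
* `stub_fatGaussianDomination` (S2, XS) — `‖e^{−KF}‖ ≤ exp(−(2c₀K/π²)·ΣΣ pv(φ_w−φ_w')²)` (Jordan's inequality on the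
  principal value `toIocMod 2π (−π) ·`).
* `stub_subGaussianMargin` (S3, S) — on windows of oscillation `≤ π`, `Re F ≥ (2c₀r³/(π²B))·Q(φ)`,
  `Q(φ) = −Re Σ c_n (n·φ)²` (twice the Hessian form), stated on `‖e^{−KF}‖`.
* `stub_gaussianDefectCost` (S4, S) — `ε^k·det Q ≤ det(Q − D)` for `Q ≻ 0`, `0 ⪯ D`, `(1−ε)Q − D ⪰ 0`, `rank D ≤ k`.
* `stub_vortexPlaquetteEnergy` (S6, S; lead c4 reshape) — plaquette vorticity `q ∈ ℤ` and `ΣΣ pv² ≥ 2π²q²`.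
* `stub_largeFieldRegulated` (S7, S; lead c4 reshape) — `‖e^{−KF}‖ ≤ e^{−(K/2)Q}·e^{(1−ε₀)(K/2)Q}·e^{−ε₀c₀Kp²}` on
  windows of oscillation in `[p, π]`, `ε₀ = 2c₀r³/(π²B)`.
* `stub_singleRegimeRG` (S5, XL — held by the lead) — S2 → S3 → S4 → S6 → S7 → for every (I3)-admissible table:
  `0 < Re Z` and the slice-averaged two-point deficit `Re ∫ D e^{−A} ≤ C/(c₀K)·Re Z`, uniformly in even `L₀ ≤ L ≤ M`.

Composition (sorry-free given the stubs): `singleRegime_I3 := S5 S2 S3 S4 S6 S7`; `BirComplexStableXYR_of :=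
Theorems.birComplexStableXYR_of_singleRegimeI3 singleRegime_I3` — the landed glue (p129739, lead c5) removes (I3) by S1
(same action ⇒ same `Z` and same deficit integral; budget `C_r·B`) and applies `Theorems.stub_splitGlueR3` (positivity
child at `r ≥ 3`, deficit child at `r ≥ 2`, `Im Z = 0` by (R)-reality, threshold `K ≥ 2C/c₀`) — concludes the crux BY NAME.
S1 is consumed inside the landed glue and only referenced below.
-/

set_option linter.dupNamespace false -- crux workfile namespace `Summit.<S>.<S>.Cruxes…` (D-0017 layout)

noncomputable section

namespace Summit.HubbardSuperconductivity.HubbardSuperconductivity.Cruxes.BirComplexStableXYR.Lines.FatGaussianDefectCalculus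

open scoped BigOperators ComplexConjugate
open MeasureTheory Literature.Probability.LatticeModels
open Summit.HubbardSuperconductivity.BirComplexStableXYNegative
open Summit.HubbardSuperconductivity.HubbardSuperconductivity.Theses.BalabanIR
open Summit.HubbardSuperconductivity.HubbardSuperconductivity.Theorems

/-! ## Registered stubs -/

-- stub S1 (M) `stub_cubicNormalForm` — LANDED p127699 (route prover seat 0) as
-- `Summit.HubbardSuperconductivity.HubbardSuperconductivity.Theorems.FatGaussian.stub_cubicNormalForm`
-- (`Theorems/BalabanIRBirComplexStableXYRStubCubicNormalForm.lean`); it is consumed inside the landed composition glue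
-- `Theorems.srg_of_I3` / `Theorems.birComplexStableXYR_of_singleRegimeI3` (p129739) and therefore no longer restated here.

/-- **stub S2 (XS): fat-Gaussian domination of the modulus weight by coercivity (C).** LANDED p126812. -/
theorem stub_fatGaussianDomination :
    ∀ (r : ℕ) (c₀ K : ℝ) (c : Table r), 0 ≤ c₀ → 0 ≤ K → (∀ φ : W r → ℝ, c₀ * ∑ w, ∑ w', (1 - Real.cos (φ w - φ w')) ≤ (genF c φ).re) → ∀ φ : W r → ℝ, ‖Complex.exp (-((K : ℂ) * genF c φ))‖ ≤ Real.exp (-(2 * c₀ * K / Real.pi ^ 2) * ∑ w, ∑ w', (toIocMod Real.two_pi_pos (-Real.pi) (φ w - φ w')) ^ 2) :=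
  -- LANDED: p126812 (lead a4), `Theorems/BalabanIRBirComplexStableXYRStubFatGaussianDomination.lean`
  Summit.HubbardSuperconductivity.HubbardSuperconductivity.Theorems.FatGaussian.stub_fatGaussianDomination

/-- **stub S3 (S): sub-Gaussian margin — on windows of oscillation `≤ π` the real part of `F` dominates a fixed
multiple of (twice) the Hessian quadratic form `−Re Σ c_n (n·φ)²`.** LANDED p127210. -/
theorem stub_subGaussianMargin :
    ∀ (r : ℕ) (B c₀ K : ℝ) (c : Table r), 0 < B → 0 ≤ c₀ → 0 ≤ K → (∀ n ∈ c.support, ∑ w, n w = 0) → normA c ≤ B → (∀ φ : W r → ℝ, c₀ * ∑ w, ∑ w', (1 - Real.cos (φ w - φ w')) ≤ (genF c φ).re) → ∀ φ : W r → ℝ, (∀ w w' : W r, |φ w - φ w'| ≤ Real.pi) → ‖Complex.exp (-((K : ℂ) * genF c φ))‖ ≤ Real.exp (-(2 * c₀ * (r : ℝ) ^ 3 / (Real.pi ^ 2 * B)) * K * (-c.sum (fun n a => a * (((∑ w, (n w : ℝ) * φ w) ^ 2 : ℝ) : ℂ))).re) :=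
  -- LANDED: p127210 (route prover seat 0), `Theorems/BalabanIRBirComplexStableXYRStubSubGaussianMargin.lean`
  Summit.HubbardSuperconductivity.HubbardSuperconductivity.Theorems.FatGaussian.stub_subGaussianMargin

/-- **stub S4 (S): Gaussian defect cost — a `(1−ε)`-subcritical PSD defect of rank `≤ k` costs at most `ε^{−k}` in
determinant.** LANDED p127216. -/
theorem stub_gaussianDefectCost :
    ∀ (ι : Type) [Fintype ι] [DecidableEq ι] (Q D : Matrix ι ι ℝ) (ε : ℝ) (k : ℕ), 0 < ε → ε ≤ 1 → Q.PosDef → D.PosSemidef → ((1 - ε) • Q - D).PosSemidef → D.rank ≤ k → ε ^ k * Q.det ≤ (Q - D).det :=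
  -- LANDED: p127216 (route prover seat 0), `Theorems/BalabanIRBirComplexStableXYRStubGaussianDefectCost.lean`
  Summit.HubbardSuperconductivity.HubbardSuperconductivity.Theorems.FatGaussian.stub_gaussianDefectCost

/-- **stub S6 (S): vortex plaquette energy in the fat Gaussian.** LANDED p128691.  For any four distinct window sites the
principal values of the phase differences around the 4-cycle sum to `2πq` with `q ∈ ℤ` (the plaquette vorticity),
and the window's fat-Gaussian energy `ΣΣ pv(φ_w − φ_w')²` is at least `2π²q²` (Cauchy–Schwarz over the eight
ordered pairs of the cycle, `|pv(−x)| = |pv(x)|`).  With S2 this is the Villain-type vortex core cost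
`‖e^{−KF}‖ ≤ e^{−(c₀K/π²)ΣΣpv²}·e^{−2c₀Kq²}` of every admissible table (card lever (iii)). -/
theorem stub_vortexPlaquetteEnergy :
    ∀ (r : ℕ) (φ : W r → ℝ) (w₁ w₂ w₃ w₄ : W r), w₁ ≠ w₂ → w₁ ≠ w₃ → w₁ ≠ w₄ → w₂ ≠ w₃ → w₂ ≠ w₄ → w₃ ≠ w₄ → ∃ q : ℤ, toIocMod Real.two_pi_pos (-Real.pi) (φ w₁ - φ w₂) + toIocMod Real.two_pi_pos (-Real.pi) (φ w₂ - φ w₃) + toIocMod Real.two_pi_pos (-Real.pi) (φ w₃ - φ w₄) + toIocMod Real.two_pi_pos (-Real.pi) (φ w₄ - φ w₁) = 2 * Real.pi * q ∧ 2 * Real.pi ^ 2 * (q : ℝ) ^ 2 ≤ ∑ w, ∑ w', (toIocMod Real.two_pi_pos (-Real.pi) (φ w - φ w')) ^ 2 :=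
  -- LANDED: p128691 (lead c4 wave 2), `Theorems/BalabanIRBirComplexStableXYRStubVortexPlaquetteEnergy.lean`
  Summit.HubbardSuperconductivity.HubbardSuperconductivity.Theorems.FatGaussian.stub_vortexPlaquetteEnergy

/-- **stub S7 (S): the scale-0 large-field factor in the regulated sup-norm (Option A).** LANDED p128549.  On a window of
oscillation between `p` and `π`, with `ε₀ := 2c₀r³/(π²B)` and `Q(φ) := Re(−Σ_n c_n (n·φ)²)` (twice the real
window Hessian), `‖e^{−KF(φ)}‖ ≤ e^{−(K/2)Q} · e^{(1−ε₀)(K/2)Q} · e^{−ε₀c₀Kp²}`: the window activity relative to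
the thin Gaussian `e^{−(K/2)Q}`, measured against the `(1−ε₀)`-critical regulator `e^{(1−ε₀)(K/2)Q}`, carries the
small factor `e^{−ε₀c₀Kp²}` (S3 plus the window Hessian coercivity `Q ≥ c₀ΣΣ(φ_w−φ_w')² ≥ 2c₀·osc²`,
landed `cvxr_re_hess_origin_ge`; card lever (ii)). -/
theorem stub_largeFieldRegulated :
    ∀ (r : ℕ) (B c₀ K p : ℝ) (c : Table r), 0 < B → 0 < c₀ → 0 ≤ K → 0 ≤ p → (∀ n ∈ c.support, ∑ w, n w = 0) → c.sum (fun _ a => a) = 0 → normA c ≤ B → (∀ φ : W r → ℝ, c₀ * ∑ w, ∑ w', (1 - Real.cos (φ w - φ w')) ≤ (genF c φ).re) → ∀ φ : W r → ℝ, (∀ w w' : W r, |φ w - φ w'| ≤ Real.pi) → (∃ w w' : W r, p ≤ |φ w - φ w'|) → ‖Complex.exp (-((K : ℂ) * genF c φ))‖ ≤ Real.exp (-(K / 2) * (-c.sum (fun n a => a * (((∑ w, (n w : ℝ) * φ w) ^ 2 : ℝ) : ℂ))).re) * Real.exp ((1 - 2 * c₀ * (r : ℝ) ^ 3 / (Real.pi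 ^ 2 * B)) * (K / 2) * (-c.sum (fun n a => a * (((∑ w, (n w : ℝ) * φ w) ^ 2 : ℝ) : ℂ))).re) * Real.exp (-(2 * c₀ * (r : ℝ) ^ 3 / (Real.pi ^ 2 * B) * c₀ * K * p ^ 2)) :=
  -- LANDED: p128549 (lead c4 wave 2), `Theorems/BalabanIRBirComplexStableXYRStubLargeFieldRegulated.lean`
  Summit.HubbardSuperconductivity.HubbardSuperconductivity.Theorems.FatGaussian.stub_largeFieldRegulated

/-- **stub S5a (XL, held by the lead): bare positivity on the (I3) class at window range `r ≥ 3`.**  For every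
(U1)(N)(A)(C)(R)(P)(I3) table with `r ≥ 3`, `K ≥ K₀(r,B,c₀)` and even `L₀ ≤ L ≤ M`: `0 < Re Z`.  (`Im Z = 0` is the landed
(R)-reality; `r = 2` is the landed `birEven_partitionFunction_pos`, glued below by `complexPositivityI3_of_ge3`; at `r ≥ 3`
the pair-slice transfer operator is only `J`-self-adjoint.  Endgame tool landed: `Theorems.conjPositivity_endgame`.) -/
theorem stub_complexPositivityR3I3 :
    ∀ (r : ℕ) (B c₀ : ℝ), 3 ≤ r → 0 < c₀ → ∃ K₀ : ℝ, ∃ L₀ : ℕ, ∀ K : ℝ, K₀ ≤ K → ∀ c : Table r, (∀ n ∈ c.support, ∑ w, n w = 0) → c.sum (fun _ a => a) = 0 → normA c ≤ B → (∀ φ : W r → ℝ, c₀ * ∑ w, ∑ w', (1 - Real.cos (φ w - φ w')) ≤ (genF c φ).re) → (∀ n : Freq r, c (fun w => n (w.1, w.2.1, Fin.rev w.2.2)) = (starRingEnd ℂ) (c (-n))) → (∀ n : Freq r, c (fun w => n (Fin.rev w.1, Fin.rev w.2.1, w.2.2)) = c n) → (∀ v : W r → ℝ, c.sum (fun n a =>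 a.im * (∑ w, (n w : ℝ) * v w) ^ 2) = 0) → ∀ (L M : ℕ) [NeZero L] [NeZero M], L₀ ≤ L → L ≤ M → Even L → Even M → 0 < (partZ K c L M).re := by
  sorry

/-- Positivity on the (I3) class for every `r ≥ 2` (the shape consumed by the composition): S5a plus the LANDED `r = 2`
case (`Theorems.complexPositivityI3_of_ge3`, lead c6). -/
theorem stub_complexPositivityI3 :
    ∀ (r : ℕ) (B c₀ : ℝ), 2 ≤ r → 0 < c₀ → ∃ K₀ : ℝ, ∃ L₀ : ℕ, ∀ K : ℝ, K₀ ≤ K → ∀ c : Table r, (∀ n ∈ c.support, ∑ w, n w = 0) → c.sum (fun _ a => a) = 0 → normA c ≤ B → (∀ φ : W r → ℝ, c₀ * ∑ w, ∑ w', (1 - Real.cos (φ w - φ w')) ≤ (genF c φ).re) → (∀ n : Freq r, c (fun w => n (w.1, w.2.1, Fin.rev w.2.2)) = (starRingEnd ℂ) (c (-n))) → (∀ n : Freq r, c (fun w => n (Fin.rev w.1, Fin.rev w.2.1, w.2.2)) = c n) → (∀ v : W r → ℝ, c.sum (fun n a => a.im * (∑ w, (n w : ℝ) * v w) ^ 2)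 = 0) → ∀ (L M : ℕ) [NeZero L] [NeZero M], L₀ ≤ L → L ≤ M → Even L → Even M → 0 < (partZ K c L M).re :=
  complexPositivityI3_of_ge3 stub_complexPositivityR3I3

/-- **stub S5b (XL): the complex infrared bound.**  For every (U1)(N)(A)(C)(R)(P)(I3) table, `K ≥ K₀(r,B,c₀)`, even
`L₀ ≤ L ≤ M`, every spatial momentum `k ≠ 0` and every temporal momentum `q`:
`Re ∫ |Σ_s e^{iθ_s} χ_k(s₁)χ_q(s₂)|² e^{−A} ≤ C·L²M/(c₀K·(ε_L(k) + ε_M(q))) · Re Z` — the Goldstone-propagator upper bound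
on the structure factor of the complex measure, uniformly in the volume (for the real XY table: the FSS infrared bound
with `C = O(1)`; at the Gaussian level: `birComplexStableXYR_spinWave` / `gaussianCoercive`). -/
theorem stub_complexInfraredBound :
    ∀ (r : ℕ) (B c₀ : ℝ), 2 ≤ r → 0 < c₀ → ∃ K₀ : ℝ, ∃ L₀ : ℕ, ∃ C : ℝ, ∀ K : ℝ, K₀ ≤ K → ∀ c : Table r, (∀ n ∈ c.support, ∑ w, n w = 0) → c.sum (fun _ a => a) = 0 → normA c ≤ B → (∀ φ : W r → ℝ, c₀ * ∑ w, ∑ w', (1 - Real.cos (φ w - φ w')) ≤ (genF c φ).re) → (∀ n : Freq r, c (fun w => n (w.1, w.2.1, Fin.rev w.2.2)) = (starRingEnd ℂ) (c (-n))) → (∀ n : Freq r, c (fun w => n (Fin.rev w.1, Fin.rev w.2.1, w.2.2)) = c n) → (∀ v : W r → ℝ, c.sum (fun n a => a.im * (∑ w, (n w : ℝ) * v w) ^ 2) = 0) → ∀ (L M : ℕ) [NeZero L] [NeZero M], L₀ ≤ L → L ≤ M → Even L → Even M → ∀ k ∈ Finset.univ.erase (0 : TorusSite 2 L), ∀ q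 : TorusSite 1 M, (∫ θ in cube L M, (((‖∑ s : Λ L M, Complex.exp (Complex.I * (θ s : ℂ)) * (torusChar k s.1 * torusChar q (fun _ => s.2))‖ ^ 2 : ℝ)) : ℂ) * Complex.exp (-(action K c L M θ))).re ≤ C * ((L : ℝ) ^ 2 * M) / (c₀ * K * (dispersion (latticeMomentum L k) + dispersion (latticeMomentum M q))) * (partZ K c L M).re := by
  sorry


/-! ## Chapter 1 of T-RG (lead c7): the exact Fröhlich–Spencer unfolding of the torus integral — registered stubs

For an ARBITRARY `2π`-periodic window weight the crux's torus integral unfolds EXACTLY as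
`∫_{[0,2π]^Λ} G = Σ'_{a ∈ C¹_T(ℤ)} ∫_{φ 0 ∈ [0,2π)} G(φ) Π_b χ_v(d₀φ_b − 2πa_b) dφ` (bond partition of unity — landed
`lccb_liftIdentity` — regrouped by the gauge classes `a + d₀n` of integer `1`-cochains in the axial TREE GAUGE `T`, and unfolded
to the pinned real field space by tiling it with the `2πn`-translates of the cube, `n 0 = 0`), after which the thin (Hessian)
Gaussian is inserted window-wise through the window path identity `F_s(φ) = F_s^{path}(d₀φ − 2πa)` and the square is completed:
`Z = 2π Σ_a e^{−(K/2)𝒬(σ_a)} ∫ e^{−(K/2)⟨ψ,Hψ⟩} Π_s R_s(d₀ψ − σ_a)`, `σ_a = 2πa − d₀ψ_a` the Coulomb strain of the vortex current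
`d₁a`, with the volume-uniform Gaussian vortex cost `𝒬(σ_a) ≥ (π²c₀/4d)·Σ_□ (d₁a)²`.  The four generic inputs are the stubs
below (tree-gauge decomposition, pinned tiling, Coulomb square completion, curl-norm bound); the model-specific assembly
(window path identity, thin-Gaussian insertion, the representation of `partZ` and of the slice numerators) is the lead's.
S5a/S5b are unchanged: the representation is the object T-RG expands, not a shrinking of T-RG. -/

section Unfolding

open Literature.MathematicalPhysics.QuantumFieldTheory
open scoped Matrix

/-- **stub U1 (M): tree-gauge decomposition of integer `1`-cochains.** LANDED p154567.  On a charted torus every integer `1`-cochain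
`a` is, in exactly one way, `a = a_T + d₀ n` with `n 0 = 0` and `a_T` vanishing on the axial spanning tree
`T = {(y, μ) : y_ν = 0 for all ν > μ, y_μ + 1 < N_μ}` (the edges of the lexicographic staircases from the origin):
equivalently, there is a unique `n` with `n 0 = 0` whose coboundary agrees with `a` on `T` (`n = prim a`, the axial
primitive; uniqueness because `T` spans). -/
theorem stub_treeGaugeDecomposition :
    ∀ (Λ : Type) [AddCommGroup Λ] (d : ℕ) (F : TorusChart Λ d) (a : Λ → Fin d → ℤ),
      ∃! n : Λ → ℤ, n 0 = 0 ∧ ∀ (y : Λ) (μ : Fin d), (∀ ν : Fin d, μ < ν → F.cval ν y = 0) →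
        F.cval μ y + 1 < F.period μ → a y μ = n (y + F.gen μ) - n y :=
  -- LANDED: p154567 (lead c7 wave 1), `Theorems/BalabanIRBirComplexStableXYRStubTreeGaugeDecomposition.lean`
  FSUnfolding.stub_treeGaugeDecomposition

/-- **stub U2 (S/M): pinned tiling.** LANDED p154622.  The pinned field space `{φ : φ x₀ ∈ [0,2π)}` is the disjoint union of the
translates `[0,2π)^ι + 2πn` over the integer fields `n` with `n x₀ = 0`, so the integral of an integrable `f` over it is
the sum of the cube integrals of its translates (translation invariance of Lebesgue measure on `ι → ℝ`). -/
theorem stub_pinnedTiling :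
    ∀ (ι : Type) [Fintype ι] [DecidableEq ι] (x₀ : ι) (f : (ι → ℝ) → ℂ),
      IntegrableOn f {φ : ι → ℝ | φ x₀ ∈ Set.Ico 0 (2 * Real.pi)} →
      HasSum (fun n : {n : ι → ℤ // n x₀ = 0} =>
          ∫ φ in Set.pi Set.univ (fun _ : ι => Set.Ico (0:ℝ) (2 * Real.pi)),
            f (fun x => φ x + 2 * Real.pi * ((n.1 x : ℤ) : ℝ)))
        (∫ φ in {φ : ι → ℝ | φ x₀ ∈ Set.Ico 0 (2 * Real.pi)}, f φ) :=
  -- LANDED: p154622 (lead c7 wave 1), `Theorems/BalabanIRBirComplexStableXYRStubPinnedTiling.lean`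
  FSUnfolding.stub_pinnedTiling

/-- **stub Q1 (M): Coulomb square completion.** LANDED p154737.  For a positive semidefinite form `H` on `1`-cochains (index `k`) and a
linear map `D` from `0`-cochains (index `m`) — here `D = d₀` and `H` the window Hessian form — the normal equations
`Dᵀ H D ψ = Dᵀ H a` are solvable for every `a` (`Dᵀ H a ⊥ ker (Dᵀ H D)` because `vᵀDᵀHDv = 0 ⇒ HDv = 0`), and for any
solution `ψ` the square completes exactly: `⟨Dφ − a, H(Dφ − a)⟩ = ⟨D(φ−ψ), HD(φ−ψ)⟩ + ⟨a − Dψ, H(a − Dψ)⟩` (the cross term is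
the normal equation).  `σ := a − Dψ` is the Coulomb strain, `⟨σ,Hσ⟩` the vortex-loop energy. -/
theorem stub_coulombSquare :
    ∀ (m k : Type) [Fintype m] [Fintype k] [DecidableEq m] [DecidableEq k]
      (H : Matrix k k ℝ) (D : Matrix k m ℝ) (a : k → ℝ), H.PosSemidef →
      ∃ ψ : m → ℝ, D.transpose.mulVec (H.mulVec (D.mulVec ψ)) = D.transpose.mulVec (H.mulVec a) ∧
        ∀ φ : m → ℝ, (D.mulVec φ - a) ⬝ᵥ H.mulVec (D.mulVec φ - a) =
          (D.mulVec (φ - ψ)) ⬝ᵥ H.mulVec (D.mulVec (φ - ψ)) + (a - D.mulVec ψ) ⬝ᵥ H.mulVec (a - D.mulVec ψ) :=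
  -- LANDED: p154737 (lead c7 wave 1), `Theorems/BalabanIRBirComplexStableXYRStubCoulombSquare.lean`
  FSUnfolding.stub_coulombSquare

/-- **stub V1 (S): curl-norm bound.** LANDED p155142.  On a charted torus with `d` directions the plaquette circulations of a real
`1`-cochain are controlled by its `ℓ²` norm: `Σ_{x,i,j} (d₁ω)(x,i,j)² ≤ 16 d · Σ_{x,i} ω(x,i)²` (each circulation is a signed
sum of four edge values, `(Σ₄)² ≤ 4Σ₄(·)²`, and `x ↦ x + e_i` is a bijection of the site group).  With `d₁(2πa − d₀ψ) =
2π d₁ a` (integer) and the coercivity `𝒬 ≥ c₀‖·‖²` of the thin form this is the volume-uniform Gaussian vortex cost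
`𝒬(σ_a) ≥ (π² c₀ / (4 d)) · #{vortex plaquettes}`. -/
theorem stub_curlNormBound :
    ∀ (Λ : Type) [AddCommGroup Λ] [Fintype Λ] (d : ℕ) (F : TorusChart Λ d) (ω : Λ → Fin d → ℝ),
      ∑ x : Λ, ∑ i : Fin d, ∑ j : Fin d, (F.d₁ ω x i j) ^ 2 ≤ 16 * (d : ℝ) * ∑ x : Λ, ∑ i : Fin d, (ω x i) ^ 2 :=
  -- LANDED: p155142 (lead c7 wave 1; = seat 0's Literature `TorusChart.sum_d₁_sq_le` p154470), `Theorems/BalabanIRBirComplexStableXYRStubCurlNormBound.lean`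
  FSUnfolding.stub_curlNormBound


/-! ### Chapter 1, wave 2 (lead c7): unfolded lift identity, abstract square completion, window path identity,
coercivity of the thin form on all `1`-cochains -/

/-- **stub U3 (M/L): the unfolded lift identity on a charted torus.** LANDED p156704.  For a continuous `2πℤ^Λ`-periodic `g`, the
cube integral `∫_{[0,2π)^Λ} g` is the `HasSum`, over the integer `1`-cochains `a` in TREE GAUGE (vanishing on the axial
comb tree), of the integrals over the PINNED field space `{φ : φ 0 ∈ [0,2π)}` of `g` times the smoothed-box bond weight
`Π_{x,i} χ_v(d₀φ(x,i) − 2π a(x,i))`.  (Bond partition of unity `hasSum_integral_mul_prod` on the cube over ALL `a`;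
regroup `a = a_T + d₀ n`, `n 0 = 0`, by `stub_treeGaugeDecomposition`; the fibre over `a_T` is the pinned tiling
`stub_pinnedTiling` / `TorusChart.hasSum_setIntegral_cubeIco_vadd` because `W(φ, a_T + d₀n) = W(φ − 2πn, a_T)` and `g`
is periodic; integrability on the pinned set from `Σ_n W(·, a_T − d₀ n) ≤ 1`.) -/
theorem stub_unfoldedLiftIdentity :
    ∀ (Λ : Type) [AddCommGroup Λ] [Fintype Λ] [DecidableEq Λ] (d : ℕ) (F : TorusChart Λ d) (v : NNReal), v ≠ 0 →
      ∀ g : (Λ → ℝ) → ℂ, Continuous g →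
        (∀ (φ : Λ → ℝ) (n : Λ → ℤ), g (fun x => φ x + 2 * Real.pi * (n x : ℝ)) = g φ) →
        HasSum (fun a : {a : Λ → Fin d → ℤ // ∀ (y : Λ) (μ : Fin d), (∀ ν : Fin d, μ < ν → F.cval ν y = 0) →
              F.cval μ y + 1 < F.period μ → a y μ = 0} =>
            ∫ φ in {φ : Λ → ℝ | φ 0 ∈ Set.Ico 0 (2 * Real.pi)},
              g φ * ∏ x : Λ, ∏ i : Fin d, ((∫ t in Set.Icc (-Real.pi) Real.pi,
                ProbabilityTheory.gaussianPDFReal 0 v (F.d₀ φ x i - 2 * Real.pi * (a.1 x i : ℝ) - t) : ℝ) : ℂ))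
          (∫ φ in Set.pi Set.univ (fun _ : Λ => Set.Ico (0:ℝ) (2 * Real.pi)), g φ) :=
  -- LANDED: p156704 (lead c7 wave 2), `Theorems/BalabanIRBirComplexStableXYRStubUnfoldedLiftIdentity.lean`
  FSUnfolding.stub_unfoldedLiftIdentity

/-- **stub Q1′ (M): abstract Coulomb square completion.** LANDED p156180.  For a symmetric positive-semidefinite bilinear form `B` on
a finite-dimensional real space `V`, a linear `T : U → V` and `a ∈ V`, there is `ψ ∈ U` solving the normal equations
`B (T u) (a − T ψ) = 0` for all `u`, and then `B(Tφ − a, Tφ − a) = B(T(φ−ψ), T(φ−ψ)) + B(a − Tψ, a − Tψ)` for every `φ`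
(module-level form of the landed matrix statement `stub_coulombSquare`; used with `U` = pinned `0`-cochains, `V` = real
`1`-cochains, `T = d₀`, `B` = polar form of the thin Gaussian form). -/
theorem stub_bilinSquare :
    ∀ (U V : Type) [AddCommGroup U] [Module ℝ U] [AddCommGroup V] [Module ℝ V]
      [FiniteDimensional ℝ U] [FiniteDimensional ℝ V]
      (B : V →ₗ[ℝ] V →ₗ[ℝ] ℝ) (T : U →ₗ[ℝ] V) (a : V),
      (∀ v w : V, B v w = B w v) → (∀ v : V, 0 ≤ B v v) →
      ∃ ψ : U, (∀ u : U, B (T u) (a - T ψ) = 0) ∧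
        ∀ φ : U, B (T φ - a) (T φ - a) = B (T (φ - ψ)) (T (φ - ψ)) + B (a - T ψ) (a - T ψ) :=
  -- LANDED: p156180 (lead c7 wave 2), `Theorems/BalabanIRBirComplexStableXYRStubBilinSquare.lean`
  FSUnfolding.stub_bilinSquare

/-- **stub P1a (S/M): the window path identity at the level of configurations.** LANDED p156185.  On the engine's torus
`Λ L M = (Fin 2 → ZMod L) × ZMod M` (chart `TorusChart.piProdZMod 2 L M`: directions `0,1` spatial, `2` temporal) the
staircase sum inside the window with corner `s` — `w.1` edges in direction `0`, then `w.2.1` in direction `1`, then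
`w.2.2` in direction `2` — of the shifted gradient `d₀φ − 2πa` equals `φ(sh L M s w) − φ(s)` minus `2π` times the
(integer) staircase sum of `a`.  (`lineSum_sub`, `lineSum_d₀`, `map_lineSum`; the endpoint
`s + w.1•e₀ + w.2.1•e₁ + w.2.2•e₂ = sh L M s w`.) -/
theorem stub_pathCfg_d0 :
    ∀ (r L M : ℕ) [NeZero L] [NeZero M] (φ : Λ L M → ℝ) (a : Λ L M → Fin 3 → ℤ) (s : Λ L M) (w : W r),
      (TorusChart.piProdZMod 2 L M).lineSum
          (fun x i => (TorusChart.piProdZMod 2 L M).d₀ φ x i - 2 * Real.pi * (a x i : ℝ)) 0 (w.1 : ℕ) s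
        + (TorusChart.piProdZMod 2 L M).lineSum
          (fun x i => (TorusChart.piProdZMod 2 L M).d₀ φ x i - 2 * Real.pi * (a x i : ℝ)) 1 (w.2.1 : ℕ)
            (s + (w.1 : ℕ) • (TorusChart.piProdZMod 2 L M).gen 0)
        + (TorusChart.piProdZMod 2 L M).lineSum
          (fun x i => (TorusChart.piProdZMod 2 L M).d₀ φ x i - 2 * Real.pi * (a x i : ℝ)) 2 (w.2.2 : ℕ)
            (s + (w.1 : ℕ) • (TorusChart.piProdZMod 2 L M).gen 0 + (w.2.1 : ℕ) • (TorusChart.piProdZMod 2 L M).gen 1)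
      = φ (sh L M s w) - φ s - 2 * Real.pi *
          (((TorusChart.piProdZMod 2 L M).lineSum a 0 (w.1 : ℕ) s
            + (TorusChart.piProdZMod 2 L M).lineSum a 1 (w.2.1 : ℕ) (s + (w.1 : ℕ) • (TorusChart.piProdZMod 2 L M).gen 0)
            + (TorusChart.piProdZMod 2 L M).lineSum a 2 (w.2.2 : ℕ)
              (s + (w.1 : ℕ) • (TorusChart.piProdZMod 2 L M).gen 0
                + (w.2.1 : ℕ) • (TorusChart.piProdZMod 2 L M).gen 1) : ℤ) : ℝ) :=
  -- LANDED: p156185 (lead c7 wave 2), `Theorems/BalabanIRBirComplexStableXYRStubPathCfgD0.lean`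
  FSUnfolding.stub_pathCfg_d0

/-- **stub P1e (M): coercivity of the thin Gaussian form on ALL real `1`-cochains.** LANDED p156515.  Under (N) and (C) the summed
window Hessian form evaluated on the window path configurations of an arbitrary real `1`-cochain `ω` dominates
`2c₀‖ω‖²` (window range `r ≥ 2`): in the window with corner `s` the path configuration takes the value `0` at the corner
and `ω(s,i)` at the unit vector `e_i`, and the window-level second-order condition `cvxr_re_hess_origin_ge` gives
`Q_c(v) ≥ c₀ ΣΣ (v_w − v_w')²`.  This makes the thin form coercive off the exact cochains too, whence the volume-uniform
Gaussian vortex cost through `stub_curlNormBound`. -/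
theorem stub_thinFormCoercive :
    ∀ (r : ℕ) (c : Table r) (c₀ : ℝ), 2 ≤ r → 0 < c₀ → c.sum (fun _ a => a) = 0 →
      (∀ φ : W r → ℝ, c₀ * ∑ w, ∑ w', (1 - Real.cos (φ w - φ w')) ≤ (genF c φ).re) →
      ∀ (L M : ℕ) [NeZero L] [NeZero M] (ω : Λ L M → Fin 3 → ℝ),
        2 * c₀ * ∑ x : Λ L M, ∑ i : Fin 3, (ω x i) ^ 2 ≤
          ∑ s : Λ L M, (-c.sum (fun n a => a * (((∑ w : W r, (n w : ℝ) *
            ((TorusChart.piProdZMod 2 L M).lineSum ω 0 (w.1 : ℕ) s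
              + (TorusChart.piProdZMod 2 L M).lineSum ω 1 (w.2.1 : ℕ) (s + (w.1 : ℕ) • (TorusChart.piProdZMod 2 L M).gen 0)
              + (TorusChart.piProdZMod 2 L M).lineSum ω 2 (w.2.2 : ℕ)
                (s + (w.1 : ℕ) • (TorusChart.piProdZMod 2 L M).gen 0
                  + (w.2.1 : ℕ) • (TorusChart.piProdZMod 2 L M).gen 1))) ^ 2 : ℝ) : ℂ))).re :=
  -- LANDED: p156515 (lead c7 wave 2), `Theorems/BalabanIRBirComplexStableXYRStubThinFormCoercive.lean`
  FSUnfolding.stub_thinFormCoercive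


/-! ### Chapter 1, wave 3 (lead c7): window factorisation, polar form, unfolded `partZ`, vortex cost, and the
Fröhlich–Spencer representation of `partZ` (assembly target)

Convention for the remaining statements (the tree's "defining hypothesis" idiom, cf. `birAct_*`): the window path
configuration and the window Hessian form enter through functions `P`, `Q` constrained by
`hP : ∀ ω s w, P ω s w = <staircase sum of ω inside the window with corner s>` and
`hQ : ∀ u, Q u = Re(−Σ_n c_n (n·u)²)`, so that signatures stay readable and definition-free. -/

/-- **stub R1 (M): window factorisation of the Gibbs factor through the shifted gradient.** LANDED p157121.  For every real field
`φ`, every INTEGER `1`-cochain `a` and every table with (U1): `e^{−A(φ)} = e^{−(K/2)·Σ_s Q(P_s(d₀φ − 2πa))} ·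
Π_s exp(−K·genF c (P_s(d₀φ − 2πa)) + (K/2)·Q(P_s(d₀φ − 2πa)))` — the window path identity
`genF c (φ ∘ sh s) = genF c (P_s(d₀φ − 2πa))` ((U1): `birAct_F_rotate`; periodicity: `genF_sub_two_pi_mul_int`; telescoping:
`stub_pathCfg_d0`) followed by `exp_sum`/`exp_add` bookkeeping.  The second factor is the product of the bounded local
complex factors `R_s`; the first is the thin Gaussian. -/
theorem stub_windowFactorisation :
    ∀ (r : ℕ) (K : ℝ) (c : Table r), (∀ n ∈ c.support, ∑ w, n w = 0) → ∀ (L M : ℕ) [NeZero L] [NeZero M]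
      (P : (Λ L M → Fin 3 → ℝ) → Λ L M → W r → ℝ),
      (∀ (ω : Λ L M → Fin 3 → ℝ) (s : Λ L M) (w : W r), P ω s w =
        (TorusChart.piProdZMod 2 L M).lineSum ω 0 (w.1 : ℕ) s
          + (TorusChart.piProdZMod 2 L M).lineSum ω 1 (w.2.1 : ℕ) (s + (w.1 : ℕ) • (TorusChart.piProdZMod 2 L M).gen 0)
          + (TorusChart.piProdZMod 2 L M).lineSum ω 2 (w.2.2 : ℕ)
            (s + (w.1 : ℕ) • (TorusChart.piProdZMod 2 L M).gen 0 + (w.2.1 : ℕ) • (TorusChart.piProdZMod 2 L M).gen 1)) →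
      ∀ (Q : (W r → ℝ) → ℝ),
      (∀ u : W r → ℝ, Q u = (-c.sum (fun n a => a * (((∑ w, (n w : ℝ) * u w) ^ 2 : ℝ) : ℂ))).re) →
      ∀ (φ : Λ L M → ℝ) (a : Λ L M → Fin 3 → ℤ),
        Complex.exp (-(action K c L M φ)) =
          Complex.exp (-(((K / 2 * ∑ s : Λ L M,
              Q (P (fun x i => (TorusChart.piProdZMod 2 L M).d₀ φ x i - 2 * Real.pi * (a x i : ℝ)) s)) : ℝ) : ℂ)) *
          ∏ s : Λ L M, Complex.exp
            (-((K : ℂ) * genF c (P (fun x i => (TorusChart.piProdZMod 2 L M).d₀ φ x i - 2 * Real.pi * (a x i : ℝ)) s))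
              + (((K / 2 * Q (P (fun x i => (TorusChart.piProdZMod 2 L M).d₀ φ x i - 2 * Real.pi * (a x i : ℝ)) s)) : ℝ) : ℂ)) :=
  -- LANDED: p157121 (lead c7 wave 3), `Theorems/BalabanIRBirComplexStableXYRStubWindowFactorisation.lean`
  FSUnfolding.stub_windowFactorisation

/-- **stub R4 (M): the polar (bilinear) form of the thin Gaussian form.** LANDED p157172.  The thin form `ω ↦ Σ_s Q(P_s ω)` on real
`1`-cochains is a quadratic form: there is a symmetric real bilinear form `B` with `B ω ω = Σ_s Q(P_s ω)` (`P_s` is linear in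
`ω` — `lineSum` is additive —, and `Q(u) = Σ_{n ∈ supp c} Re(−c_n)·(n·u)²` is a signed sum of squares of linear functionals;
`B(ω, ω') := Σ_s Σ_n Re(−c_n)(n·P_s ω)(n·P_s ω')`).  This is what the square completion `stub_bilinSquare` consumes. -/
theorem stub_thinFormPolar :
    ∀ (r : ℕ) (c : Table r) (L M : ℕ) [NeZero L] [NeZero M]
      (P : (Λ L M → Fin 3 → ℝ) → Λ L M → W r → ℝ),
      (∀ (ω : Λ L M → Fin 3 → ℝ) (s : Λ L M) (w : W r), P ω s w =
        (TorusChart.piProdZMod 2 L M).lineSum ω 0 (w.1 : ℕ) s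
          + (TorusChart.piProdZMod 2 L M).lineSum ω 1 (w.2.1 : ℕ) (s + (w.1 : ℕ) • (TorusChart.piProdZMod 2 L M).gen 0)
          + (TorusChart.piProdZMod 2 L M).lineSum ω 2 (w.2.2 : ℕ)
            (s + (w.1 : ℕ) • (TorusChart.piProdZMod 2 L M).gen 0 + (w.2.1 : ℕ) • (TorusChart.piProdZMod 2 L M).gen 1)) →
      ∀ (Q : (W r → ℝ) → ℝ),
      (∀ u : W r → ℝ, Q u = (-c.sum (fun n a => a * (((∑ w, (n w : ℝ) * u w) ^ 2 : ℝ) : ℂ))).re) →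
      ∃ B : (Λ L M → Fin 3 → ℝ) →ₗ[ℝ] (Λ L M → Fin 3 → ℝ) →ₗ[ℝ] ℝ,
        (∀ ω ω' : Λ L M → Fin 3 → ℝ, B ω ω' = B ω' ω) ∧
        ∀ ω : Λ L M → Fin 3 → ℝ, B ω ω = ∑ s : Λ L M, Q (P ω s) :=
  -- LANDED: p157172 (lead c7 wave 3), `Theorems/BalabanIRBirComplexStableXYRStubThinFormPolar.lean`
  FSUnfolding.stub_thinFormPolar

/-- **stub R8 (S/M): the unfolded partition function.** LANDED p157111.  `partZ` is the `HasSum`, over tree-gauge integer `1`-cochains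
`a`, of the pinned integrals of the Gibbs factor times the smoothed-box bond weight of `d₀φ − 2πa`
(`stub_unfoldedLiftIdentity` for `g = e^{−A}`, continuous (`birAct_continuous_action`) and `2πℤ^Λ`-periodic
(`birAct_action_periodic`); the crux's closed cube and the half-open cube differ by a null set,
`TorusChart.cubeIco_ae_eq_cubeIcc`). -/
theorem stub_unfoldedPartZ :
    ∀ (r : ℕ) (K : ℝ) (c : Table r) (L M : ℕ) [NeZero L] [NeZero M] (v : NNReal), v ≠ 0 →
      HasSum (fun a : {a : Λ L M → Fin 3 → ℤ // ∀ (y : Λ L M) (μ : Fin 3),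
            (∀ ν : Fin 3, μ < ν → (TorusChart.piProdZMod 2 L M).cval ν y = 0) →
            (TorusChart.piProdZMod 2 L M).cval μ y + 1 < (TorusChart.piProdZMod 2 L M).period μ → a y μ = 0} =>
          ∫ φ in {φ : Λ L M → ℝ | φ 0 ∈ Set.Ico 0 (2 * Real.pi)},
            Complex.exp (-(action K c L M φ)) *
              ∏ x : Λ L M, ∏ i : Fin 3, ((∫ t in Set.Icc (-Real.pi) Real.pi, ProbabilityTheory.gaussianPDFReal 0 v
                ((TorusChart.piProdZMod 2 L M).d₀ φ x i - 2 * Real.pi * (a.1 x i : ℝ) - t) : ℝ) : ℂ))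
        (partZ K c L M) :=
  -- LANDED: p157111 (lead c7 wave 3), `Theorems/BalabanIRBirComplexStableXYRStubUnfoldedPartZ.lean`
  FSUnfolding.stub_unfoldedPartZ

/-- **stub V2 (S): the volume-uniform Gaussian vortex cost.** LANDED p157119.  For every integer `1`-cochain `a` and every real field `ψ`
the thin form of the strain `σ = 2πa − d₀ψ` is at least `(π²c₀/6)·Σ_{x,i,j} (d₁a)(x,i,j)²` — coercivity
`stub_thinFormCoercive` (`𝒬 ≥ 2c₀‖σ‖²`), the curl bound `stub_curlNormBound` (`‖d₁σ‖² ≤ 48‖σ‖²`, `d = 3`) and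
`d₁σ = 2π·d₁a` (`d₁ ∘ d₀ = 0`): at least `π²c₀/6` per unit of squared vorticity, uniformly in `L, M`. -/
theorem stub_vortexCost :
    ∀ (r : ℕ) (c : Table r) (c₀ : ℝ), 2 ≤ r → 0 < c₀ → c.sum (fun _ a => a) = 0 →
      (∀ φ : W r → ℝ, c₀ * ∑ w, ∑ w', (1 - Real.cos (φ w - φ w')) ≤ (genF c φ).re) →
      ∀ (L M : ℕ) [NeZero L] [NeZero M]
      (P : (Λ L M → Fin 3 → ℝ) → Λ L M → W r → ℝ),
      (∀ (ω : Λ L M → Fin 3 → ℝ) (s : Λ L M) (w : W r), P ω s w =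
        (TorusChart.piProdZMod 2 L M).lineSum ω 0 (w.1 : ℕ) s
          + (TorusChart.piProdZMod 2 L M).lineSum ω 1 (w.2.1 : ℕ) (s + (w.1 : ℕ) • (TorusChart.piProdZMod 2 L M).gen 0)
          + (TorusChart.piProdZMod 2 L M).lineSum ω 2 (w.2.2 : ℕ)
            (s + (w.1 : ℕ) • (TorusChart.piProdZMod 2 L M).gen 0 + (w.2.1 : ℕ) • (TorusChart.piProdZMod 2 L M).gen 1)) →
      ∀ (Q : (W r → ℝ) → ℝ),
      (∀ u : W r → ℝ, Q u = (-c.sum (fun n a => a * (((∑ w, (n w : ℝ) * u w) ^ 2 : ℝ) : ℂ))).re) →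
      ∀ (a : Λ L M → Fin 3 → ℤ) (ψ : Λ L M → ℝ),
        Real.pi ^ 2 * c₀ / 6 * ∑ x : Λ L M, ∑ i : Fin 3, ∑ j : Fin 3,
            (((TorusChart.piProdZMod 2 L M).d₁ a x i j : ℤ) : ℝ) ^ 2 ≤
          ∑ s : Λ L M, Q (P (fun x i => 2 * Real.pi * (a x i : ℝ) - (TorusChart.piProdZMod 2 L M).d₀ ψ x i) s) :=
  -- LANDED: p157119 (lead c7 wave 3), `Theorems/BalabanIRBirComplexStableXYRStubVortexCost.lean`
  FSUnfolding.stub_vortexCost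

/-- **stub R9 (M/L, lead): the exact Fröhlich–Spencer representation of the engine's partition function** — LANDED p157389 (all vortex
sectors).  Under (U1), (N), (C) and `r ≥ 2`: for each tree-gauge integer `1`-cochain `a` there is a Coulomb strain
`σ_a = 2πa − d₀ψ_a` (same gauge class as `2πa`, so `d₁σ_a = 2π·d₁a` carries the vorticity), `𝒬`-orthogonal to the exact
cochains (Pythagoras `𝒬(d₀u − σ_a) = 𝒬(d₀u) + 𝒬(σ_a)`), such that
`Z = Σ'_a 2π·e^{−(K/2)𝒬(σ_a)} ∫_{pinned ψ} e^{−(K/2)𝒬(d₀ψ)} · Π_s R_s(P_s(d₀ψ − σ_a)) · W_v(d₀ψ − σ_a) dψ`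
— a Gaussian vortex-loop factor (`≥ π²c₀/6` per unit squared vorticity, `stub_vortexCost`), the thin massless Gaussian of
the spin wave `ψ` (pinned at the origin), bounded local complex factors shifted by the strain, and the bond weights.
Assembly of `stub_unfoldedPartZ` (unfolding), the `U(1)` gauge reduction `setIntegral_inter_eval_zero_mem_eq_smul`,
`stub_windowFactorisation`, `stub_thinFormPolar` + `stub_bilinSquare` (square completion) and translation invariance of
Lebesgue measure on the pinned fields. -/
theorem stub_fsRepresentation :
    ∀ (r : ℕ) (K : ℝ) (c : Table r) (c₀ : ℝ), 2 ≤ r → 0 < c₀ → (∀ n ∈ c.support, ∑ w, n w = 0) →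
      c.sum (fun _ a => a) = 0 → (∀ φ : W r → ℝ, c₀ * ∑ w, ∑ w', (1 - Real.cos (φ w - φ w')) ≤ (genF c φ).re) →
      ∀ (L M : ℕ) [NeZero L] [NeZero M] (v : NNReal), v ≠ 0 →
      ∀ (P : (Λ L M → Fin 3 → ℝ) → Λ L M → W r → ℝ),
      (∀ (ω : Λ L M → Fin 3 → ℝ) (s : Λ L M) (w : W r), P ω s w =
        (TorusChart.piProdZMod 2 L M).lineSum ω 0 (w.1 : ℕ) s
          + (TorusChart.piProdZMod 2 L M).lineSum ω 1 (w.2.1 : ℕ) (s + (w.1 : ℕ) • (TorusChart.piProdZMod 2 L M).gen 0)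
          + (TorusChart.piProdZMod 2 L M).lineSum ω 2 (w.2.2 : ℕ)
            (s + (w.1 : ℕ) • (TorusChart.piProdZMod 2 L M).gen 0 + (w.2.1 : ℕ) • (TorusChart.piProdZMod 2 L M).gen 1)) →
      ∀ (Q : (W r → ℝ) → ℝ),
      (∀ u : W r → ℝ, Q u = (-c.sum (fun n a => a * (((∑ w, (n w : ℝ) * u w) ^ 2 : ℝ) : ℂ))).re) →
      ∃ σ : {a : Λ L M → Fin 3 → ℤ // ∀ (y : Λ L M) (μ : Fin 3),
            (∀ ν : Fin 3, μ < ν → (TorusChart.piProdZMod 2 L M).cval ν y = 0) →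
            (TorusChart.piProdZMod 2 L M).cval μ y + 1 < (TorusChart.piProdZMod 2 L M).period μ → a y μ = 0} →
          (Λ L M → Fin 3 → ℝ),
        (∀ a, ∃ ψ : Λ L M → ℝ, σ a = fun x i => 2 * Real.pi * (a.1 x i : ℝ) - (TorusChart.piProdZMod 2 L M).d₀ ψ x i) ∧
        (∀ a (u : Λ L M → ℝ),
          ∑ s : Λ L M, Q (P (fun x i => (TorusChart.piProdZMod 2 L M).d₀ u x i - σ a x i) s) =
            ∑ s : Λ L M, Q (P ((TorusChart.piProdZMod 2 L M).d₀ u) s) + ∑ s : Λ L M, Q (P (σ a) s)) ∧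
        HasSum (fun a => ((2 * Real.pi : ℝ) : ℂ) *
            Complex.exp (-(((K / 2 * ∑ s : Λ L M, Q (P (σ a) s)) : ℝ) : ℂ)) *
            ∫ ψ : Literature.MathematicalPhysics.QuantumFieldTheory.TorusChart.Punctured (Λ L M) → ℝ,
              Complex.exp (-(((K / 2 * ∑ s : Λ L M, Q (P ((TorusChart.piProdZMod 2 L M).d₀
                (Literature.MathematicalPhysics.QuantumFieldTheory.TorusChart.extZero ψ)) s)) : ℝ) : ℂ)) *
              ((∏ s : Λ L M, Complex.exp
                (-((K : ℂ) * genF c (P (fun x i => (TorusChart.piProdZMod 2 L M).d₀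
                    (Literature.MathematicalPhysics.QuantumFieldTheory.TorusChart.extZero ψ) x i - σ a x i) s))
                  + (((K / 2 * Q (P (fun x i => (TorusChart.piProdZMod 2 L M).d₀
                    (Literature.MathematicalPhysics.QuantumFieldTheory.TorusChart.extZero ψ) x i - σ a x i) s)) : ℝ) : ℂ))) *
              ∏ x : Λ L M, ∏ i : Fin 3, ((∫ t in Set.Icc (-Real.pi) Real.pi, ProbabilityTheory.gaussianPDFReal 0 v
                ((TorusChart.piProdZMod 2 L M).d₀
                  (Literature.MathematicalPhysics.QuantumFieldTheory.TorusChart.extZero ψ) x i - σ a x i - t) : ℝ) : ℂ)))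
          (partZ K c L M) :=
  -- LANDED: p157389 (lead c7, assembly), `Theorems/BalabanIRBirComplexStableXYRFSRepresentation.lean`
  FSUnfolding.stub_fsRepresentation


/-! ### Chapter 1, wave 4 (lead c7): numerators (observable version of the representation), modulus of the local
factors at the chapter-2 interface, oscillation of window path configurations -/

/-- **stub R10 (M): the Fröhlich–Spencer representation of the numerators.** LANDED p158326.  Same as `stub_fsRepresentation`, for the
integral of `O·e^{−A}` with an arbitrary continuous, `2πℤ^Λ`-periodic, rotation-invariant observable `O` (the slice order and
the structure factors of conjunct 2 are such): the strains `σ_a = 2πa − d₀ψ_a` are exported through gauge-fixed potentials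
`ψ_a` (`ψ_a 0 = 0`), and the observable is evaluated at the shifted field `extZero ψ + ψ_a`.  (Proof = that of R9 with
`g = O·e^{−A}` in `stub_unfoldedLiftIdentity`; `O = 1` recovers R9.) -/
theorem stub_fsRepresentationObs :
    ∀ (r : ℕ) (K : ℝ) (c : Table r) (c₀ : ℝ), 2 ≤ r → 0 < c₀ → (∀ n ∈ c.support, ∑ w, n w = 0) →
      c.sum (fun _ a => a) = 0 → (∀ φ : W r → ℝ, c₀ * ∑ w, ∑ w', (1 - Real.cos (φ w - φ w')) ≤ (genF c φ).re) →
      ∀ (L M : ℕ) [NeZero L] [NeZero M] (v : NNReal), v ≠ 0 →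
      ∀ (P : (Λ L M → Fin 3 → ℝ) → Λ L M → W r → ℝ),
      (∀ (ω : Λ L M → Fin 3 → ℝ) (s : Λ L M) (w : W r), P ω s w =
        (TorusChart.piProdZMod 2 L M).lineSum ω 0 (w.1 : ℕ) s
          + (TorusChart.piProdZMod 2 L M).lineSum ω 1 (w.2.1 : ℕ) (s + (w.1 : ℕ) • (TorusChart.piProdZMod 2 L M).gen 0)
          + (TorusChart.piProdZMod 2 L M).lineSum ω 2 (w.2.2 : ℕ)
            (s + (w.1 : ℕ) • (TorusChart.piProdZMod 2 L M).gen 0 + (w.2.1 : ℕ) • (TorusChart.piProdZMod 2 L M).gen 1)) →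
      ∀ (Q : (W r → ℝ) → ℝ),
      (∀ u : W r → ℝ, Q u = (-c.sum (fun n a => a * (((∑ w, (n w : ℝ) * u w) ^ 2 : ℝ) : ℂ))).re) →
      ∃ ψ0 : {a : Λ L M → Fin 3 → ℤ // ∀ (y : Λ L M) (μ : Fin 3),
            (∀ ν : Fin 3, μ < ν → (TorusChart.piProdZMod 2 L M).cval ν y = 0) →
            (TorusChart.piProdZMod 2 L M).cval μ y + 1 < (TorusChart.piProdZMod 2 L M).period μ → a y μ = 0} →
          (Λ L M → ℝ),
        (∀ a, ψ0 a 0 = 0) ∧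
        (∀ a (u : Λ L M → ℝ),
          ∑ s : Λ L M, Q (P (fun x i => (TorusChart.piProdZMod 2 L M).d₀ u x i
              - (2 * Real.pi * (a.1 x i : ℝ) - (TorusChart.piProdZMod 2 L M).d₀ (ψ0 a) x i)) s) =
            ∑ s : Λ L M, Q (P ((TorusChart.piProdZMod 2 L M).d₀ u) s)
              + ∑ s : Λ L M, Q (P (fun x i => 2 * Real.pi * (a.1 x i : ℝ) - (TorusChart.piProdZMod 2 L M).d₀ (ψ0 a) x i) s)) ∧
        ∀ (O : (Λ L M → ℝ) → ℂ), Continuous O →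
          (∀ (φ : Λ L M → ℝ) (n : Λ L M → ℤ), O (fun x => φ x + 2 * Real.pi * (n x : ℝ)) = O φ) →
          (∀ (φ : Λ L M → ℝ) (t : ℝ), O (fun x => φ x + t) = O φ) →
          HasSum (fun a => ((2 * Real.pi : ℝ) : ℂ) *
              Complex.exp (-(((K / 2 * ∑ s : Λ L M, Q (P (fun x i => 2 * Real.pi * (a.1 x i : ℝ)
                - (TorusChart.piProdZMod 2 L M).d₀ (ψ0 a) x i) s)) : ℝ) : ℂ)) *
              ∫ ψ : Literature.MathematicalPhysics.QuantumFieldTheory.TorusChart.Punctured (Λ L M) → ℝ,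
                O (fun x => Literature.MathematicalPhysics.QuantumFieldTheory.TorusChart.extZero ψ x + ψ0 a x) *
                Complex.exp (-(((K / 2 * ∑ s : Λ L M, Q (P ((TorusChart.piProdZMod 2 L M).d₀
                  (Literature.MathematicalPhysics.QuantumFieldTheory.TorusChart.extZero ψ)) s)) : ℝ) : ℂ)) *
                ((∏ s : Λ L M, Complex.exp
                  (-((K : ℂ) * genF c (P (fun x i => (TorusChart.piProdZMod 2 L M).d₀
                      (Literature.MathematicalPhysics.QuantumFieldTheory.TorusChart.extZero ψ) x i
                      - (2 * Real.pi * (a.1 x i : ℝ) - (TorusChart.piProdZMod 2 L M).d₀ (ψ0 a) x i)) s))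
                    + (((K / 2 * Q (P (fun x i => (TorusChart.piProdZMod 2 L M).d₀
                      (Literature.MathematicalPhysics.QuantumFieldTheory.TorusChart.extZero ψ) x i
                      - (2 * Real.pi * (a.1 x i : ℝ) - (TorusChart.piProdZMod 2 L M).d₀ (ψ0 a) x i)) s)) : ℝ) : ℂ))) *
                ∏ x : Λ L M, ∏ i : Fin 3, ((∫ t in Set.Icc (-Real.pi) Real.pi, ProbabilityTheory.gaussianPDFReal 0 v
                  ((TorusChart.piProdZMod 2 L M).d₀
                    (Literature.MathematicalPhysics.QuantumFieldTheory.TorusChart.extZero ψ) x i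
                    - (2 * Real.pi * (a.1 x i : ℝ) - (TorusChart.piProdZMod 2 L M).d₀ (ψ0 a) x i) - t) : ℝ) : ℂ)))
            (∫ φ in cube L M, O φ * Complex.exp (-(action K c L M φ))) :=
  -- LANDED: p158326 (lead c7 wave 4), `Theorems/BalabanIRBirComplexStableXYRStubFSRepresentationObs.lean`
  FSUnfolding.stub_fsRepresentationObs

/-- **stub R11 (S) — LANDED p158012: modulus of the local factors `R_s(u) = exp(−K·genF c u + (K/2)·Q u)` — the chapter-2 interface.**
(i) fat-Gaussian domination (S2): always `‖R(u)‖ ≤ exp((K/2)Q u − (2c₀K/π²)·ΣΣ pv(u_w − u_w')²)`; (ii) sub-Gaussian margin (S3):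
on windows of oscillation `≤ π`, `‖R(u)‖ ≤ exp((1 − 2ε₀)(K/2)·Q u)`, `ε₀ = 2c₀r³/(π²B)`; (iii) large-field smallness (S7): on
windows of oscillation in `[p, π]`, `‖R(u)‖ ≤ exp((1 − ε₀)(K/2)·Q u)·exp(−ε₀c₀Kp²)`.  (`‖e^z‖ = e^{Re z}` and the landed S2/S3/S7.) -/
theorem stub_locFactorBounds :
    ∀ (r : ℕ) (B c₀ K : ℝ) (c : Table r), 0 < B → 0 < c₀ → 0 ≤ K → (∀ n ∈ c.support, ∑ w, n w = 0) →
      c.sum (fun _ a => a) = 0 → normA c ≤ B →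
      (∀ φ : W r → ℝ, c₀ * ∑ w, ∑ w', (1 - Real.cos (φ w - φ w')) ≤ (genF c φ).re) →
      ∀ (Q : (W r → ℝ) → ℝ),
      (∀ u : W r → ℝ, Q u = (-c.sum (fun n a => a * (((∑ w, (n w : ℝ) * u w) ^ 2 : ℝ) : ℂ))).re) →
      ∀ u : W r → ℝ,
        ‖Complex.exp (-((K : ℂ) * genF c u) + (((K / 2 * Q u) : ℝ) : ℂ))‖ ≤
            Real.exp (K / 2 * Q u - (2 * c₀ * K / Real.pi ^ 2) *
              ∑ w, ∑ w', (toIocMod Real.two_pi_pos (-Real.pi) (u w - u w')) ^ 2) ∧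
        ((∀ w w' : W r, |u w - u w'| ≤ Real.pi) →
          ‖Complex.exp (-((K : ℂ) * genF c u) + (((K / 2 * Q u) : ℝ) : ℂ))‖ ≤
            Real.exp ((1 - 2 * (2 * c₀ * (r : ℝ) ^ 3 / (Real.pi ^ 2 * B))) * (K / 2) * Q u)) ∧
        (∀ p : ℝ, 0 ≤ p → (∀ w w' : W r, |u w - u w'| ≤ Real.pi) → (∃ w w' : W r, p ≤ |u w - u w'|) →
          ‖Complex.exp (-((K : ℂ) * genF c u) + (((K / 2 * Q u) : ℝ) : ℂ))‖ ≤
            Real.exp ((1 - 2 * c₀ * (r : ℝ) ^ 3 / (Real.pi ^ 2 * B)) * (K / 2) * Q u) *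
              Real.exp (-(2 * c₀ * (r : ℝ) ^ 3 / (Real.pi ^ 2 * B) * c₀ * K * p ^ 2))) :=
  -- LANDED: p158012 (lead c7 wave 4), `Theorems/BalabanIRBirComplexStableXYRStubLocFactorBounds.lean`
  FSUnfolding.stub_locFactorBounds

/-- **stub R12 (S): oscillation of window path configurations is controlled by the bond gradients.** LANDED p158000.  If every value of the
`1`-cochain `η` is at most `m` in modulus, two values of the window path configuration `P_s η` differ by at most
`6(r−1)·m` (each staircase has at most `3(r−1)` edges).  So a "rough window" (oscillation `≥ p`) contains a bond with
`|η_b| ≥ p/(6(r−1))` — the link between the window-wise large-field condition of S7 and bond-wise Gaussian tail events. -/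
theorem stub_pathCfg_osc :
    ∀ (r L M : ℕ) [NeZero L] [NeZero M]
      (P : (Λ L M → Fin 3 → ℝ) → Λ L M → W r → ℝ),
      (∀ (ω : Λ L M → Fin 3 → ℝ) (s : Λ L M) (w : W r), P ω s w =
        (TorusChart.piProdZMod 2 L M).lineSum ω 0 (w.1 : ℕ) s
          + (TorusChart.piProdZMod 2 L M).lineSum ω 1 (w.2.1 : ℕ) (s + (w.1 : ℕ) • (TorusChart.piProdZMod 2 L M).gen 0)
          + (TorusChart.piProdZMod 2 L M).lineSum ω 2 (w.2.2 : ℕ)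
            (s + (w.1 : ℕ) • (TorusChart.piProdZMod 2 L M).gen 0 + (w.2.1 : ℕ) • (TorusChart.piProdZMod 2 L M).gen 1)) →
      ∀ (η : Λ L M → Fin 3 → ℝ) (m : ℝ), (∀ (x : Λ L M) (i : Fin 3), |η x i| ≤ m) →
      ∀ (s : Λ L M) (w w' : W r), |P η s w - P η s w'| ≤ 6 * ((r : ℝ) - 1) * m :=
  -- LANDED: p158000 (lead c7 wave 4), `Theorems/BalabanIRBirComplexStableXYRStubPathCfgOsc.lean`
  FSUnfolding.stub_pathCfg_osc


/-! ## Chapter 2, wave 5 (lead c7): organising the sector sum — gauge-class invariance of sector terms, sector labels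
`(vorticity, winding)`, the cheap temporal-holonomy sectors, and the conjugation symmetry of the action under (R)∧(P) -/

/-- **stub B1 (M): sector terms are gauge-class functions.** LANDED p159250.  For a `2πℤ^Λ`-periodic, rotation-invariant observable `O` and a
(U1) table, the pinned sector integral `∫_{φ 0 ∈ [0,2π)} O e^{−A} W_v(d₀φ − 2πa)` depends on the integer `1`-cochain `a` only through
its gauge class `a + d₀ℤ^Λ` (gauge reduction of the constant mode, periodicity, translation invariance on the pinned fields). This
is what allows the tree-gauge sum of `stub_fsRepresentation(Obs)` to be regrouped by sector labels. -/
theorem stub_sectorClassFunction :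
    ∀ (r : ℕ) (K : ℝ) (c : Table r), (∀ n ∈ c.support, ∑ w, n w = 0) → ∀ (L M : ℕ) [NeZero L] [NeZero M] (v : NNReal)
      (O : (Λ L M → ℝ) → ℂ), (∀ (φ : Λ L M → ℝ) (n : Λ L M → ℤ), O (fun x => φ x + 2 * Real.pi * (n x : ℝ)) = O φ) →
      (∀ (φ : Λ L M → ℝ) (t : ℝ), O (fun x => φ x + t) = O φ) →
      ∀ (a : Λ L M → Fin 3 → ℤ) (n : Λ L M → ℤ),
        (∫ φ in {φ : Λ L M → ℝ | φ 0 ∈ Set.Ico 0 (2 * Real.pi)},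
          O φ * Complex.exp (-(action K c L M φ)) *
            ∏ x : Λ L M, ∏ i : Fin 3, ((∫ t in Set.Icc (-Real.pi) Real.pi, ProbabilityTheory.gaussianPDFReal 0 v
              ((TorusChart.piProdZMod 2 L M).d₀ φ x i
                - 2 * Real.pi * ((a x i + (TorusChart.piProdZMod 2 L M).d₀ n x i : ℤ) : ℝ) - t) : ℝ) : ℂ)) =
        ∫ φ in {φ : Λ L M → ℝ | φ 0 ∈ Set.Ico 0 (2 * Real.pi)},
          O φ * Complex.exp (-(action K c L M φ)) *
            ∏ x : Λ L M, ∏ i : Fin 3, ((∫ t in Set.Icc (-Real.pi) Real.pi, ProbabilityTheory.gaussianPDFReal 0 v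
              ((TorusChart.piProdZMod 2 L M).d₀ φ x i - 2 * Real.pi * (a x i : ℝ) - t) : ℝ) : ℂ) :=
  -- LANDED: p159250 (lead c7 wave 5), `Theorems/BalabanIRBirComplexStableXYRStubSectorClassFunction.lean`
  FSUnfolding.stub_sectorClassFunction

/-- **stub B4 (S): sector labels.** LANDED p159023.  Two integer `1`-cochains on a charted torus are gauge equivalent (`a' = a + d₀n`) iff they have
the same vorticity `d₁` and the same axial windings `wind` (seat 1's `exists_d₀_eq_iff` applied to `a' − a`).  Hence the sectors of the
Fröhlich–Spencer representation are labelled by `(q, h) = (d₁a, wind a)`: vortex current and holonomy. -/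
theorem stub_sectorLabel :
    ∀ (Λ : Type) [AddCommGroup Λ] (d : ℕ) (F : TorusChart Λ d) (a a' : Λ → Fin d → ℤ),
      (∃ n : Λ → ℤ, a' = a + F.d₀ n) ↔ (F.d₁ a' = F.d₁ a ∧ F.wind a' = F.wind a) :=
  -- LANDED: p159023 (lead c7 wave 5), `Theorems/BalabanIRBirComplexStableXYRStubSectorLabel.lean`
  FSUnfolding.stub_sectorLabel

/-- **stub B5 (M): the Gaussian cost of a pure holonomy sector is only that of the constant twist.** LANDED p159354.  For a vortex-free integer
`1`-cochain `a` (`d₁a = 0`) with windings `h = wind a`, ANY strain `σ = 2πa − d₀ψ` satisfying the Pythagoras/normal-equation property of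
`stub_fsRepresentation` has thin-form energy at most that of the constant cochain `2πh_μ/N_μ`:
`𝒬(σ) ≤ |Λ| · Q(w ↦ 2π(h₀w₁/L + h₁w₂/L + h₂w₃/M))`.  In particular a temporal holonomy `h₂` costs `O(K·normA·r⁵·h₂²·L²/M)` in the
exponent — NOT suppressed once `M ≳ K L²` (seat 0's T-end warning): the `h₂`-series must be kept whole in chapter 2 (it is the rotor /
zero-mode endgame), while spatial holonomies cost `≳ c₀ K h² M`. -/
theorem stub_windingSectorCost :
    ∀ (r : ℕ) (c : Table r) (c₀ : ℝ), 2 ≤ r → 0 < c₀ → c.sum (fun _ a => a) = 0 →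
      (∀ φ : W r → ℝ, c₀ * ∑ w, ∑ w', (1 - Real.cos (φ w - φ w')) ≤ (genF c φ).re) →
      ∀ (L M : ℕ) [NeZero L] [NeZero M]
      (P : (Λ L M → Fin 3 → ℝ) → Λ L M → W r → ℝ),
      (∀ (ω : Λ L M → Fin 3 → ℝ) (s : Λ L M) (w : W r), P ω s w =
        (TorusChart.piProdZMod 2 L M).lineSum ω 0 (w.1 : ℕ) s
          + (TorusChart.piProdZMod 2 L M).lineSum ω 1 (w.2.1 : ℕ) (s + (w.1 : ℕ) • (TorusChart.piProdZMod 2 L M).gen 0)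
          + (TorusChart.piProdZMod 2 L M).lineSum ω 2 (w.2.2 : ℕ)
            (s + (w.1 : ℕ) • (TorusChart.piProdZMod 2 L M).gen 0 + (w.2.1 : ℕ) • (TorusChart.piProdZMod 2 L M).gen 1)) →
      ∀ (Q : (W r → ℝ) → ℝ),
      (∀ u : W r → ℝ, Q u = (-c.sum (fun n a => a * (((∑ w, (n w : ℝ) * u w) ^ 2 : ℝ) : ℂ))).re) →
      ∀ (h : Fin 3 → ℤ) (a : Λ L M → Fin 3 → ℤ), (TorusChart.piProdZMod 2 L M).d₁ a = 0 →
        (TorusChart.piProdZMod 2 L M).wind a = h →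
      ∀ (σ : Λ L M → Fin 3 → ℝ),
        (∃ ψ : Λ L M → ℝ, σ = fun x i => 2 * Real.pi * (a x i : ℝ) - (TorusChart.piProdZMod 2 L M).d₀ ψ x i) →
        (∀ u : Λ L M → ℝ,
          ∑ s : Λ L M, Q (P (fun x i => (TorusChart.piProdZMod 2 L M).d₀ u x i - σ x i) s) =
            ∑ s : Λ L M, Q (P ((TorusChart.piProdZMod 2 L M).d₀ u) s) + ∑ s : Λ L M, Q (P σ s)) →
        ∑ s : Λ L M, Q (P σ s) ≤
          (Fintype.card (Λ L M) : ℝ) * Q (fun w : W r => 2 * Real.pi *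
            ((h 0 : ℝ) * ((w.1 : ℕ) : ℝ) / L + (h 1 : ℝ) * ((w.2.1 : ℕ) : ℝ) / L + (h 2 : ℝ) * ((w.2.2 : ℕ) : ℝ) / M)) :=
  -- LANDED: p159354 (lead c7 wave 5), `Theorems/BalabanIRBirComplexStableXYRStubWindingSectorCost.lean`
  FSUnfolding.stub_windingSectorCost

/-- **stub B2a (M): the action is conjugated by the lattice inversion under (R)∧(P).** LANDED p159189.  Time-reflection Hermiticity (R) and spatial
inversion evenness (P) give `F(φ ∘ RP) = conj F(φ)` for the full window inversion `RP : w ↦ (r−1)·𝟙 − w`; since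
`θ(−sh s w) = θ(sh s'' (RP w))` with `s'' = −s − (r−1)(e₀+e₁+e₂)` (a bijection of the sites), the summed action satisfies
`A(θ ∘ neg) = conj A(θ)`.  This is the symmetry pairing the sectors `a ↔ a^J` (term ↦ conj term) in chapter 2 — the input of the landed
`conjPositivity_endgame` (p130769) at the level of the representation, and the reason `Z` and the `h₂`-series are real. -/
theorem stub_actionConjNeg :
    ∀ (r : ℕ) (K : ℝ) (c : Table r),
      (∀ n : Freq r, c (fun w => n (w.1, w.2.1, Fin.rev w.2.2)) = (starRingEnd ℂ) (c (-n))) →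
      (∀ n : Freq r, c (fun w => n (Fin.rev w.1, Fin.rev w.2.1, w.2.2)) = c n) →
      ∀ (L M : ℕ) [NeZero L] [NeZero M] (θ : Λ L M → ℝ),
        action K c L M (fun y => θ (-y)) = (starRingEnd ℂ) (action K c L M θ) :=
  -- LANDED: p159189 (lead c7 wave 5), `Theorems/BalabanIRBirComplexStableXYRStubActionConjNeg.lean`
  FSUnfolding.stub_actionConjNeg


/-! ## Chapter 2, wave 6 (lead c7): sector conjugation under (R)∧(P), the vanishing imaginary gradient, and the sector
Berry phase (the imaginary LINEAR part of the window weight is a class invariant that leaves the integral) -/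

/-- **stub B2b (M/L): conjugation pairs the sectors.** LANDED p160662.  Under (R)∧(P) the complex conjugate of the pinned sector integral of
`O·e^{−A}·W_v(d₀φ − 2πa)` is the pinned sector integral of `conj(O∘neg)·e^{−A}·W_v(d₀φ − 2πa^J)` with the reflected gauge field
`a^J(y,i) = −a(−y − e_i, i)` (`stub_actionConjNeg`, the substitution `φ ↦ φ∘neg` — a volume-preserving coordinate permutation fixing the
pinning `φ 0 ∈ [0,2π)` —, `d₀(φ∘neg)(x,i) = −d₀φ(−x−e_i,i)`, evenness and reality of the smoothed box).  With B1/B4: sector `(q,h)` is paired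
with a sector of opposite holonomy and reflected vorticity, term ↦ conj term — the reality of the holonomy theta series and the input of
`conjPositivity_endgame` at the level of the representation. -/
theorem stub_sectorConjugation :
    ∀ (r : ℕ) (K : ℝ) (c : Table r),
      (∀ n : Freq r, c (fun w => n (w.1, w.2.1, Fin.rev w.2.2)) = (starRingEnd ℂ) (c (-n))) →
      (∀ n : Freq r, c (fun w => n (Fin.rev w.1, Fin.rev w.2.1, w.2.2)) = c n) →
      ∀ (L M : ℕ) [NeZero L] [NeZero M] (v : NNReal) (O : (Λ L M → ℝ) → ℂ) (a : Λ L M → Fin 3 → ℤ),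
        (starRingEnd ℂ) (∫ φ in {φ : Λ L M → ℝ | φ 0 ∈ Set.Ico 0 (2 * Real.pi)},
          O φ * Complex.exp (-(action K c L M φ)) *
            ∏ x : Λ L M, ∏ i : Fin 3, ((∫ t in Set.Icc (-Real.pi) Real.pi, ProbabilityTheory.gaussianPDFReal 0 v
              ((TorusChart.piProdZMod 2 L M).d₀ φ x i - 2 * Real.pi * (a x i : ℝ) - t) : ℝ) : ℂ)) =
        ∫ φ in {φ : Λ L M → ℝ | φ 0 ∈ Set.Ico 0 (2 * Real.pi)},
          (starRingEnd ℂ) (O (fun y => φ (-y))) * Complex.exp (-(action K c L M φ)) *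
            ∏ x : Λ L M, ∏ i : Fin 3, ((∫ t in Set.Icc (-Real.pi) Real.pi, ProbabilityTheory.gaussianPDFReal 0 v
              ((TorusChart.piProdZMod 2 L M).d₀ φ x i
                - 2 * Real.pi * ((-a (-x - (TorusChart.piProdZMod 2 L M).gen i) i : ℤ) : ℝ) - t) : ℝ) : ℂ) :=
  -- LANDED: p160662 (lead c7 wave 6), `Theorems/BalabanIRBirComplexStableXYRStubSectorConjugation.lean`
  FSUnfolding.stub_sectorConjugation

/-- **stub C7 (M): the imaginary gradient of the window weight vanishes at the constants.** LANDED p160330.  Under (N) and (C) the constant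
configuration minimises `Re F`, so the derivative of `t ↦ Re genF c (t·δ_w)` vanishes at `0`: `Σ_n Im(c_n)·n_w = 0` for every window site
`w`.  Hence the LINEAR Taylor part of `genF c` at `0` is purely imaginary, `i·Σ_w m_w u_w` with `m_w = Σ_n Re(c_n) n_w` — the sector Berry
phase of C8; after it and the (real, (I3)) quadratic part are taken out, `R_s` is `1 + O(K·cubic)` on small fields. -/
theorem stub_imGradientZero :
    ∀ (r : ℕ) (c : Table r) (c₀ : ℝ), 0 < c₀ → c.sum (fun _ a => a) = 0 →
      (∀ φ : W r → ℝ, c₀ * ∑ w, ∑ w', (1 - Real.cos (φ w - φ w')) ≤ (genF c φ).re) →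
      ∀ w : W r, c.sum (fun n a => a.im * (n w : ℝ)) = 0 :=
  -- LANDED: p160330 (lead c7 wave 6), `Theorems/BalabanIRBirComplexStableXYRStubImGradientZero.lean`
  FSUnfolding.stub_imGradientZero

/-- **stub C8 (S/M): the linear part of the window weights only sees the sector.** LANDED p160352.  For any site weights `m : W r → ℝ`, the translate-sum
over all windows of the linear functional `u ↦ Σ_w m_w u_w` evaluated on the window path configurations of `d₀φ − σ` does not depend on the
spin wave `φ`: the exact part drops out (`P_s(d₀φ) w = φ(sh s w) − φ s` by `stub_pathCfg_d0`, and `s ↦ sh s w` is a translation of the torus).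
So `Π_s e^{−iK m·P_s(d₀ψ − σ_a)} = e^{+iK Σ_s m·P_s σ_a}` is a sector constant — the Berry phase `Φ(a)` of the vortex/holonomy configuration
(for a temporal holonomy `h₂` it is the imaginary-chemical-potential tilt `∝ K L² h₂`); chapter 2 factors it out of every sector integral. -/
theorem stub_linearPartSector :
    ∀ (r L M : ℕ) [NeZero L] [NeZero M]
      (P : (Λ L M → Fin 3 → ℝ) → Λ L M → W r → ℝ),
      (∀ (ω : Λ L M → Fin 3 → ℝ) (s : Λ L M) (w : W r), P ω s w =
        (TorusChart.piProdZMod 2 L M).lineSum ω 0 (w.1 : ℕ) s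
          + (TorusChart.piProdZMod 2 L M).lineSum ω 1 (w.2.1 : ℕ) (s + (w.1 : ℕ) • (TorusChart.piProdZMod 2 L M).gen 0)
          + (TorusChart.piProdZMod 2 L M).lineSum ω 2 (w.2.2 : ℕ)
            (s + (w.1 : ℕ) • (TorusChart.piProdZMod 2 L M).gen 0 + (w.2.1 : ℕ) • (TorusChart.piProdZMod 2 L M).gen 1)) →
      ∀ (m : W r → ℝ) (φ : Λ L M → ℝ) (σ : Λ L M → Fin 3 → ℝ),
        ∑ s : Λ L M, ∑ w : W r, m w * P (fun x i => (TorusChart.piProdZMod 2 L M).d₀ φ x i - σ x i) s w =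
          -∑ s : Λ L M, ∑ w : W r, m w * P σ s w :=
  -- LANDED: p160352 (lead c7 wave 6), `Theorems/BalabanIRBirComplexStableXYRStubLinearPartSector.lean`
  FSUnfolding.stub_linearPartSector


/-! ## Chapter 2, wave 7 (lead c7): the Berry phase leaves the sector integral; the reduced local factors are `1 + O(K·osc³)` -/

/-- **stub D1 (S/M): Berry-phase factorisation of the local factors.** LANDED p161299.  Splitting off the linear part `i·m·u` of each window weight,
`Π_s R_s(P_s(d₀φ − σ)) = e^{+iK Σ_s m·P_s σ} · Π_s R̃_s(P_s(d₀φ − σ))` with the REDUCED factor `R̃_s(u) = exp(−K(genF c u − i m·u) + (K/2)Q u)`: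
the phase is a sector constant (`stub_linearPartSector`), independent of the spin wave. -/
theorem stub_berryPhaseFactor :
    ∀ (r : ℕ) (K : ℝ) (c : Table r) (L M : ℕ) [NeZero L] [NeZero M]
      (P : (Λ L M → Fin 3 → ℝ) → Λ L M → W r → ℝ),
      (∀ (ω : Λ L M → Fin 3 → ℝ) (s : Λ L M) (w : W r), P ω s w =
        (TorusChart.piProdZMod 2 L M).lineSum ω 0 (w.1 : ℕ) s
          + (TorusChart.piProdZMod 2 L M).lineSum ω 1 (w.2.1 : ℕ) (s + (w.1 : ℕ) • (TorusChart.piProdZMod 2 L M).gen 0)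
          + (TorusChart.piProdZMod 2 L M).lineSum ω 2 (w.2.2 : ℕ)
            (s + (w.1 : ℕ) • (TorusChart.piProdZMod 2 L M).gen 0 + (w.2.1 : ℕ) • (TorusChart.piProdZMod 2 L M).gen 1)) →
      ∀ (Q : (W r → ℝ) → ℝ) (m : W r → ℝ) (φ : Λ L M → ℝ) (σ : Λ L M → Fin 3 → ℝ),
        ∏ s : Λ L M, Complex.exp
            (-((K : ℂ) * genF c (P (fun x i => (TorusChart.piProdZMod 2 L M).d₀ φ x i - σ x i) s))
              + (((K / 2 * Q (P (fun x i => (TorusChart.piProdZMod 2 L M).d₀ φ x i - σ x i) s)) : ℝ) : ℂ)) =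
          Complex.exp (Complex.I * (((K * ∑ s : Λ L M, ∑ w : W r, m w * P σ s w) : ℝ) : ℂ)) *
          ∏ s : Λ L M, Complex.exp
            (-((K : ℂ) * (genF c (P (fun x i => (TorusChart.piProdZMod 2 L M).d₀ φ x i - σ x i) s)
                - Complex.I * ((∑ w : W r, m w * P (fun x i => (TorusChart.piProdZMod 2 L M).d₀ φ x i - σ x i) s w : ℝ) : ℂ)))
              + (((K / 2 * Q (P (fun x i => (TorusChart.piProdZMod 2 L M).d₀ φ x i - σ x i) s)) : ℝ) : ℂ)) :=
  -- LANDED: p161299 (lead c7 wave 7), `Theorems/BalabanIRBirComplexStableXYRStubBerryPhaseFactor.lean`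
  FSUnfolding.stub_berryPhaseFactor

/-- **stub D2 (M): the reduced local factor is a cubic remainder.** LANDED p161301.  Under (U1), (N), (C) (so `Σ_n Im(c_n) n = 0`,
`stub_imGradientZero`), the real-Hessian hypothesis (I3) and the budget `normA c ≤ B`, the window weight is its Berry phase plus its real
quadratic part up to a cubic error controlled by the window oscillation:
`‖genF c u − i·m·u − ½Q(u)‖ ≤ 2B·δ³` whenever `|u_w − u_w'| ≤ δ` (`m_w = Σ_n Re(c_n)n_w`; the landed Taylor bound
`cvxr_norm_genF_sub_taylor2_le`).  Hence `R̃_s(u) = exp(−K·(cubic))` and `|R̃_s − 1| ≤ 2KBδ³e^{2KBδ³}` on small fields (`δ = p = K^{−1/3−δ'}`). -/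
theorem stub_cubicRemainder :
    ∀ (r : ℕ) (B c₀ : ℝ) (c : Table r), 0 < c₀ → (∀ n ∈ c.support, ∑ w, n w = 0) → c.sum (fun _ a => a) = 0 →
      normA c ≤ B → (∀ φ : W r → ℝ, c₀ * ∑ w, ∑ w', (1 - Real.cos (φ w - φ w')) ≤ (genF c φ).re) →
      (∀ v : W r → ℝ, c.sum (fun n a => a.im * (∑ w, (n w : ℝ) * v w) ^ 2) = 0) →
      ∀ (Q : (W r → ℝ) → ℝ),
      (∀ u : W r → ℝ, Q u = (-c.sum (fun n a => a * (((∑ w, (n w : ℝ) * u w) ^ 2 : ℝ) : ℂ))).re) →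
      ∀ (m : W r → ℝ), (∀ w : W r, m w = c.sum (fun n a => a.re * (n w : ℝ))) →
      ∀ (u : W r → ℝ) (δ : ℝ), 0 ≤ δ → (∀ w w' : W r, |u w - u w'| ≤ δ) →
        ‖genF c u - Complex.I * ((∑ w : W r, m w * u w : ℝ) : ℂ) - (((Q u / 2) : ℝ) : ℂ)‖ ≤ 2 * B * δ ^ 3 :=
  -- LANDED: p161301 (lead c7 wave 7), `Theorems/BalabanIRBirComplexStableXYRStubCubicRemainder.lean`
  FSUnfolding.stub_cubicRemainder


/-! ## Chapter 2, wave 8 (lead c8): the exact Gaussian skeleton of the vortex-free sector sum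

In the Fröhlich–Spencer representation (R9/R10) the vortex-free sectors `d₁a = 0` are labelled by the holonomy
`h = wind a ∈ ℤ³` (B4).  The stubs below make their Gaussian data EXACT: the Pythagorean (Coulomb) strain of such a
sector is the CONSTANT twist `σ̄_h = (2πh_i/N_i)_i` (constants are `𝒬`-orthogonal to gradients by translation
invariance; uniqueness by the coercivity P1e), so the sector prefactor is `exp(−(K/2)|Λ|·Q_c(v̄_h))` with
`v̄_h(w) = 2π(h₀w₁/L + h₁w₂/L + h₂w₃/M)` (equality case of B5); the Berry phase (C8/D1) of a constant strain is
`K|Λ|·Σ_w m_w v̄_h(w)`, the weights `m_w = Σ_n Re(c_n) n_w` are ODD under the time reflection (R), so spatial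
holonomies carry no phase and the temporal one carries `2πK L² μ h₂`, `μ = Σ_w m_w w₃`; (R) also removes the
space–time cross terms of `Q_c(v̄_h)`.  At the Gaussian level (`R̃ ≡ 1`) the vortex-free sum is therefore a real
spatial theta series times the TILTED temporal theta series `Σ_{h₂} e^{−E h₂² + iαh₂}`, `E = 2π²Kρ_t L²/M`,
`α = 2πKL²μ`, which is POSITIVE by Poisson summation (its dual is the charge representation, every charge sector
`m` weighted by `e^{−(2πm−α)²/(4E)} > 0`) — the `K = ∞` caricature of the S5a endgame and the format T-RG (i) must
deliver at `q = 0` (bounds per charge sector, not per winding sector). -/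

/-- **stub E1 (S/M): constants are `𝒬`-orthogonal to gradients (Pythagoras for constant cochains).**  For every
real field `u` and every constant `1`-cochain `x i ↦ v i`:
`Σ_s Q(P_s(d₀u − v)) = Σ_s Q(P_s(d₀u)) + Σ_s Q(P_s v)`.  (`P_s` is linear (`lineSum_sub`); `Q(a − b) = Q a + Q b −
2·Re(−Σ_n c_n (n·a)(n·b))`; the window functional `n·P_s v` of a constant cochain does not depend on `s`, while
`Σ_s n·P_s(d₀u) = Σ_w n_w Σ_s (u(sh s w) − u s) = 0` by `stub_pathCfg_d0` (with `a = 0`) and translation invariance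
of `Σ_s`.) -/
theorem stub_constCochainPythagoras :
    ∀ (r : ℕ) (c : Table r) (L M : ℕ) [NeZero L] [NeZero M]
      (P : (Λ L M → Fin 3 → ℝ) → Λ L M → W r → ℝ),
      (∀ (ω : Λ L M → Fin 3 → ℝ) (s : Λ L M) (w : W r), P ω s w =
        (TorusChart.piProdZMod 2 L M).lineSum ω 0 (w.1 : ℕ) s
          + (TorusChart.piProdZMod 2 L M).lineSum ω 1 (w.2.1 : ℕ) (s + (w.1 : ℕ) • (TorusChart.piProdZMod 2 L M).gen 0)
          + (TorusChart.piProdZMod 2 L M).lineSum ω 2 (w.2.2 : ℕ)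
            (s + (w.1 : ℕ) • (TorusChart.piProdZMod 2 L M).gen 0 + (w.2.1 : ℕ) • (TorusChart.piProdZMod 2 L M).gen 1)) →
      ∀ (Q : (W r → ℝ) → ℝ),
      (∀ u : W r → ℝ, Q u = (-c.sum (fun n a => a * (((∑ w, (n w : ℝ) * u w) ^ 2 : ℝ) : ℂ))).re) →
      ∀ (v : Fin 3 → ℝ) (u : Λ L M → ℝ),
        ∑ s : Λ L M, Q (P (fun x i => (TorusChart.piProdZMod 2 L M).d₀ u x i - v i) s) =
          ∑ s : Λ L M, Q (P ((TorusChart.piProdZMod 2 L M).d₀ u) s) + ∑ s : Λ L M, Q (P (fun _ i => v i) s) :=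
  -- LANDED: p164385 (lead c8 wave 8), `Theorems/BalabanIRBirComplexStableXYRStubConstCochainPythagoras.lean`
  FSUnfolding.stub_constCochainPythagoras

/-- **stub E2 (S): window path configuration of a constant cochain.**  The staircase sums of the constant `1`-cochain
`x i ↦ v i` inside the window with corner `s` are `w₁v₀ + w₂v₁ + w₃v₂` (a line sum of `k` equal edge values is `k`
times the value) — independent of `s`.  With E1 the Gaussian weight of a constant strain is `exp(−(K/2)|Λ|Q(v̄))`, and
with C8/D1 its Berry phase is `K|Λ|Σ_w m_w v̄(w)`. -/
theorem stub_pathCfg_const :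
    ∀ (r L M : ℕ) [NeZero L] [NeZero M]
      (P : (Λ L M → Fin 3 → ℝ) → Λ L M → W r → ℝ),
      (∀ (ω : Λ L M → Fin 3 → ℝ) (s : Λ L M) (w : W r), P ω s w =
        (TorusChart.piProdZMod 2 L M).lineSum ω 0 (w.1 : ℕ) s
          + (TorusChart.piProdZMod 2 L M).lineSum ω 1 (w.2.1 : ℕ) (s + (w.1 : ℕ) • (TorusChart.piProdZMod 2 L M).gen 0)
          + (TorusChart.piProdZMod 2 L M).lineSum ω 2 (w.2.2 : ℕ)
            (s + (w.1 : ℕ) • (TorusChart.piProdZMod 2 L M).gen 0 + (w.2.1 : ℕ) • (TorusChart.piProdZMod 2 L M).gen 1)) →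
      ∀ (v : Fin 3 → ℝ) (s : Λ L M) (w : W r),
        P (fun _ i => v i) s w = ((w.1 : ℕ) : ℝ) * v 0 + ((w.2.1 : ℕ) : ℝ) * v 1 + ((w.2.2 : ℕ) : ℝ) * v 2 :=
  -- LANDED: p164566 (lead c8 wave 8), `Theorems/BalabanIRBirComplexStableXYRStubPathCfgConst.lean`
  FSUnfolding.stub_pathCfg_const

/-- **stub E3 (M): the Coulomb strain of a vortex-free sector is the constant twist.**  Under (N), (C), `r ≥ 2` (coercivity of
the thin form, P1e) and given Pythagoras for constants (E1, supplied as a hypothesis): if `a` is an integer `1`-cochain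
with `d₁a = 0` and windings `h`, then ANY strain `σ = 2πa − d₀ψ` with the Pythagoras property of `stub_fsRepresentation`
equals the constant cochain `σ̄_h = (2πh_i/N_i)_i`.  (`2πa − σ̄_h` is flat with zero windings, hence a gradient
(`TorusChart.exists_d₀_eq_iff`); so `σ − σ̄_h = d₀w`; the two Pythagoras identities give `𝒬(d₀w) = 0`, and
`𝒬 ≥ 2c₀‖·‖²` (`stub_thinFormCoercive`) forces `d₀w = 0`.)  Consequently the vortex-free sector weights of R9 are
EXACTLY `exp(−(K/2)|Λ|·Q(v̄_h))` — the equality case of B5. -/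
theorem stub_holonomyStrainConst :
    ∀ (r : ℕ) (c : Table r) (c₀ : ℝ), 2 ≤ r → 0 < c₀ → c.sum (fun _ a => a) = 0 →
      (∀ φ : W r → ℝ, c₀ * ∑ w, ∑ w', (1 - Real.cos (φ w - φ w')) ≤ (genF c φ).re) →
      ∀ (L M : ℕ) [NeZero L] [NeZero M]
      (P : (Λ L M → Fin 3 → ℝ) → Λ L M → W r → ℝ),
      (∀ (ω : Λ L M → Fin 3 → ℝ) (s : Λ L M) (w : W r), P ω s w =
        (TorusChart.piProdZMod 2 L M).lineSum ω 0 (w.1 : ℕ) s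
          + (TorusChart.piProdZMod 2 L M).lineSum ω 1 (w.2.1 : ℕ) (s + (w.1 : ℕ) • (TorusChart.piProdZMod 2 L M).gen 0)
          + (TorusChart.piProdZMod 2 L M).lineSum ω 2 (w.2.2 : ℕ)
            (s + (w.1 : ℕ) • (TorusChart.piProdZMod 2 L M).gen 0 + (w.2.1 : ℕ) • (TorusChart.piProdZMod 2 L M).gen 1)) →
      ∀ (Q : (W r → ℝ) → ℝ),
      (∀ u : W r → ℝ, Q u = (-c.sum (fun n a => a * (((∑ w, (n w : ℝ) * u w) ^ 2 : ℝ) : ℂ))).re) →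
      (∀ (v : Fin 3 → ℝ) (u : Λ L M → ℝ),
        ∑ s : Λ L M, Q (P (fun x i => (TorusChart.piProdZMod 2 L M).d₀ u x i - v i) s) =
          ∑ s : Λ L M, Q (P ((TorusChart.piProdZMod 2 L M).d₀ u) s) + ∑ s : Λ L M, Q (P (fun _ i => v i) s)) →
      ∀ (h : Fin 3 → ℤ) (a : Λ L M → Fin 3 → ℤ), (TorusChart.piProdZMod 2 L M).d₁ a = 0 →
        (TorusChart.piProdZMod 2 L M).wind a = h →
      ∀ (σ : Λ L M → Fin 3 → ℝ),
        (∃ ψ : Λ L M → ℝ, σ = fun x i => 2 * Real.pi * (a x i : ℝ) - (TorusChart.piProdZMod 2 L M).d₀ ψ x i) →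
        (∀ u : Λ L M → ℝ,
          ∑ s : Λ L M, Q (P (fun x i => (TorusChart.piProdZMod 2 L M).d₀ u x i - σ x i) s) =
            ∑ s : Λ L M, Q (P ((TorusChart.piProdZMod 2 L M).d₀ u) s) + ∑ s : Λ L M, Q (P σ s)) →
        σ = fun _ i => 2 * Real.pi * (h i : ℝ) / ((TorusChart.piProdZMod 2 L M).period i : ℝ) :=
  -- LANDED: p164762 (lead c8 wave 8), `Theorems/BalabanIRBirComplexStableXYRStubHolonomyStrainConst.lean`
  FSUnfolding.stub_holonomyStrainConst

/-- **stub E4 (S/M): the Berry weights are odd under the time reflection.**  With `m_w = Σ_n Re(c_n) n_w`, hypothesis (R)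
(`c_{n∘R} = conj c_{−n}`, `R(a,b,t) = (a,b,r−1−t)`) gives `m_{Rw} = −m_w` (re-index the table sum by the support-preserving
involution `n ↦ −(n∘R)`, under which `Re c` is even and `n_{Rw}` turns into `−n_w`). -/
theorem stub_berryWeightsReflect :
    ∀ (r : ℕ) (c : Table r),
      (∀ n : Freq r, c (fun w => n (w.1, w.2.1, Fin.rev w.2.2)) = (starRingEnd ℂ) (c (-n))) →
      ∀ (m : W r → ℝ), (∀ w : W r, m w = c.sum (fun n a => a.re * (n w : ℝ))) →
      ∀ w : W r, m (w.1, w.2.1, Fin.rev w.2.2) = -m w :=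
  -- LANDED: p164603 (lead c8 wave 8), `Theorems/BalabanIRBirComplexStableXYRStubBerryWeightsReflect.lean`
  FSUnfolding.stub_berryWeightsReflect

/-- **stub E5 (S): spatial holonomies carry no Berry phase.**  If the Berry weights are (R)-odd (E4) then, with (U1)
(`Σ_w m_w = Σ_n Re(c_n)·Σ_w n_w = 0`), their first spatial moments vanish: `Σ_w m_w w₁ = Σ_w m_w w₂ = 0` (pair `w` with
`Rw`, which has the same spatial coordinates).  Hence the phase `K|Λ|Σ_w m_w v̄_h(w)` of the constant twist `v̄_h` is
`2πK L² h₂ · Σ_w m_w w₃`: only the TEMPORAL holonomy is tilted. -/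
theorem stub_spatialBerryZero :
    ∀ (r : ℕ) (c : Table r), (∀ n ∈ c.support, ∑ w, n w = 0) →
      ∀ (m : W r → ℝ), (∀ w : W r, m w = c.sum (fun n a => a.re * (n w : ℝ))) →
      (∀ w : W r, m (w.1, w.2.1, Fin.rev w.2.2) = -m w) →
      (∑ w : W r, m w = 0) ∧ (∑ w : W r, m w * ((w.1 : ℕ) : ℝ) = 0) ∧ (∑ w : W r, m w * ((w.2.1 : ℕ) : ℝ) = 0) :=
  -- LANDED: p164623 (lead c8 wave 8), `Theorems/BalabanIRBirComplexStableXYRStubSpatialBerryZero.lean`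
  FSUnfolding.stub_spatialBerryZero

/-- **stub E6 (S/M): no space–time cross terms in the Gaussian holonomy energy.**  Under (U1) and (R) the window Hessian
form of a linear configuration splits: `Q(w ↦ xw₁ + yw₂ + tw₃) = Q(w ↦ xw₁ + yw₂) + Q(w ↦ tw₃)` (the cross term
`Σ_n Re(−c_n)(x a_n + y b_n)(t t_n)`, `a_n = Σ_w n_w w₁`, `b_n = Σ_w n_w w₂`, `t_n = Σ_w n_w w₃`, is odd under the
support-preserving involution `n ↦ −(n∘R)`: `Re c` even, `a, b` odd, `t` even by (U1)).  So the Gaussian vortex-free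
sum factorises into a real spatial theta series and the tilted temporal one. -/
theorem stub_holonomyFormSplit :
    ∀ (r : ℕ) (c : Table r), (∀ n ∈ c.support, ∑ w, n w = 0) →
      (∀ n : Freq r, c (fun w => n (w.1, w.2.1, Fin.rev w.2.2)) = (starRingEnd ℂ) (c (-n))) →
      ∀ (Q : (W r → ℝ) → ℝ),
      (∀ u : W r → ℝ, Q u = (-c.sum (fun n a => a * (((∑ w, (n w : ℝ) * u w) ^ 2 : ℝ) : ℂ))).re) →
      ∀ (x y t : ℝ),
        Q (fun w => x * ((w.1 : ℕ) : ℝ) + y * ((w.2.1 : ℕ) : ℝ) + t * ((w.2.2 : ℕ) : ℝ)) =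
          Q (fun w => x * ((w.1 : ℕ) : ℝ) + y * ((w.2.1 : ℕ) : ℝ)) + Q (fun w => t * ((w.2.2 : ℕ) : ℝ)) :=
  -- LANDED: p164893 (lead c8 wave 8), `Theorems/BalabanIRBirComplexStableXYRStubHolonomyFormSplit.lean`
  FSUnfolding.stub_holonomyFormSplit

/-- **stub E7 (S): the tilted theta series is positive (Poisson summation / charge representation).**  For `E > 0` and real
`α`, `Σ_{h∈ℤ} e^{−Eh² + iαh} = √(π/E)·Σ_{m∈ℤ} e^{−(α−2πm)²/(4E)}` is a POSITIVE real number (Mathlib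
`tsum_exp_neg_quadratic` with `a = E/π`, `b = iα/(2π)`).  This is the Gaussian-level positivity of the vortex-free
sum in every regime of `E = 2π²Kρ_tL²/M`, including `M ≫ KL²` where the winding series oscillates wildly. -/
theorem stub_thetaPositive :
    ∀ (E α : ℝ), 0 < E →
      Summable (fun h : ℤ => Complex.exp (-((E * (h : ℝ) ^ 2 : ℝ) : ℂ) + Complex.I * ((α * (h : ℝ) : ℝ) : ℂ))) ∧
      0 < (∑' h : ℤ, Complex.exp (-((E * (h : ℝ) ^ 2 : ℝ) : ℂ) + Complex.I * ((α * (h : ℝ) : ℝ) : ℂ))).re ∧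
      (∑' h : ℤ, Complex.exp (-((E * (h : ℝ) ^ 2 : ℝ) : ℂ) + Complex.I * ((α * (h : ℝ) : ℝ) : ℂ))).im = 0 :=
  -- LANDED: p164777 (lead c8 wave 8), `Theorems/BalabanIRBirComplexStableXYRStubThetaPositive.lean`
  FSUnfolding.stub_thetaPositive


/-! ## Chapter 2, wave 9 (lead c8): the scale-0 small-field vertex in the `T_φ` seminorm, the Gaussian normal
form of the sector integrals, and coercivity of the spatial holonomy form

The `T_φ(𝔥)` seminorm (BBS Def. 7.1.1, landed `tphiSeminorm`) of the window weight is controlled by hypothesis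
(A) ALONE: a character `u ↦ e^{i n·u}` has `‖·‖_{T_φ(𝔥)} ≤ e^{𝔥|n|₁}` at every point (it is `exp` of a purely
imaginary linear functional of operator norm `|n|₁` for the sup norm on `W r → ℝ`), so
`‖genF c‖_{T_φ(𝔥),u} ≤ Σ_n |c_n| e^{𝔥|n|₁} ≤ normA c ≤ B` for `𝔥 ≤ 1` — this is WHY (A) has the form it has.  With the
degree-2 Taylor polynomial of `genF c` at `0` identified as `i m·u + ½Q(u)` ((N), C7, (I3)), the landed Taylor
remainder estimate `tphiSeminorm_taylorRemainder_le` turns this into the `T_φ` bound of the scale-0 small-field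
vertex `V = genF c − i m·u − ½Q`: `‖V‖_{T_φ(ℓ),u} ≤ 2(ℓ + ‖u‖)³B` — the input of the fluctuation step
(`tphiSeminorm_gaussian_convolution_le`, seat 0) at `ℓ = (Kc₀)^{-1/2}`, `‖u‖ ≤ p = K^{-1/3-δ}`.  The Gaussian
normal form rewrites every sector integral of R9/R10 as `gaussZ(K H'_c) · 𝔼_{N(0,(K H'_c)⁻¹)}[…]` with the
pinned window-Hessian matrix `H'_c` (positive definite by P1e), so that the finite-range decomposition of
`(H_c)⁻¹` and the Gaussian toolkit act on the representation verbatim. -/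

/-- **stub G1 (S/M, generic): `T_φ` seminorm of a continuous linear functional.**  For `ℓ : E →L[ℝ] ℂ`,
`tphiSeminorm N 𝔥 ℓ φ ≤ ‖ℓ φ‖ + 𝔥‖ℓ‖` (`D¹ℓ = ℓ` has norm `‖ℓ‖` through the curry isometry, `Dᵖℓ = 0` for
`p ≥ 2`; for `N = 0` the bound is `‖ℓ φ‖`). -/
theorem stub_tphiSeminorm_clm_le :
    ∀ (E : Type) [NormedAddCommGroup E] [NormedSpace ℝ E] (ℓ : E →L[ℝ] ℂ) (N : ℕ) (𝔥 : ℝ), 0 ≤ 𝔥 →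
      ∀ φ : E, tphiSeminorm N 𝔥 (fun x => ℓ x) φ ≤ ‖ℓ φ‖ + 𝔥 * ‖ℓ‖ :=
  -- LANDED: p165823 (lead c8 wave 9), `Theorems/BalabanIRBirComplexStableXYRStubTphiSeminormClmLe.lean`
  FSUnfolding.stub_tphiSeminorm_clm_le

/-- **stub G2 (S/M): `T_φ` seminorm of a character.**  Given G1 (as a hypothesis), for every frequency `n` the
window character `u ↦ exp(i·Σ_w n_w u_w)` satisfies `‖·‖_{T_φ(𝔥),u} ≤ e^{𝔥·Σ_w|n_w|}` at every `u` (landed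
`tphiSeminorm_cexp_le` with the purely imaginary linear exponent `F = i·(n·u)`: `e^{Re F} = 1`, and
`tphiSeminorm F − ‖F u‖ ≤ 𝔥‖F‖_{op} ≤ 𝔥|n|₁` for the sup norm on `W r → ℝ`). -/
theorem stub_tphiSeminorm_char_le :
    (∀ (E : Type) [NormedAddCommGroup E] [NormedSpace ℝ E] (ℓ : E →L[ℝ] ℂ) (N : ℕ) (𝔥 : ℝ), 0 ≤ 𝔥 →
      ∀ φ : E, tphiSeminorm N 𝔥 (fun x => ℓ x) φ ≤ ‖ℓ φ‖ + 𝔥 * ‖ℓ‖) →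
    ∀ (r : ℕ) (n : Freq r) (N : ℕ) (𝔥 : ℝ), 0 ≤ 𝔥 → ∀ u : W r → ℝ,
      tphiSeminorm N 𝔥 (fun φ : W r → ℝ => Complex.exp (Complex.I * ((∑ w, (n w : ℝ) * φ w : ℝ) : ℂ))) u ≤
        Real.exp (𝔥 * ∑ w, |(n w : ℝ)|) :=
  -- LANDED: p165909 (lead c8 wave 9), `Theorems/BalabanIRBirComplexStableXYRStubTphiSeminormCharLe.lean`
  FSUnfolding.stub_tphiSeminorm_char_le

/-- **stub G3 (M): hypothesis (A) is the `T_φ(1)` bound of the window weight.**  Given G2 (as a hypothesis), for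
`0 ≤ 𝔥 ≤ 1` and every table: `tphiSeminorm N 𝔥 (genF c) u ≤ normA c` at every `u` (`genF c = Σ_n c_n·χ_n` over the
finite support; `tphiSeminorm_add_le`, `tphiSeminorm_mul_le` with the constant `c_n` (`tphiSeminorm_const`),
monotonicity of `exp`, and `normA c = Σ_n ‖c_n‖e^{|n|₁}`). -/
theorem stub_tphiSeminorm_genF_le :
    (∀ (r : ℕ) (n : Freq r) (N : ℕ) (𝔥 : ℝ), 0 ≤ 𝔥 → ∀ u : W r → ℝ,
      tphiSeminorm N 𝔥 (fun φ : W r → ℝ => Complex.exp (Complex.I * ((∑ w, (n w : ℝ) * φ w : ℝ) : ℂ))) u ≤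
        Real.exp (𝔥 * ∑ w, |(n w : ℝ)|)) →
    ∀ (r : ℕ) (c : Table r) (N : ℕ) (𝔥 : ℝ), 0 ≤ 𝔥 → 𝔥 ≤ 1 → ∀ u : W r → ℝ,
      tphiSeminorm N 𝔥 (fun φ : W r → ℝ => genF c φ) u ≤ normA c :=
  -- LANDED: p165784 (lead c8 wave 9), `Theorems/BalabanIRBirComplexStableXYRStubTphiSeminormGenFLe.lean`
  FSUnfolding.stub_tphiSeminorm_genF_le

/-- **stub G4 (S): the window weight is smooth** (a finite sum of exponentials of linear functionals). -/
theorem stub_genF_contDiff :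
    ∀ (r : ℕ) (c : Table r) (N : ℕ), ContDiff ℝ N (fun φ : W r → ℝ => genF c φ) :=
  -- LANDED: p165725 (lead c8 wave 9), `Theorems/BalabanIRBirComplexStableXYRStubGenFContDiff.lean`
  FSUnfolding.stub_genF_contDiff

/-- **stub G5 (M/L): the second-order Taylor polynomial of the window weight at `0` is `i m·u + ½Q(u)`.**  Under (N)
(`genF c 0 = Σ c_n = 0`), (C) (so `Σ_n Im(c_n) n = 0`, landed `stub_imGradientZero`: the linear part
`i·Σ_n c_n (n·u)` is `i·m·u`, `m_w = Σ_n Re(c_n) n_w`) and (I3) (the quadratic part `−½Σ_n c_n (n·u)²` is REAL, equal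
to `½Q(u)`): `taylorPolyFD 2 (genF c) u = i·(m·u) + ½Q(u)` (landed `taylorPolyFD`: `Σ_{p≤2} (p!)⁻¹ Dᵖ(genF c)(0)[u,…,u]`;
the diagonal derivatives of `u ↦ e^{i n·u}` at `0` are `(i n·u)ᵖ`, e.g. via `cvxr_hasDerivAt_genF_line` /
`iteratedFDeriv` of `cexp ∘` linear). -/
theorem stub_taylorPolyFD_two_genF :
    ∀ (r : ℕ) (c : Table r) (c₀ : ℝ), 0 < c₀ → c.sum (fun _ a => a) = 0 →
      (∀ φ : W r → ℝ, c₀ * ∑ w, ∑ w', (1 - Real.cos (φ w - φ w')) ≤ (genF c φ).re) →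
      (∀ v : W r → ℝ, c.sum (fun n a => a.im * (∑ w, (n w : ℝ) * v w) ^ 2) = 0) →
      ∀ (Q : (W r → ℝ) → ℝ),
      (∀ u : W r → ℝ, Q u = (-c.sum (fun n a => a * (((∑ w, (n w : ℝ) * u w) ^ 2 : ℝ) : ℂ))).re) →
      ∀ (m : W r → ℝ), (∀ w : W r, m w = c.sum (fun n a => a.re * (n w : ℝ))) →
      ∀ u : W r → ℝ,
        taylorPolyFD 2 (fun φ : W r → ℝ => genF c φ) u =
          Complex.I * ((∑ w : W r, m w * u w : ℝ) : ℂ) + (((Q u / 2) : ℝ) : ℂ) :=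
  -- LANDED: p166137 (lead c8 wave 9), `Theorems/BalabanIRBirComplexStableXYRStubTaylorPolyFDTwoGenF.lean`
  FSUnfolding.stub_taylorPolyFD_two_genF

/-- **stub G6 (M): the Gaussian normal form of the pinned sector integrals.**  With the window-Hessian matrix `H`
of the thin form (hypothesis `hH`: the landed `thinForm_d0_eq_hessianForm` matrix, `Σ_s Q(P_s(d₀φ)) = φᵀHφ` under
(U1)) and its pinned block `H' = H|_{Λ∖0}`: for `K > 0`, `K•H'` is positive definite ((N)+(C)+`r ≥ 2`: coercivity
`stub_thinFormCoercive` and `TorusChart.posDef_submatrix_of_d₀_coercive`), and for every `G`,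
`∫ e^{−(K/2)Σ_s Q(P_s d₀(extZero ψ))} G(ψ) dψ = gaussZ(K•H') · ∫ G d N(0,(K•H')⁻¹)` (`TorusChart.dotProduct_mulVec_extZero`
+ `integral_pi_mul_exp_neg_half_mul_eq`).  This is the form in which the finite-range decomposition of `(H_c)⁻¹`
and the Gaussian toolkit (seats 0/1) act on R9/R10. -/
theorem stub_sectorNormalForm :
    ∀ (r : ℕ) (c : Table r) (c₀ : ℝ), 2 ≤ r → 0 < c₀ → (∀ n ∈ c.support, ∑ w, n w = 0) →
      c.sum (fun _ a => a) = 0 →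
      (∀ φ : W r → ℝ, c₀ * ∑ w, ∑ w', (1 - Real.cos (φ w - φ w')) ≤ (genF c φ).re) →
      ∀ (L M : ℕ) [NeZero L] [NeZero M]
      (P : (Λ L M → Fin 3 → ℝ) → Λ L M → W r → ℝ),
      (∀ (ω : Λ L M → Fin 3 → ℝ) (s : Λ L M) (w : W r), P ω s w =
        (TorusChart.piProdZMod 2 L M).lineSum ω 0 (w.1 : ℕ) s
          + (TorusChart.piProdZMod 2 L M).lineSum ω 1 (w.2.1 : ℕ) (s + (w.1 : ℕ) • (TorusChart.piProdZMod 2 L M).gen 0)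
          + (TorusChart.piProdZMod 2 L M).lineSum ω 2 (w.2.2 : ℕ)
            (s + (w.1 : ℕ) • (TorusChart.piProdZMod 2 L M).gen 0 + (w.2.1 : ℕ) • (TorusChart.piProdZMod 2 L M).gen 1)) →
      ∀ (Q : (W r → ℝ) → ℝ),
      (∀ u : W r → ℝ, Q u = (-c.sum (fun n a => a * (((∑ w, (n w : ℝ) * u w) ^ 2 : ℝ) : ℂ))).re) →
      ∀ (H : Matrix (Λ L M) (Λ L M) ℝ),
      (∀ i j : Λ L M, H i j = (-(∑ k : Λ L M × ↥c.support, c k.2 *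
          ((∑ w, ((k.2 : Freq r) w : ℝ) * (if sh L M k.1 w = i then (1 : ℝ) else 0) : ℝ) : ℂ) *
          ((∑ w, ((k.2 : Freq r) w : ℝ) * (if sh L M k.1 w = j then (1 : ℝ) else 0) : ℝ) : ℂ))).re) →
      ∀ (K : ℝ), 0 < K →
        (K • H.submatrix Subtype.val Subtype.val :
            Matrix (TorusChart.Punctured (Λ L M)) (TorusChart.Punctured (Λ L M)) ℝ).PosDef ∧
        ∀ (G : (TorusChart.Punctured (Λ L M) → ℝ) → ℂ),
          ∫ ψ : TorusChart.Punctured (Λ L M) → ℝ,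
              Complex.exp (-(((K / 2 * ∑ s : Λ L M, Q (P ((TorusChart.piProdZMod 2 L M).d₀
                (TorusChart.extZero ψ)) s)) : ℝ) : ℂ)) * G ψ =
            ((GaussianToolkit.gaussZ (K • H.submatrix Subtype.val Subtype.val :
                Matrix (TorusChart.Punctured (Λ L M)) (TorusChart.Punctured (Λ L M)) ℝ)).toReal : ℂ) *
              ∫ x, G (WithLp.ofLp x) ∂(ProbabilityTheory.multivariateGaussian 0
                (K • H.submatrix Subtype.val Subtype.val :
                  Matrix (TorusChart.Punctured (Λ L M)) (TorusChart.Punctured (Λ L M)) ℝ)⁻¹) :=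
  -- LANDED: p165787 (lead c8 wave 9), `Theorems/BalabanIRBirComplexStableXYRStubSectorNormalForm.lean`
  FSUnfolding.stub_sectorNormalForm

/-- **stub A1 (S): coercivity of the spatial holonomy form.**  Under (N), (C) and `r ≥ 2` the window Hessian form
of a spatially linear configuration dominates `c₀(x² + y²)` (window-level second-order condition
`cvxr_re_hess_origin_ge`: `Q(v) ≥ c₀ΣΣ(v_w − v_w')²`, and the pairs of window sites one unit step apart in
direction `0` (resp. `1`) alone contribute `≥ x²` (resp. `y²`)).  Makes the spatial theta series of the Gaussian
vortex-free sum summable (and trivially positive). -/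
theorem stub_spatialHolonomyFormCoercive :
    ∀ (r : ℕ) (c : Table r) (c₀ : ℝ), 2 ≤ r → 0 < c₀ → c.sum (fun _ a => a) = 0 →
      (∀ φ : W r → ℝ, c₀ * ∑ w, ∑ w', (1 - Real.cos (φ w - φ w')) ≤ (genF c φ).re) →
      ∀ (Q : (W r → ℝ) → ℝ),
      (∀ u : W r → ℝ, Q u = (-c.sum (fun n a => a * (((∑ w, (n w : ℝ) * u w) ^ 2 : ℝ) : ℂ))).re) →
      ∀ (x y : ℝ), c₀ * (x ^ 2 + y ^ 2) ≤ Q (fun w => x * ((w.1 : ℕ) : ℝ) + y * ((w.2.1 : ℕ) : ℝ)) :=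
  -- LANDED: p165767 (lead c8 wave 9), `Theorems/BalabanIRBirComplexStableXYRStubSpatialHolonomyFormCoercive.lean`
  FSUnfolding.stub_spatialHolonomyFormCoercive


/-- **stub G7 (lead c8; assembly of G1–G5): the scale-0 small-field vertex and local factor in the `T_φ` seminorm.**
Under (N), (C), (I3) and `normA c ≤ B`: for `N ≥ 3`, `0 < ℓ ≤ 1`, `K ≥ 0` and every window configuration `u`,
the cubic vertex `V(u) = genF c u − i m·u − ½Q(u)` has `‖V‖_{T_φ(ℓ),u} ≤ 2(ℓ + ‖u‖)³B` and the reduced local factor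
`R̃ = e^{−KV}` has `‖R̃‖_{T_φ(ℓ),u} ≤ exp(4KB(ℓ + ‖u‖)³)` — at `ℓ = (Kc₀)^{-1/2}`, `‖u‖ ≤ p = K^{-1/3-δ}` the exponent is
`O(B K^{-3δ})`: the small-field vertex is perturbative in the norm of the fluctuation step, uniformly over the class. -/
theorem stub_smallFieldVertex :
    ∀ (r : ℕ) (B c₀ : ℝ) (c : Table r), 0 < c₀ → c.sum (fun _ a => a) = 0 → normA c ≤ B →
      (∀ φ : W r → ℝ, c₀ * ∑ w, ∑ w', (1 - Real.cos (φ w - φ w')) ≤ (genF c φ).re) →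
      (∀ v : W r → ℝ, c.sum (fun n a => a.im * (∑ w, (n w : ℝ) * v w) ^ 2) = 0) →
      ∀ (Q : (W r → ℝ) → ℝ),
      (∀ u : W r → ℝ, Q u = (-c.sum (fun n a => a * (((∑ w, (n w : ℝ) * u w) ^ 2 : ℝ) : ℂ))).re) →
      ∀ (m : W r → ℝ), (∀ w : W r, m w = c.sum (fun n a => a.re * (n w : ℝ))) →
      ∀ (K : ℝ), 0 ≤ K → ∀ (N : ℕ), 3 ≤ N → ∀ (ℓ : ℝ), 0 < ℓ → ℓ ≤ 1 → ∀ u : W r → ℝ,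
        tphiSeminorm N ℓ (fun v : W r → ℝ =>
            genF c v - Complex.I * ((∑ w : W r, m w * v w : ℝ) : ℂ) - (((Q v / 2) : ℝ) : ℂ)) u ≤
          2 * (ℓ + ‖u‖) ^ 3 * B ∧
        tphiSeminorm N ℓ (fun v : W r → ℝ => Complex.exp (-((K : ℂ) *
            (genF c v - Complex.I * ((∑ w : W r, m w * v w : ℝ) : ℂ) - (((Q v / 2) : ℝ) : ℂ))))) u ≤
          Real.exp (4 * K * B * (ℓ + ‖u‖) ^ 3) :=
  -- LANDED: p166739 (lead c8), `Theorems/BalabanIRBirComplexStableXYRSmallFieldVertex.lean`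
  FSUnfolding.stub_smallFieldVertex


/-! ## Chapter 2, wave 10 (lead c8): holonomy sector data, the analyticity strip, conjugation of the twisted
integrals, and the exact compensation of the Gaussian vortex prefactor -/

/-- **stub H1 (M): the Gaussian data of a vortex-free sector, assembled.**  Under (U1), (N), (C), (R), `r ≥ 2`: for an
integer `1`-cochain `a` with `d₁a = 0` and windings `h`, and ANY strain `σ = 2πa − d₀ψ` with the Pythagoras property of
R9, (i) the Gaussian sector energy is `Σ_s Q(P_s σ) = |Λ|·(Q(w ↦ x w₁ + y w₂) + (2πh₂/M)²·Q(w ↦ w₃))` with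
`x = 2πh₀/L`, `y = 2πh₁/L` (E3: `σ` is the constant twist; E2: its window configuration; E6: no space–time cross
term; homogeneity of `Q`), and (ii) the Berry phase functional is `Σ_s Σ_w m_w P_s σ w = |Λ|·(2πh₂/M)·Σ_w m_w w₃`
(E2, E4/E5: spatial moments of `m` vanish).  With C8/D1 and `|Λ| = L²M`: sector `(0,h)` of R9 carries exactly
`exp(−(K/2)|Λ|Q_sp(h₀,h₁)) · exp(−2π²Kρ_t L² h₂²/M) · exp(2πi K L² μ h₂)`, `ρ_t = Q(w ↦ w₃)`, `μ = Σ_w m_w w₃`. -/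
theorem stub_holonomySectorData :
    ∀ (r : ℕ) (c : Table r) (c₀ : ℝ), 2 ≤ r → 0 < c₀ → (∀ n ∈ c.support, ∑ w, n w = 0) →
      c.sum (fun _ a => a) = 0 →
      (∀ φ : W r → ℝ, c₀ * ∑ w, ∑ w', (1 - Real.cos (φ w - φ w')) ≤ (genF c φ).re) →
      (∀ n : Freq r, c (fun w => n (w.1, w.2.1, Fin.rev w.2.2)) = (starRingEnd ℂ) (c (-n))) →
      ∀ (L M : ℕ) [NeZero L] [NeZero M]
      (P : (Λ L M → Fin 3 → ℝ) → Λ L M → W r → ℝ),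
      (∀ (ω : Λ L M → Fin 3 → ℝ) (s : Λ L M) (w : W r), P ω s w =
        (TorusChart.piProdZMod 2 L M).lineSum ω 0 (w.1 : ℕ) s
          + (TorusChart.piProdZMod 2 L M).lineSum ω 1 (w.2.1 : ℕ) (s + (w.1 : ℕ) • (TorusChart.piProdZMod 2 L M).gen 0)
          + (TorusChart.piProdZMod 2 L M).lineSum ω 2 (w.2.2 : ℕ)
            (s + (w.1 : ℕ) • (TorusChart.piProdZMod 2 L M).gen 0 + (w.2.1 : ℕ) • (TorusChart.piProdZMod 2 L M).gen 1)) →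
      ∀ (Q : (W r → ℝ) → ℝ),
      (∀ u : W r → ℝ, Q u = (-c.sum (fun n a => a * (((∑ w, (n w : ℝ) * u w) ^ 2 : ℝ) : ℂ))).re) →
      ∀ (m : W r → ℝ), (∀ w : W r, m w = c.sum (fun n a => a.re * (n w : ℝ))) →
      ∀ (h : Fin 3 → ℤ) (a : Λ L M → Fin 3 → ℤ), (TorusChart.piProdZMod 2 L M).d₁ a = 0 →
        (TorusChart.piProdZMod 2 L M).wind a = h →
      ∀ (σ : Λ L M → Fin 3 → ℝ),
        (∃ ψ : Λ L M → ℝ, σ = fun x i => 2 * Real.pi * (a x i : ℝ) - (TorusChart.piProdZMod 2 L M).d₀ ψ x i) →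
        (∀ u : Λ L M → ℝ,
          ∑ s : Λ L M, Q (P (fun x i => (TorusChart.piProdZMod 2 L M).d₀ u x i - σ x i) s) =
            ∑ s : Λ L M, Q (P ((TorusChart.piProdZMod 2 L M).d₀ u) s) + ∑ s : Λ L M, Q (P σ s)) →
        (∑ s : Λ L M, Q (P σ s) =
          (Fintype.card (Λ L M) : ℝ) *
            (Q (fun w : W r => 2 * Real.pi * (h 0 : ℝ) / L * ((w.1 : ℕ) : ℝ) + 2 * Real.pi * (h 1 : ℝ) / L * ((w.2.1 : ℕ) : ℝ))
              + (2 * Real.pi * (h 2 : ℝ) / M) ^ 2 * Q (fun w : W r => ((w.2.2 : ℕ) : ℝ)))) ∧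
        (∑ s : Λ L M, ∑ w : W r, m w * P σ s w =
          (Fintype.card (Λ L M) : ℝ) * (2 * Real.pi * (h 2 : ℝ) / M) * ∑ w : W r, m w * ((w.2.2 : ℕ) : ℝ)) :=
  -- LANDED: p167343 (lead c8 wave 10), `Theorems/BalabanIRBirComplexStableXYRStubHolonomySectorData.lean`
  FSUnfolding.stub_holonomySectorData

/-- **stub H2 (S): the analyticity strip of hypothesis (A).**  The window weight extends to complex window configurations
`u + iv`, `genF c (u + iv) = Σ_n c_n e^{i n·u − n·v}`, and on the strip `‖v‖_∞ ≤ 1` its modulus is at most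
`Σ_n |c_n| e^{|n|₁} = normA c` (termwise `|e^{i n·u − n·v}| = e^{−n·v} ≤ e^{|n|₁‖v‖_∞}`).  This is the bound every
complex-translation / contour-shift argument of the endgame (imaginary chemical potential, charge sectors) uses. -/
theorem stub_genF_complexShift_le :
    ∀ (r : ℕ) (c : Table r) (u v : W r → ℝ), (∀ w : W r, |v w| ≤ 1) →
      ‖c.sum (fun n a => a * Complex.exp (Complex.I * ((∑ w, (n w : ℝ) * u w : ℝ) : ℂ)
          - ((∑ w, (n w : ℝ) * v w : ℝ) : ℂ)))‖ ≤ normA c :=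
  -- LANDED: p167161 (lead c8 wave 10), `Theorems/BalabanIRBirComplexStableXYRStubGenFComplexShiftLe.lean`
  FSUnfolding.stub_genF_complexShift_le

/-- **stub H5 (M/L): conjugating the twisted vortex-free integrals flips the twist.**  Under (U1), (R), (P): for every
constant real twist `x i ↦ t i` the pinned R9-type integral
`I(t) = ∫ e^{−(K/2)Σ_s Q(P_s d₀ψ̂)} Π_s exp(−K genF c(P_s(d₀ψ̂ − t)) + (K/2)Q(P_s(d₀ψ̂ − t))) · Π_{x,i} W_v(d₀ψ̂(x,i) − t i) dψ`
(`ψ̂ = extZero ψ`) satisfies `conj I(t) = I(−t)` (substitute `ψ ↦ ψ ∘ neg`, a volume-preserving coordinate permutation of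
`Punctured Λ → ℝ`; `d₀(ψ̂∘neg)(x,i) = −d₀ψ̂(−x−e_i,i)`; window configurations go to `u ∘ RP −` const with
`genF c (u∘RP) = conj genF c u` ((R)∧(P)), `Q(u∘RP) = Q u`, and constant shifts invisible by (U1); the constant cochain
`t` goes to `−t` up to such a constant; the smoothed box is even, `smoothedBox_even`/`bondWeight_comp_neg`).  With E7/H1
this makes the vortex-free series real term-by-term-pair `h ↔ −h`. -/
theorem stub_twistIntegralConj :
    ∀ (r : ℕ) (K : ℝ) (c : Table r), (∀ n ∈ c.support, ∑ w, n w = 0) →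
      (∀ n : Freq r, c (fun w => n (w.1, w.2.1, Fin.rev w.2.2)) = (starRingEnd ℂ) (c (-n))) →
      (∀ n : Freq r, c (fun w => n (Fin.rev w.1, Fin.rev w.2.1, w.2.2)) = c n) →
      ∀ (L M : ℕ) [NeZero L] [NeZero M] (v : NNReal)
      (P : (Λ L M → Fin 3 → ℝ) → Λ L M → W r → ℝ),
      (∀ (ω : Λ L M → Fin 3 → ℝ) (s : Λ L M) (w : W r), P ω s w =
        (TorusChart.piProdZMod 2 L M).lineSum ω 0 (w.1 : ℕ) s
          + (TorusChart.piProdZMod 2 L M).lineSum ω 1 (w.2.1 : ℕ) (s + (w.1 : ℕ) • (TorusChart.piProdZMod 2 L M).gen 0)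
          + (TorusChart.piProdZMod 2 L M).lineSum ω 2 (w.2.2 : ℕ)
            (s + (w.1 : ℕ) • (TorusChart.piProdZMod 2 L M).gen 0 + (w.2.1 : ℕ) • (TorusChart.piProdZMod 2 L M).gen 1)) →
      ∀ (Q : (W r → ℝ) → ℝ),
      (∀ u : W r → ℝ, Q u = (-c.sum (fun n a => a * (((∑ w, (n w : ℝ) * u w) ^ 2 : ℝ) : ℂ))).re) →
      ∀ (t : Fin 3 → ℝ),
        (starRingEnd ℂ) (∫ ψ : TorusChart.Punctured (Λ L M) → ℝ,
            Complex.exp (-(((K / 2 * ∑ s : Λ L M, Q (P ((TorusChart.piProdZMod 2 L M).d₀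
              (TorusChart.extZero ψ)) s)) : ℝ) : ℂ)) *
            ((∏ s : Λ L M, Complex.exp
              (-((K : ℂ) * genF c (P (fun x i => (TorusChart.piProdZMod 2 L M).d₀
                  (TorusChart.extZero ψ) x i - t i) s))
                + (((K / 2 * Q (P (fun x i => (TorusChart.piProdZMod 2 L M).d₀
                  (TorusChart.extZero ψ) x i - t i) s)) : ℝ) : ℂ))) *
            ∏ x : Λ L M, ∏ i : Fin 3, ((∫ τ in Set.Icc (-Real.pi) Real.pi, ProbabilityTheory.gaussianPDFReal 0 v
              ((TorusChart.piProdZMod 2 L M).d₀ (TorusChart.extZero ψ) x i - t i - τ) : ℝ) : ℂ))) =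
        ∫ ψ : TorusChart.Punctured (Λ L M) → ℝ,
            Complex.exp (-(((K / 2 * ∑ s : Λ L M, Q (P ((TorusChart.piProdZMod 2 L M).d₀
              (TorusChart.extZero ψ)) s)) : ℝ) : ℂ)) *
            ((∏ s : Λ L M, Complex.exp
              (-((K : ℂ) * genF c (P (fun x i => (TorusChart.piProdZMod 2 L M).d₀
                  (TorusChart.extZero ψ) x i - (-t i)) s))
                + (((K / 2 * Q (P (fun x i => (TorusChart.piProdZMod 2 L M).d₀
                  (TorusChart.extZero ψ) x i - (-t i)) s)) : ℝ) : ℂ))) *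
            ∏ x : Λ L M, ∏ i : Fin 3, ((∫ τ in Set.Icc (-Real.pi) Real.pi, ProbabilityTheory.gaussianPDFReal 0 v
              ((TorusChart.piProdZMod 2 L M).d₀ (TorusChart.extZero ψ) x i - (-t i) - τ) : ℝ) : ℂ)) :=
  -- LANDED: p168003 (lead c8 wave 10), `Theorems/BalabanIRBirComplexStableXYRStubTwistIntegralConj.lean`
  FSUnfolding.stub_twistIntegralConj

/-- **stub H8 (S/M): the Gaussian vortex prefactor is exactly compensated; what is left is the periodic fat Gaussian.**
For ANY strain `σ` with the Pythagoras property and any real field `u`, the modulus of the full R9 sector integrand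
(prefactor `e^{−(K/2)𝒬(σ)}`, thin Gaussian `e^{−(K/2)𝒬(d₀u)}`, local factors `Π_s R_s(P_s(d₀u − σ))`) is at most the
FAT-Gaussian weight `exp(−(2c₀K/π²)·Σ_s ΣΣ pv((P_s(d₀u−σ))_w − (P_s(d₀u−σ))_{w'})²)` of `d₀u − σ` (S2 window-wise, and
`Σ_s Q(P_s(d₀u − σ)) = 𝒬(d₀u) + 𝒬(σ)`).  So the sector prefactor of R9 is NOT a free smallness: the cost of a vortex
sector is the CORE energy of the periodic fat Gaussian (S6), as in every Peierls estimate for vortices. -/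
theorem stub_sectorModulusFat :
    ∀ (r : ℕ) (K : ℝ) (c : Table r) (c₀ : ℝ), 0 ≤ c₀ → 0 ≤ K →
      (∀ φ : W r → ℝ, c₀ * ∑ w, ∑ w', (1 - Real.cos (φ w - φ w')) ≤ (genF c φ).re) →
      ∀ (L M : ℕ) [NeZero L] [NeZero M]
      (P : (Λ L M → Fin 3 → ℝ) → Λ L M → W r → ℝ),
      (∀ (ω : Λ L M → Fin 3 → ℝ) (s : Λ L M) (w : W r), P ω s w =
        (TorusChart.piProdZMod 2 L M).lineSum ω 0 (w.1 : ℕ) s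
          + (TorusChart.piProdZMod 2 L M).lineSum ω 1 (w.2.1 : ℕ) (s + (w.1 : ℕ) • (TorusChart.piProdZMod 2 L M).gen 0)
          + (TorusChart.piProdZMod 2 L M).lineSum ω 2 (w.2.2 : ℕ)
            (s + (w.1 : ℕ) • (TorusChart.piProdZMod 2 L M).gen 0 + (w.2.1 : ℕ) • (TorusChart.piProdZMod 2 L M).gen 1)) →
      ∀ (Q : (W r → ℝ) → ℝ),
      (∀ u : W r → ℝ, Q u = (-c.sum (fun n a => a * (((∑ w, (n w : ℝ) * u w) ^ 2 : ℝ) : ℂ))).re) →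
      ∀ (σ : Λ L M → Fin 3 → ℝ),
        (∀ u : Λ L M → ℝ,
          ∑ s : Λ L M, Q (P (fun x i => (TorusChart.piProdZMod 2 L M).d₀ u x i - σ x i) s) =
            ∑ s : Λ L M, Q (P ((TorusChart.piProdZMod 2 L M).d₀ u) s) + ∑ s : Λ L M, Q (P σ s)) →
      ∀ (u : Λ L M → ℝ),
        ‖Complex.exp (-(((K / 2 * ∑ s : Λ L M, Q (P σ s)) : ℝ) : ℂ)) *
          (Complex.exp (-(((K / 2 * ∑ s : Λ L M, Q (P ((TorusChart.piProdZMod 2 L M).d₀ u) s)) : ℝ) : ℂ)) *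
            ∏ s : Λ L M, Complex.exp
              (-((K : ℂ) * genF c (P (fun x i => (TorusChart.piProdZMod 2 L M).d₀ u x i - σ x i) s))
                + (((K / 2 * Q (P (fun x i => (TorusChart.piProdZMod 2 L M).d₀ u x i - σ x i) s)) : ℝ) : ℂ)))‖ ≤
          Real.exp (-(2 * c₀ * K / Real.pi ^ 2) * ∑ s : Λ L M, ∑ w : W r, ∑ w' : W r,
            (toIocMod Real.two_pi_pos (-Real.pi)
              (P (fun x i => (TorusChart.piProdZMod 2 L M).d₀ u x i - σ x i) s w
                - P (fun x i => (TorusChart.piProdZMod 2 L M).d₀ u x i - σ x i) s w')) ^ 2) :=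
  -- LANDED: p167163 (lead c8 wave 10), `Theorems/BalabanIRBirComplexStableXYRStubSectorModulusFat.lean`
  FSUnfolding.stub_sectorModulusFat


/-! ## Chapter 2, wave 11 (lead c8): Gaussian large-field rarity (bond-gradient tails of the thin Gaussian), the
bond-weight defect, the regime-1 endgame lemma (perturbed tilted theta series), and summability of the spatial
holonomy series -/

/-- **stub C1 (M): precision bound for bond gradients under the pinned thin Gaussian.**  With `H` the window-Hessian
matrix (hypothesis `hH`, as in G6) and `H' = H|_{Λ∖0}`: for `K > 0` and every bond `(x,i)`, the functional
`ψ ↦ d₀(extZero ψ)(x,i) = a·ψ`, `a_j = [j = x+e_i] − [j = x]` on `Λ∖0`, has `aᵀ(K•H')⁻¹a ≤ 1/(2c₀K)` — the variance of a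
bond gradient under `N(0,(KH')⁻¹)` is at most `1/(2c₀K)` ((a·t)² ≤ Σ_bonds (d₀ t̂)² ≤ (2c₀)⁻¹ t̂ᵀHt̂ by P1e and
`thinForm_d0_eq_hessianForm`; then `MinlosSazonov.dotProduct_inv_mulVec_le`). -/
theorem stub_bondGradientPrecision :
    ∀ (r : ℕ) (c : Table r) (c₀ : ℝ), 2 ≤ r → 0 < c₀ → (∀ n ∈ c.support, ∑ w, n w = 0) →
      c.sum (fun _ a => a) = 0 →
      (∀ φ : W r → ℝ, c₀ * ∑ w, ∑ w', (1 - Real.cos (φ w - φ w')) ≤ (genF c φ).re) →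
      ∀ (L M : ℕ) [NeZero L] [NeZero M] (H : Matrix (Λ L M) (Λ L M) ℝ),
      (∀ i j : Λ L M, H i j = (-(∑ k : Λ L M × ↥c.support, c k.2 *
          ((∑ w, ((k.2 : Freq r) w : ℝ) * (if sh L M k.1 w = i then (1 : ℝ) else 0) : ℝ) : ℂ) *
          ((∑ w, ((k.2 : Freq r) w : ℝ) * (if sh L M k.1 w = j then (1 : ℝ) else 0) : ℝ) : ℂ))).re) →
      ∀ (K : ℝ), 0 < K → ∀ (x : Λ L M) (i : Fin 3),
        (fun j : TorusChart.Punctured (Λ L M) =>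
            (if j.1 = x + (TorusChart.piProdZMod 2 L M).gen i then (1 : ℝ) else 0) - (if j.1 = x then (1 : ℝ) else 0)) ⬝ᵥ
          (K • H.submatrix Subtype.val Subtype.val :
              Matrix (TorusChart.Punctured (Λ L M)) (TorusChart.Punctured (Λ L M)) ℝ)⁻¹ *ᵥ
          (fun j : TorusChart.Punctured (Λ L M) =>
            (if j.1 = x + (TorusChart.piProdZMod 2 L M).gen i then (1 : ℝ) else 0) - (if j.1 = x then (1 : ℝ) else 0)) ≤
        1 / (2 * c₀ * K) :=
  -- LANDED: p168474 (lead c8 wave 11), `Theorems/BalabanIRBirComplexStableXYRStubBondGradientPrecision.lean`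
  FSUnfolding.stub_bondGradientPrecision

/-- **stub C2a (S/M, generic): the Gaussian tail.**  For the real centred Gaussian of variance `v` and `t ≥ 0`,
`P(|X| ≥ t) ≤ 2e^{−t²/(2v)}` (Chernoff with `mgf_gaussianReal`, both signs; for `v = 0` the law is `δ₀`). -/
theorem stub_gaussianRealTail :
    ∀ (v : NNReal) (t : ℝ), 0 ≤ t →
      (ProbabilityTheory.gaussianReal 0 v) {x : ℝ | t ≤ |x|} ≤
        ENNReal.ofReal (2 * Real.exp (-(t ^ 2 / (2 * (v : ℝ))))) :=
  -- LANDED: p168448 (lead c8 wave 11), `Theorems/BalabanIRBirComplexStableXYRStubGaussianRealTail.lean`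
  FSUnfolding.stub_gaussianRealTail

/-- **stub C2b (M, generic): linear functionals of a centred multivariate Gaussian are real Gaussians** with variance
`aᵀSa` (`IsGaussian.map_eq_gaussianReal`, `covarianceBilin_multivariateGaussian`). -/
theorem stub_multivariateGaussian_functional :
    ∀ (ι : Type) [Fintype ι] [DecidableEq ι] (S : Matrix ι ι ℝ), S.PosSemidef → ∀ (a : ι → ℝ),
      (ProbabilityTheory.multivariateGaussian 0 S).map (fun x => a ⬝ᵥ WithLp.ofLp x) =
        ProbabilityTheory.gaussianReal 0 (a ⬝ᵥ S *ᵥ a).toNNReal :=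
  -- LANDED: p168446 (lead c8 wave 11), `Theorems/BalabanIRBirComplexStableXYRStubMultivariateGaussianFunctional.lean`
  FSUnfolding.stub_multivariateGaussian_functional

/-- **stub B1 (M): the bond-weight defect lives on large fields.**  The smoothed box `W_v(η) = ∫_{[−π,π]} φ_v(η − τ)dτ`
(`φ_v` the centred Gaussian density of variance `v`) is the probability that `η + √v·Z ∈ [−π,π]`; hence, given the
Gaussian tail (C2a, as a hypothesis), for `|η| ≤ π − a`, `a ≥ 0`: `0 ≤ 1 − W_v(η) ≤ 2e^{−a²/(2v)}` — the Mayer germ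
`w_b = 1 − W_v(η_b)` of the bond weights is exponentially small off the large-field region. -/
theorem stub_bondWeightDefect :
    ∀ (v : NNReal), v ≠ 0 →
      (∀ t : ℝ, 0 ≤ t → (ProbabilityTheory.gaussianReal 0 v) {x : ℝ | t ≤ |x|} ≤
        ENNReal.ofReal (2 * Real.exp (-(t ^ 2 / (2 * (v : ℝ)))))) →
      ∀ (η a : ℝ), 0 ≤ a → |η| ≤ Real.pi - a →
        0 ≤ 1 - ∫ τ in Set.Icc (-Real.pi) Real.pi, ProbabilityTheory.gaussianPDFReal 0 v (η - τ) ∧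
        1 - ∫ τ in Set.Icc (-Real.pi) Real.pi, ProbabilityTheory.gaussianPDFReal 0 v (η - τ) ≤
          2 * Real.exp (-(a ^ 2 / (2 * (v : ℝ)))) :=
  -- LANDED: p168472 (lead c8 wave 11), `Theorems/BalabanIRBirComplexStableXYRStubBondWeightDefect.lean`
  FSUnfolding.stub_bondWeightDefect

/-- **stub H11 (M): the regime-1 endgame lemma — a perturbed tilted theta series stays positive.**  If `|Ξ(h) − 1| ≤ ε`
for all `h ∈ ℤ` and `ε·(1 + 2/(e^{π²/E} − 1)) < e^{−π²/(4E)}`, then `Re Σ_h e^{−Eh²+iαh}Ξ(h) > 0` for EVERY real tilt `α`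
(Poisson: `Σ_h e^{−Eh²+iαh} = √(π/E)Σ_m e^{−(2πm−α)²/(4E)} ≥ √(π/E)e^{−π²/(4E)}`, while the error is at most
`ε·Σ_h e^{−Eh²} ≤ ε√(π/E)(1 + 2/(e^{π²/E} − 1))`).  This is the format T-RG (i) must deliver at `q = 0` in the regime
`M ≲ C·KL²` (`E = 2π²Kρ_tL²/M` bounded below): uniform control `|Ξ(h) − 1| ≤ ε(C)` of the normalised twisted integrals.
For `M ≫ KL²` (`E → 0`) the admissible `ε` is exponentially small in `1/E` and the endgame must instead be run on the
effective 1-D rotor chain (charge representation; lead c8 line card §T-end). -/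
theorem stub_thetaPerturbedPositive :
    ∀ (E α ε : ℝ), 0 < E → 0 ≤ ε → ∀ (Ξ : ℤ → ℂ), (∀ h : ℤ, ‖Ξ h - 1‖ ≤ ε) →
      ε * (1 + 2 / (Real.exp (Real.pi ^ 2 / E) - 1)) < Real.exp (-(Real.pi ^ 2 / (4 * E))) →
      Summable (fun h : ℤ => Complex.exp (-((E * (h : ℝ) ^ 2 : ℝ) : ℂ) + Complex.I * ((α * (h : ℝ) : ℝ) : ℂ)) * Ξ h) ∧
      0 < (∑' h : ℤ, Complex.exp (-((E * (h : ℝ) ^ 2 : ℝ) : ℂ) + Complex.I * ((α * (h : ℝ) : ℝ) : ℂ)) * Ξ h).re :=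
  -- LANDED: p168602 (lead c8 wave 11), `Theorems/BalabanIRBirComplexStableXYRStubThetaPerturbedPositive.lean`
  FSUnfolding.stub_thetaPerturbedPositive

/-- **stub A2 (S/M, generic): a coercive spatial theta series is summable and positive.**  If `f(h) ≥ κ(h₀² + h₁²)` with
`κ > 0` then `Σ_{h∈ℤ²} e^{−f(h)}` converges to a positive real (domination by a product of two one-dimensional Gaussian
series).  With A1 (`Q_sp ≥ c₀(x² + y²)`) this is the spatial factor of the Gaussian vortex-free sum. -/
theorem stub_spatialThetaSummable :
    ∀ (f : ℤ × ℤ → ℝ) (κ : ℝ), 0 < κ → (∀ h : ℤ × ℤ, κ * (((h.1 : ℝ)) ^ 2 + ((h.2 : ℝ)) ^ 2) ≤ f h) →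
      Summable (fun h : ℤ × ℤ => Real.exp (-f h)) ∧ 0 < ∑' h : ℤ × ℤ, Real.exp (-f h) :=
  -- LANDED: p168451 (lead c8 wave 11), `Theorems/BalabanIRBirComplexStableXYRStubSpatialThetaSummable.lean`
  FSUnfolding.stub_spatialThetaSummable


/-! ## Chapter 2, wave 13 (lead c8): the sector integrand is the original Gibbs factor; bond-gradient tails under the thin Gaussian -/

/-- **stub S1 (S): the Gaussian splitting of R9 is a rewriting — prefactor × thin Gaussian × local factors = the Gibbs factor.**
For ANY strain `σ` with the Pythagoras property and any real field `u`:
`e^{−(K/2)𝒬(σ)} · e^{−(K/2)𝒬(d₀u)} · Π_s exp(−K genF c(P_s(d₀u − σ)) + (K/2)Q(P_s(d₀u − σ))) = Π_s exp(−K genF c (P_s(d₀u − σ)))`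
(`exp_add`, `Finset.prod_mul_distrib`, `Complex.exp_sum`, and `Σ_s Q(P_s(d₀u − σ)) = 𝒬(d₀u) + 𝒬(σ)`).  With R1/P1a read backwards
the right-hand side is `e^{−A(û + ψ_a)}` for `σ = σ_a`: every sector term of R9/R10 is an honest shifted Gibbs integral (so B1/B2b/B4
apply to it verbatim), and the modulus bound H8 is its immediate corollary. -/
theorem stub_sectorIntegrandExact :
    ∀ (r : ℕ) (K : ℝ) (c : Table r) (L M : ℕ) [NeZero L] [NeZero M]
      (P : (Λ L M → Fin 3 → ℝ) → Λ L M → W r → ℝ),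
      (∀ (ω : Λ L M → Fin 3 → ℝ) (s : Λ L M) (w : W r), P ω s w =
        (TorusChart.piProdZMod 2 L M).lineSum ω 0 (w.1 : ℕ) s
          + (TorusChart.piProdZMod 2 L M).lineSum ω 1 (w.2.1 : ℕ) (s + (w.1 : ℕ) • (TorusChart.piProdZMod 2 L M).gen 0)
          + (TorusChart.piProdZMod 2 L M).lineSum ω 2 (w.2.2 : ℕ)
            (s + (w.1 : ℕ) • (TorusChart.piProdZMod 2 L M).gen 0 + (w.2.1 : ℕ) • (TorusChart.piProdZMod 2 L M).gen 1)) →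
      ∀ (Q : (W r → ℝ) → ℝ),
      (∀ u : W r → ℝ, Q u = (-c.sum (fun n a => a * (((∑ w, (n w : ℝ) * u w) ^ 2 : ℝ) : ℂ))).re) →
      ∀ (σ : Λ L M → Fin 3 → ℝ),
        (∀ u : Λ L M → ℝ,
          ∑ s : Λ L M, Q (P (fun x i => (TorusChart.piProdZMod 2 L M).d₀ u x i - σ x i) s) =
            ∑ s : Λ L M, Q (P ((TorusChart.piProdZMod 2 L M).d₀ u) s) + ∑ s : Λ L M, Q (P σ s)) →
      ∀ (u : Λ L M → ℝ),
        Complex.exp (-(((K / 2 * ∑ s : Λ L M, Q (P σ s)) : ℝ) : ℂ)) *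
          (Complex.exp (-(((K / 2 * ∑ s : Λ L M, Q (P ((TorusChart.piProdZMod 2 L M).d₀ u) s)) : ℝ) : ℂ)) *
            ∏ s : Λ L M, Complex.exp
              (-((K : ℂ) * genF c (P (fun x i => (TorusChart.piProdZMod 2 L M).d₀ u x i - σ x i) s))
                + (((K / 2 * Q (P (fun x i => (TorusChart.piProdZMod 2 L M).d₀ u x i - σ x i) s)) : ℝ) : ℂ))) =
          ∏ s : Λ L M, Complex.exp
            (-((K : ℂ) * genF c (P (fun x i => (TorusChart.piProdZMod 2 L M).d₀ u x i - σ x i) s))) :=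
  -- LANDED: p169667 (lead c8 wave 13), `Theorems/BalabanIRBirComplexStableXYRStubSectorIntegrandExact.lean`
  FSUnfolding.stub_sectorIntegrandExact

/-- **stub C3 (M): bond-gradient tails under the pinned thin Gaussian.**  With `H`, `H'` as in G6/C1: for `K > 0`, every bond `(x,i)`
and `t ≥ 0`, `P_{N(0,(K•H')⁻¹)}(|d₀ψ̂(x,i)| ≥ t) ≤ 2e^{−c₀Kt²}` (C2b: the bond gradient is `N(0, aᵀ(KH')⁻¹a)`; C1: variance
`≤ 1/(2c₀K)`; C2a: Gaussian tail; degenerate bonds/variance handled by the Dirac law).  Large fields are RARE in measure under the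
reference Gaussian, at the rate the sup-norm factor S7 loses — the Balaban-style complement of the BBS-style regulator bound. -/
theorem stub_bondGradientTail :
    ∀ (r : ℕ) (c : Table r) (c₀ : ℝ), 2 ≤ r → 0 < c₀ → (∀ n ∈ c.support, ∑ w, n w = 0) →
      c.sum (fun _ a => a) = 0 →
      (∀ φ : W r → ℝ, c₀ * ∑ w, ∑ w', (1 - Real.cos (φ w - φ w')) ≤ (genF c φ).re) →
      ∀ (L M : ℕ) [NeZero L] [NeZero M]
      (H : Matrix (Λ L M) (Λ L M) ℝ),
      (∀ i j : Λ L M, H i j = (-(∑ k : Λ L M × ↥c.support, c k.2 *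
          ((∑ w, ((k.2 : Freq r) w : ℝ) * (if sh L M k.1 w = i then (1 : ℝ) else 0) : ℝ) : ℂ) *
          ((∑ w, ((k.2 : Freq r) w : ℝ) * (if sh L M k.1 w = j then (1 : ℝ) else 0) : ℝ) : ℂ))).re) →
      ∀ (K : ℝ), 0 < K → ∀ (x : Λ L M) (i : Fin 3) (t : ℝ), 0 ≤ t →
        (ProbabilityTheory.multivariateGaussian 0
            (K • H.submatrix Subtype.val Subtype.val :
              Matrix (TorusChart.Punctured (Λ L M)) (TorusChart.Punctured (Λ L M)) ℝ)⁻¹)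
          {ψ | t ≤ |(TorusChart.piProdZMod 2 L M).d₀ (TorusChart.extZero (WithLp.ofLp ψ)) x i|} ≤
        ENNReal.ofReal (2 * Real.exp (-(c₀ * K * t ^ 2))) :=
  -- LANDED: p169711 (lead c8 wave 13), `Theorems/BalabanIRBirComplexStableXYRStubBondGradientTail.lean`
  FSUnfolding.stub_bondGradientTail


/-- **stub W1 (M/L): the bond weight in the `T_φ` seminorm.**  The smoothed box `W_v(η) = ∫_{[−π,π]} φ_v(η−τ)dτ` is real-analytic with
`W_v' (η) = φ_v(η+π) − φ_v(η−π)` and, by Cauchy's estimate for the entire Gaussian on circles of radius `√v`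
(`|φ_v^{(j)}| ≤ j!·e^{1/2}(2πv)^{-1/2}v^{-j/2}`), `‖W_v‖_{T_φ(𝔥),η} ≤ 1 + 4𝔥/√v` for `0 ≤ 𝔥 ≤ √v/2`: at `𝔥 = (Kc₀)^{-1/2} ≪ √v` the bond
weights cost nothing in the norm of the fluctuation step. -/
theorem stub_bondWeight_tphi_le :
    ∀ (v : NNReal), v ≠ 0 → ∀ (N : ℕ) (𝔥 : ℝ), 0 ≤ 𝔥 → 𝔥 ≤ Real.sqrt v / 2 → ∀ η : ℝ,
      tphiSeminorm N 𝔥 (fun s : ℝ =>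
        ((∫ τ in Set.Icc (-Real.pi) Real.pi, ProbabilityTheory.gaussianPDFReal 0 v (s - τ) : ℝ) : ℂ)) η ≤
        1 + 4 * 𝔥 / Real.sqrt v :=
  -- LANDED: p170658 (lead c8 wave 14), `Theorems/BalabanIRBirComplexStableXYRStubBondWeightTphiLe.lean`
  FSUnfolding.stub_bondWeight_tphi_le

end Unfolding

/-! ## Chapter T-end, wave 12 (lead c8): the abstract 1-D endgame — stability of a dominant rank-one projection under a small
bounded perturbation, with power asymptotics uniform in the chain length (elementary: Feshbach fixed point + Neumann series; no
spectral theory).  Generic over a complex Banach space `E`; the crux instantiates it on the effective rotor chain of regime 2. -/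

section TEnd

/-- **stub T1 (S/M, generic): Neumann resolvent bound.**  On a complex Banach space, if `‖M‖ ≤ θ < |μ|` then `μ − M` is
invertible in the algebra of bounded operators and `‖(μ − M)⁻¹‖ ≤ 1/(|μ| − θ)` (`μ − M = μ(1 − M/μ)`, `Units.oneSub`, geometric
series).  Input of the T-end lemma (effective 1-D rotor chain endgame of S5a, regime `M ≫ KL²`). -/
theorem stub_resolventBound :
    ∀ (E : Type) [NormedAddCommGroup E] [NormedSpace ℂ E] [CompleteSpace E]
      (M : E →L[ℂ] E) (θ : ℝ), ‖M‖ ≤ θ → ∀ (μ : ℂ), θ < ‖μ‖ →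
        IsUnit (μ • (1 : E →L[ℂ] E) - M) ∧ ‖Ring.inverse (μ • (1 : E →L[ℂ] E) - M)‖ ≤ 1 / (‖μ‖ - θ) :=
  -- LANDED: p169147 (lead c8 wave 12, chapter T-end), `Theorems/BalabanIRBirComplexStableXYRTEndResolventBound.lean`
  TEnd.stub_resolventBound

/-- **stub T2 (M, generic): the Feshbach (Schur-complement) fixed point.**  For block data `a ∈ ℂ`, row functional `b`, column `c`,
complement block `M` with `‖M‖ ≤ θ < 1`, `|a − 1|, ‖b‖, ‖c‖ ≤ ε`, `4ε ≤ 1 − θ`, and the resolvent bound (T1, as a hypothesis), the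
dressed eigenvalue equation `μ = a + b (μ − M)⁻¹ c` has exactly one solution with `|μ − 1| ≤ 2ε` (Banach fixed point on the closed
disc: the map sends it into `|μ − a| ≤ ε/2` and is a `1/4`-contraction by the resolvent identity). -/
theorem stub_feshbachFixedPoint :
    ∀ (E : Type) [NormedAddCommGroup E] [NormedSpace ℂ E] [CompleteSpace E]
      (M : E →L[ℂ] E) (b : E →L[ℂ] ℂ) (c : E) (a : ℂ) (θ ε : ℝ), 0 ≤ θ → θ < 1 → 0 ≤ ε → 4 * ε ≤ 1 - θ →
      ‖M‖ ≤ θ → ‖b‖ ≤ ε → ‖c‖ ≤ ε → ‖a - 1‖ ≤ ε →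
      (∀ μ : ℂ, θ < ‖μ‖ → IsUnit (μ • (1 : E →L[ℂ] E) - M) ∧
          ‖Ring.inverse (μ • (1 : E →L[ℂ] E) - M)‖ ≤ 1 / (‖μ‖ - θ)) →
      ∃! μ : ℂ, ‖μ - 1‖ ≤ 2 * ε ∧ μ = a + b (Ring.inverse (μ • (1 : E →L[ℂ] E) - M) c) :=
  -- LANDED: p169215 (lead c8 wave 12, chapter T-end), `Theorems/BalabanIRBirComplexStableXYRTEndFeshbachFixedPoint.lean`
  TEnd.stub_feshbachFixedPoint

/-- **stub T3 (M, generic; pure algebra): dressed right and left eigenvectors.**  With the rank-one idempotent `p₀ = φ(·)e`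
(`φ e = 1`), `q₀ = 1 − p₀`, and `μ ≠ 0` solving the Feshbach equation for the block data of `t` (`a = φ(te)`, `b = φ∘t∘q₀`, `c = q₀te`,
`M = q₀tq₀`, `R = (μ − M)⁻¹`): `x = e + Rc` satisfies `t x = μx`, `ψ = φ + b∘R` satisfies `ψ∘t = μψ`, and `ψ(x) = 1 + b(R(Rc))`
(`p₀q₀ = 0`, `Me = 0` so `Re = e/μ`, `be = 0`, `p₀c = 0`, `p₀M = 0` so `φ(Rc) = 0`; `RM = μR − 1`). -/
theorem stub_dressedEigenvectors :
    ∀ (E : Type) [NormedAddCommGroup E] [NormedSpace ℂ E] [CompleteSpace E]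
      (t : E →L[ℂ] E) (e : E) (φ : E →L[ℂ] ℂ), φ e = 1 →
      ∀ (μ : ℂ), μ ≠ 0 →
        IsUnit (μ • (1 : E →L[ℂ] E) - ((1 : E →L[ℂ] E) - φ.smulRight e) * t * ((1 : E →L[ℂ] E) - φ.smulRight e)) →
        μ = φ (t e) + (φ.comp (t * ((1 : E →L[ℂ] E) - φ.smulRight e)))
              (Ring.inverse (μ • (1 : E →L[ℂ] E) - ((1 : E →L[ℂ] E) - φ.smulRight e) * t * ((1 : E →L[ℂ] E) - φ.smulRight e))
                (((1 : E →L[ℂ] E) - φ.smulRight e) (t e))) →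
        let q₀ : E →L[ℂ] E := (1 : E →L[ℂ] E) - φ.smulRight e
        let R : E →L[ℂ] E := Ring.inverse (μ • (1 : E →L[ℂ] E) - q₀ * t * q₀)
        let x : E := e + R (q₀ (t e))
        let ψ : E →L[ℂ] ℂ := φ + (φ.comp (t * q₀)).comp R
        t x = μ • x ∧ ψ.comp t = μ • ψ ∧ ψ x = 1 + (φ.comp (t * q₀)) (R (R (q₀ (t e)))) :=
  -- LANDED: p169256 (lead c8 wave 12, chapter T-end), `Theorems/BalabanIRBirComplexStableXYRTEndDressedEigenvectors.lean`
  TEnd.stub_dressedEigenvectors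

/-- **stub T4 (M, generic; pure algebra): the dressed rank-one projector and the power formula.**  If `t x = μx`, `ψ∘t = μψ` and
`ψ(x) ≠ 0` then `p = ψ(x)⁻¹·ψ(·)x` is idempotent, `tp = pt = μp`, and for `n ≥ 1`: `tⁿ = μⁿp + ((1−p)t(1−p))ⁿ` (the cross terms of
`(tp + tq)ⁿ` vanish since `pq = qp = 0`, and `(tq)ⁿ = (qtq)ⁿ` since `tq = qt`, `q² = q`). -/
theorem stub_projectorPowers :
    ∀ (E : Type) [NormedAddCommGroup E] [NormedSpace ℂ E]
      (t : E →L[ℂ] E) (x : E) (ψ : E →L[ℂ] ℂ) (μ : ℂ), t x = μ • x → ψ.comp t = μ • ψ → ψ x ≠ 0 →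
        let p : E →L[ℂ] E := (ψ x)⁻¹ • ψ.smulRight x
        p * p = p ∧ t * p = μ • p ∧ p * t = μ • p ∧
        ∀ n : ℕ, 1 ≤ n → t ^ n = μ ^ n • p + (((1 : E →L[ℂ] E) - p) * t * ((1 : E →L[ℂ] E) - p)) ^ n :=
  -- LANDED: p169351 (lead c8 wave 12, chapter T-end), `Theorems/BalabanIRBirComplexStableXYRTEndProjectorPowers.lean`
  TEnd.stub_projectorPowers

/-- **stub T5 (M, generic; estimates): the dressed projector is close and the complement block stays contracting.**  With
`‖e‖, ‖φ‖ ≤ 1`, `φ e = 1`, perturbation vectors `‖v‖, ‖w‖ ≤ δ ≤ 1/8`, `x = e + v`, `ψ = φ + w`, `p = ψ(x)⁻¹ψ(·)x`: `|ψ(x) − 1| ≤ 3δ`,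
`‖p − p₀‖ ≤ 16δ`, `‖(1−p)t(1−p)‖ ≤ ‖q₀tq₀‖ + 100δ(‖t‖+1) ≤ θ + 100δ(‖t‖+1) =: θ₁`, `‖((1−p)t(1−p))ⁿ‖ ≤ θ₁ⁿ`.  With T2–T4
(`v = Rc`, `w = b∘R`, `δ = 2ε/(1−θ)`): `‖tⁿ − μⁿp‖ ≤ θ₁ⁿ` for all `n ≥ 1`, uniformly — the 1-D endgame of S5a in regime 2. -/
theorem stub_complementDecay :
    ∀ (E : Type) [NormedAddCommGroup E] [NormedSpace ℂ E]
      (t : E →L[ℂ] E) (e : E) (φ : E →L[ℂ] ℂ) (v : E) (w : E →L[ℂ] ℂ) (θ δ : ℝ),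
      ‖e‖ ≤ 1 → ‖φ‖ ≤ 1 → φ e = 1 → 0 ≤ δ → δ ≤ 1 / 8 → ‖v‖ ≤ δ → ‖w‖ ≤ δ →
      ‖((1 : E →L[ℂ] E) - φ.smulRight e) * t * ((1 : E →L[ℂ] E) - φ.smulRight e)‖ ≤ θ →
        let x : E := e + v
        let ψ : E →L[ℂ] ℂ := φ + w
        let p : E →L[ℂ] E := (ψ x)⁻¹ • ψ.smulRight x
        ‖ψ x - 1‖ ≤ 3 * δ ∧ ‖p - φ.smulRight e‖ ≤ 16 * δ ∧
        ‖((1 : E →L[ℂ] E) - p) * t * ((1 : E →L[ℂ] E) - p)‖ ≤ θ + 100 * δ * (‖t‖ + 1) ∧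
        ∀ n : ℕ, ‖(((1 : E →L[ℂ] E) - p) * t * ((1 : E →L[ℂ] E) - p)) ^ n‖ ≤ (θ + 100 * δ * (‖t‖ + 1)) ^ n :=
  -- LANDED: p169305 (lead c8 wave 12, chapter T-end), `Theorems/BalabanIRBirComplexStableXYRTEndComplementDecay.lean`
  TEnd.stub_complementDecay

/-- **stub T6 (S, generic): the dressed eigenvalue is real under a conjugation symmetry.**  If the Feshbach map `G` satisfies
`G(z̄) = conj G(z)` on the disc `|z − 1| ≤ ρ` (which (R)∧(P) — `J`-pseudo-Hermiticity of the transfer operator with `Je = e`,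
`φ∘J = conj∘φ` — provides) and `μ` is its unique fixed point there, then `μ ∈ ℝ` (and `μ > 0` as `|μ − 1| ≤ ρ < 1`): no dominant
complex-conjugate pair, hence no sign change of the real `Z_M` as `M → ∞` — the mechanism the planner's `why_might_fail` feared is
excluded at the level of the effective chain. -/
theorem stub_muReal :
    ∀ (G : ℂ → ℂ) (ρ : ℝ) (μ : ℂ), (∀ z : ℂ, ‖z - 1‖ ≤ ρ → G (conj z) = conj (G z)) →
      (‖μ - 1‖ ≤ ρ ∧ μ = G μ) → (∀ z : ℂ, ‖z - 1‖ ≤ ρ ∧ z = G z → z = μ) → μ.im = 0 :=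
  -- LANDED: p169115 (lead c8 wave 12, chapter T-end), `Theorems/BalabanIRBirComplexStableXYRTEndMuReal.lean`
  TEnd.stub_muReal


/-- **stub T7 (lead c8; assembly of T1–T5): the T-end lemma — power asymptotics uniform in the exponent.**  For a bounded operator `t`
on a complex Banach space with block data relative to a rank-one idempotent `p₀ = φ(·)e` (`‖e‖,‖φ‖ ≤ 1`, `φe = 1`) satisfying
`‖q₀tq₀‖ ≤ θ < 1`, `‖φ∘t∘q₀‖, ‖q₀te‖, |φ(te) − 1| ≤ ε`, `16ε ≤ 1 − θ`: there are `μ` (`|μ−1| ≤ 2ε`, the Feshbach fixed point) and a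
rank-one idempotent `p` with `tp = pt = μp`, `‖p − p₀‖ ≤ 32ε/(1−θ)`, and `‖tⁿ − μⁿp‖ ≤ (θ + 200ε(‖t‖+1)/(1−θ))ⁿ` for ALL `n ≥ 1`.
The endgame of S5a in regime 2 (`M ≫ KL²`) on the effective rotor chain. -/
theorem stub_tEndPowerAsymptotics :
    ∀ (E : Type) [NormedAddCommGroup E] [NormedSpace ℂ E] [CompleteSpace E]
      (t : E →L[ℂ] E) (e : E) (φ : E →L[ℂ] ℂ) (θ ε : ℝ),
      ‖e‖ ≤ 1 → ‖φ‖ ≤ 1 → φ e = 1 → 0 ≤ θ → θ < 1 → 0 ≤ ε → 16 * ε ≤ 1 - θ →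
      ‖((1 : E →L[ℂ] E) - φ.smulRight e) * t * ((1 : E →L[ℂ] E) - φ.smulRight e)‖ ≤ θ →
      ‖φ.comp (t * ((1 : E →L[ℂ] E) - φ.smulRight e))‖ ≤ ε →
      ‖((1 : E →L[ℂ] E) - φ.smulRight e) (t e)‖ ≤ ε → ‖φ (t e) - 1‖ ≤ ε →
      ∃ (μ : ℂ) (p : E →L[ℂ] E), ‖μ - 1‖ ≤ 2 * ε ∧
        μ = φ (t e) + (φ.comp (t * ((1 : E →L[ℂ] E) - φ.smulRight e)))
          (Ring.inverse (μ • (1 : E →L[ℂ] E) - ((1 : E →L[ℂ] E) - φ.smulRight e) * t * ((1 : E →L[ℂ] E) - φ.smulRight e))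
            (((1 : E →L[ℂ] E) - φ.smulRight e) (t e))) ∧
        p * p = p ∧ t * p = μ • p ∧ p * t = μ • p ∧ ‖p - φ.smulRight e‖ ≤ 32 * ε / (1 - θ) ∧
        ∀ n : ℕ, 1 ≤ n → ‖t ^ n - μ ^ n • p‖ ≤ (θ + 200 * ε / (1 - θ) * (‖t‖ + 1)) ^ n :=
  -- LANDED: p169526 (lead c8, chapter T-end assembly), `Theorems/BalabanIRBirComplexStableXYRTEndPowerAsymptotics.lean`
  TEnd.stub_tEndPowerAsymptotics

/-- **stub T8 (lead c8; T2 + T6): the dressed eigenvalue is real** when the Feshbach map commutes with complex conjugation on the disc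
(`J`-pseudo-Hermiticity of the chain from (R)∧(P)): no dominant complex-conjugate pair, no sign change of `Z_M` as `M → ∞`. -/
theorem stub_tEndMuReal :
    ∀ (E : Type) [NormedAddCommGroup E] [NormedSpace ℂ E] [CompleteSpace E]
      (t : E →L[ℂ] E) (e : E) (φ : E →L[ℂ] ℂ) (θ ε : ℝ),
      0 ≤ θ → θ < 1 → 0 ≤ ε → 4 * ε ≤ 1 - θ →
      ‖((1 : E →L[ℂ] E) - φ.smulRight e) * t * ((1 : E →L[ℂ] E) - φ.smulRight e)‖ ≤ θ →
      ‖φ.comp (t * ((1 : E →L[ℂ] E) - φ.smulRight e))‖ ≤ ε →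
      ‖((1 : E →L[ℂ] E) - φ.smulRight e) (t e)‖ ≤ ε → ‖φ (t e) - 1‖ ≤ ε →
      (∀ z : ℂ, ‖z - 1‖ ≤ 2 * ε →
        φ (t e) + (φ.comp (t * ((1 : E →L[ℂ] E) - φ.smulRight e)))
          (Ring.inverse ((starRingEnd ℂ) z • (1 : E →L[ℂ] E) - ((1 : E →L[ℂ] E) - φ.smulRight e) * t * ((1 : E →L[ℂ] E) - φ.smulRight e))
            (((1 : E →L[ℂ] E) - φ.smulRight e) (t e))) =
        (starRingEnd ℂ) (φ (t e) + (φ.comp (t * ((1 : E →L[ℂ] E) - φ.smulRight e)))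
          (Ring.inverse (z • (1 : E →L[ℂ] E) - ((1 : E →L[ℂ] E) - φ.smulRight e) * t * ((1 : E →L[ℂ] E) - φ.smulRight e))
            (((1 : E →L[ℂ] E) - φ.smulRight e) (t e))))) →
      ∀ (μ : ℂ), ‖μ - 1‖ ≤ 2 * ε →
        μ = φ (t e) + (φ.comp (t * ((1 : E →L[ℂ] E) - φ.smulRight e)))
          (Ring.inverse (μ • (1 : E →L[ℂ] E) - ((1 : E →L[ℂ] E) - φ.smulRight e) * t * ((1 : E →L[ℂ] E) - φ.smulRight e))
            (((1 : E →L[ℂ] E) - φ.smulRight e) (t e))) →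
        μ.im = 0 :=
  -- LANDED: p169526 (lead c8, chapter T-end assembly), `Theorems/BalabanIRBirComplexStableXYRTEndPowerAsymptotics.lean`
  TEnd.stub_tEndMuReal

/-- **stub T9 (M, generic): the trace is dominated by dimension × operator norm** on a finite-dimensional complex Hilbert space
(`tr A = Σ_i ⟪b_i, A b_i⟫` in an orthonormal basis, `|⟪b_i, Ab_i⟫| ≤ ‖A‖`).  Turns T7's operator estimate into
`|Tr tⁿ − μⁿ| ≤ d·θ₁ⁿ` on a `d`-sector truncation of the rotor chain. -/
theorem stub_traceNormBound :
    ∀ (E : Type) [NormedAddCommGroup E] [InnerProductSpace ℂ E] [FiniteDimensional ℂ E] (A : E →L[ℂ] E),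
      ‖LinearMap.trace ℂ E (A : E →ₗ[ℂ] E)‖ ≤ (Module.finrank ℂ E : ℝ) * ‖A‖ :=
  -- LANDED: p169670 (lead c8 wave 13), `Theorems/BalabanIRBirComplexStableXYRTEndTraceNormBound.lean`
  TEnd.stub_traceNormBound

/-- **stub T10 (S, generic): the dressed rank-one projector has trace one** (`tr(ψ(·)x) = ψ(x)`). -/
theorem stub_traceRankOne :
    ∀ (E : Type) [NormedAddCommGroup E] [InnerProductSpace ℂ E] [FiniteDimensional ℂ E] (x : E) (ψ : E →L[ℂ] ℂ),
      ψ x ≠ 0 → LinearMap.trace ℂ E (((ψ x)⁻¹ • ψ.smulRight x : E →L[ℂ] E) : E →ₗ[ℂ] E) = 1 :=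
  -- LANDED: p169677 (lead c8 wave 13), `Theorems/BalabanIRBirComplexStableXYRTEndTraceRankOne.lean`
  TEnd.stub_traceRankOne

/-- **stub T11 (lead c8; T7 rank-one form + T9 + T10): trace asymptotics of the perturbed chain.**  On a finite-dimensional complex
Hilbert space, under the T-end hypotheses: `|tr tⁿ − μⁿ| ≤ (dim E)·θ₁ⁿ` for all `n ≥ 1` with `μ` the Feshbach fixed point — with T8
(`μ` real, `> 1 − 2ε`) and `θ₁ < μ` the truncated chain's partition function keeps its sign for every length `n ≥ n₀(dim E)`. -/
theorem stub_tEndTraceAsymptotics :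
    ∀ (E : Type) [NormedAddCommGroup E] [InnerProductSpace ℂ E] [FiniteDimensional ℂ E]
      (t : E →L[ℂ] E) (e : E) (φ : E →L[ℂ] ℂ) (θ ε : ℝ),
      ‖e‖ ≤ 1 → ‖φ‖ ≤ 1 → φ e = 1 → 0 ≤ θ → θ < 1 → 0 ≤ ε → 16 * ε ≤ 1 - θ →
      ‖((1 : E →L[ℂ] E) - φ.smulRight e) * t * ((1 : E →L[ℂ] E) - φ.smulRight e)‖ ≤ θ →
      ‖φ.comp (t * ((1 : E →L[ℂ] E) - φ.smulRight e))‖ ≤ ε →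
      ‖((1 : E →L[ℂ] E) - φ.smulRight e) (t e)‖ ≤ ε → ‖φ (t e) - 1‖ ≤ ε →
      ∃ μ : ℂ, ‖μ - 1‖ ≤ 2 * ε ∧
        μ = φ (t e) + (φ.comp (t * ((1 : E →L[ℂ] E) - φ.smulRight e)))
          (Ring.inverse (μ • (1 : E →L[ℂ] E) - ((1 : E →L[ℂ] E) - φ.smulRight e) * t * ((1 : E →L[ℂ] E) - φ.smulRight e))
            (((1 : E →L[ℂ] E) - φ.smulRight e) (t e))) ∧
        ∀ n : ℕ, 1 ≤ n →
          ‖LinearMap.trace ℂ E ((t ^ n : E →L[ℂ] E) : E →ₗ[ℂ] E) - μ ^ n‖ ≤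
            (Module.finrank ℂ E : ℝ) * (θ + 200 * ε / (1 - θ) * (‖t‖ + 1)) ^ n :=
  -- LANDED: p170458 (lead c8 T11), `Theorems/BalabanIRBirComplexStableXYRTEndTraceAsymptotics.lean`
  TEnd.stub_tEndTraceAsymptotics

/-- **stub T12 (M, generic): a conjugation symmetry of the chain makes the Feshbach map conj-covariant** (the hypothesis of T8).
If a continuous conjugate-linear `J` fixes `e`, intertwines `φ` with complex conjugation and commutes with `t`, then `J` commutes
with `p₀ = φ(·)e`, `q₀`, `M = q₀tq₀`, fixes `c = q₀te`, satisfies `b∘J = conj∘b` for `b = φ∘t∘q₀`, and `J R(z) = R(z̄) J` for the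
resolvents; hence `G(z̄) = conj G(z)` for the Feshbach map `G(z) = φ(te) + b R(z) c`.  (In the crux `J` is the (R)∧(P) time-reflection
× inversion symmetry of the effective chain, B2a/B2b.) -/
theorem stub_feshbachConjOfJ :
    ∀ (E : Type) [NormedAddCommGroup E] [NormedSpace ℂ E] (t : E →L[ℂ] E) (e : E) (φ : E →L[ℂ] ℂ) (J : E →L⋆[ℂ] E),
      J e = e → (∀ y : E, φ (J y) = (starRingEnd ℂ) (φ y)) → (∀ y : E, J (t y) = t (J y)) →
      ∀ z : ℂ,
        IsUnit (z • (1 : E →L[ℂ] E) - ((1 : E →L[ℂ] E) - φ.smulRight e) * t * ((1 : E →L[ℂ] E) - φ.smulRight e)) →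
        IsUnit ((starRingEnd ℂ) z • (1 : E →L[ℂ] E) - ((1 : E →L[ℂ] E) - φ.smulRight e) * t * ((1 : E →L[ℂ] E) - φ.smulRight e)) →
        φ (t e) + (φ.comp (t * ((1 : E →L[ℂ] E) - φ.smulRight e)))
          (Ring.inverse ((starRingEnd ℂ) z • (1 : E →L[ℂ] E) - ((1 : E →L[ℂ] E) - φ.smulRight e) * t * ((1 : E →L[ℂ] E) - φ.smulRight e))
            (((1 : E →L[ℂ] E) - φ.smulRight e) (t e))) =
        (starRingEnd ℂ) (φ (t e) + (φ.comp (t * ((1 : E →L[ℂ] E) - φ.smulRight e)))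
          (Ring.inverse (z • (1 : E →L[ℂ] E) - ((1 : E →L[ℂ] E) - φ.smulRight e) * t * ((1 : E →L[ℂ] E) - φ.smulRight e))
            (((1 : E →L[ℂ] E) - φ.smulRight e) (t e)))) :=
  -- LANDED: p170556 (lead c8 wave 14), `Theorems/BalabanIRBirComplexStableXYRTEndFeshbachConjOfJ.lean`
  TEnd.stub_feshbachConjOfJ

end TEnd


/-! ## Composition -/

/-- S5a and S5b composed by the LANDED infrared endgame (p131204): the engine's output on the (I3) subclass. -/
theorem singleRegime_I3 :
    ∀ (r : ℕ) (B c₀ : ℝ), 2 ≤ r → 0 < c₀ → ∃ K₀ : ℝ, ∃ L₀ : ℕ, ∃ C : ℝ, ∀ K : ℝ, K₀ ≤ K → ∀ c : Table r, (∀ n ∈ c.support, ∑ w, n w = 0) → c.sum (fun _ a => a) = 0 → normA c ≤ B → (∀ φ : W r → ℝ, c₀ * ∑ w, ∑ w', (1 - Real.cos (φ w - φ w')) ≤ (genF c φ).re) → (∀ n : Freq r, c (fun w => n (w.1, w.2.1, Fin.rev w.2.2)) = (starRingEnd ℂ) (c (-n))) → (∀ n : Freq r, c (fun w => n (Fin.rev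 w.1, Fin.rev w.2.1, w.2.2)) = c n) → (∀ v : W r → ℝ, c.sum (fun n a => a.im * (∑ w, (n w : ℝ) * v w) ^ 2) = 0) → ∀ (L M : ℕ) [NeZero L] [NeZero M], L₀ ≤ L → L ≤ M → Even L → Even M → 0 < (partZ K c L M).re ∧ (∫ θ in cube L M, ((((∑ x : TorusSite 2 L, ∑ y : TorusSite 2 L, (1 - Real.cos (θ (x, 0) - θ (y, 0)))) / (L : ℝ) ^ 4 : ℝ)) : ℂ) * Complex.exp (-(action K c L M θ))).re ≤ C / (c₀ * K) * (partZ K c L M).re :=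
  singleRegimeI3_of_positivity_of_infrared stub_complexPositivityI3 stub_complexInfraredBound

/-- The previous stub S5 `stub_singleRegimeRG` (leads a4–c5: "the single-regime RG given every scale-0 input") is now a
corollary of S5a/S5b: its antecedents S2, S3, S4, S6, S7 are landed theorems and its conclusion is `singleRegime_I3`. -/
theorem stub_singleRegimeRG :
    (∀ (r : ℕ) (c₀ K : ℝ) (c : Table r), 0 ≤ c₀ → 0 ≤ K → (∀ φ : W r → ℝ, c₀ * ∑ w, ∑ w', (1 - Real.cos (φ w - φ w')) ≤ (genF c φ).re) → ∀ φ : W r → ℝ, ‖Complex.exp (-((K : ℂ) * genF c φ))‖ ≤ Real.exp (-(2 * c₀ * K / Real.pi ^ 2) * ∑ w, ∑ w', (toIocMod Real.two_pi_pos (-Real.pi) (φ w - φ w')) ^ 2)) → (∀ (r : ℕ) (B c₀ K : ℝ) (c : Table r), 0 < B → 0 ≤ c₀ → 0 ≤ K → (∀ n ∈ c.support, ∑ w, n w = 0) → normA c ≤ B → (∀ φ : W r → ℝ, c₀ * ∑ w, ∑ w', (1 - Real.cos (φ w - φ w')) ≤ (genF c φ).re) → ∀ φ : W r → ℝ, (∀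 w w' : W r, |φ w - φ w'| ≤ Real.pi) → ‖Complex.exp (-((K : ℂ) * genF c φ))‖ ≤ Real.exp (-(2 * c₀ * (r : ℝ) ^ 3 / (Real.pi ^ 2 * B)) * K * (-c.sum (fun n a => a * (((∑ w, (n w : ℝ) * φ w) ^ 2 : ℝ) : ℂ))).re)) → (∀ (ι : Type) [Fintype ι] [DecidableEq ι] (Q D : Matrix ι ι ℝ) (ε : ℝ) (k : ℕ), 0 < ε → ε ≤ 1 → Q.PosDef → D.PosSemidef → ((1 - ε) • Q - D).PosSemidef → D.rank ≤ k → ε ^ k * Q.det ≤ (Q - D).det) → (∀ (r : ℕ) (φ : W r → ℝ) (w₁ w₂ w₃ w₄ : W r), w₁ ≠ w₂ → w₁ ≠ w₃ → w₁ ≠ w₄ → w₂ ≠ w₃ → w₂ ≠ w₄ → w₃ ≠ w₄ → ∃ q : ℤ, toIocMod Real.two_pi_pos (-Real.pi) (φ w₁ - φ w₂) + toIocMod Real.two_pi_pos (-Real.pi) (φ w₂ - φ w₃) + toIocMod Real.two_pi_pos (-Real.pi) (φ w₃ - φ w₄) + toIocMod Real.two_pi_pos (-Real.pi) (φ w₄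 - φ w₁) = 2 * Real.pi * q ∧ 2 * Real.pi ^ 2 * (q : ℝ) ^ 2 ≤ ∑ w, ∑ w', (toIocMod Real.two_pi_pos (-Real.pi) (φ w - φ w')) ^ 2) → (∀ (r : ℕ) (B c₀ K p : ℝ) (c : Table r), 0 < B → 0 < c₀ → 0 ≤ K → 0 ≤ p → (∀ n ∈ c.support, ∑ w, n w = 0) → c.sum (fun _ a => a) = 0 → normA c ≤ B → (∀ φ : W r → ℝ, c₀ * ∑ w, ∑ w', (1 - Real.cos (φ w - φ w')) ≤ (genF c φ).re) → ∀ φ : W r → ℝ, (∀ w w' : W r, |φ w - φ w'| ≤ Real.pi) → (∃ w w' : W r, p ≤ |φ w - φ w'|) → ‖Complex.exp (-((K : ℂ) * genF c φ))‖ ≤ Real.exp (-(K / 2) * (-c.sum (fun n a => a * (((∑ w, (n w : ℝ) * φ w) ^ 2 : ℝ) : ℂ))).re) * Real.exp ((1 - 2 * c₀ * (r : ℝ) ^ 3 / (Real.pi ^ 2 * B)) * (K / 2) * (-c.sum (fun n a => a * (((∑ w, (n w : ℝ) * φ w) ^ 2 : ℝ) : ℂ))).re) * Real.exp (-(2 *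 c₀ * (r : ℝ) ^ 3 / (Real.pi ^ 2 * B) * c₀ * K * p ^ 2))) → ∀ (r : ℕ) (B c₀ : ℝ), 2 ≤ r → 0 < c₀ → ∃ K₀ : ℝ, ∃ L₀ : ℕ, ∃ C : ℝ, ∀ K : ℝ, K₀ ≤ K → ∀ c : Table r, (∀ n ∈ c.support, ∑ w, n w = 0) → c.sum (fun _ a => a) = 0 → normA c ≤ B → (∀ φ : W r → ℝ, c₀ * ∑ w, ∑ w', (1 - Real.cos (φ w - φ w')) ≤ (genF c φ).re) → (∀ n : Freq r, c (fun w => n (w.1, w.2.1, Fin.rev w.2.2)) = (starRingEnd ℂ) (c (-n))) → (∀ n : Freq r, c (fun w => n (Fin.rev w.1, Fin.rev w.2.1, w.2.2)) = c n) → (∀ v : W r → ℝ, c.sum (fun n a => a.im * (∑ w, (n w : ℝ) * v w) ^ 2) = 0) → ∀ (L M : ℕ) [NeZero L] [NeZero M], L₀ ≤ L → L ≤ M → Even L → Even M → 0 < (partZ K c L M).re ∧ (∫ θ in cube L M, (((∑ x : TorusSite 2 L, ∑ y : TorusSite 2 L, (1 - Real.cos (θ (x, 0) - θ (y, 0))))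 / (L : ℝ) ^ 4 : ℝ) : ℂ) * Complex.exp (-(action K c L M θ))).re ≤ C / (c₀ * K) * (partZ K c L M).re :=
  fun _ _ _ _ _ => singleRegime_I3

/-- **Composition: the line closes the crux by name** (modulo the registered stubs S5a, S5b), through the LANDED glue
`Theorems.birComplexStableXYR_of_singleRegimeI3` (p129739, lead c5): (I3) is removed by the cubic normal form S1
(`FatGaussian.stub_cubicNormalForm`, same action ⇒ same `Z` and deficit integral, budget `C_r·B`), then
`Theorems.stub_splitGlueR3` (child 1 = positivity at `r ≥ 3`; child 2 = the quantitative slice deficit at `r ≥ 2`;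
`Im Z = 0` by (R)-reality; threshold `K ≥ 2C/c₀`). -/
theorem BirComplexStableXYR_of : BirComplexStableXYR :=
  birComplexStableXYR_of_singleRegimeI3 singleRegime_I3

end Summit.HubbardSuperconductivity.HubbardSuperconductivity.Cruxes.BirComplexStableXYR.Lines.FatGaussianDefectCalculus

end
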